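import Literature.MathematicalPhysics.QuantumFieldTheory.Balaban1983to89.T4BoundaryRateCollar

/-!
# T4BoundaryRateFrame — §13 of `T4BoundaryRate`, a SECOND SATELLITE LEAF: THE EXPONENTIAL LAYERED MODEL — a genuinely NON-AFFINE
fluctuation chart on layered complex carriers with LAYER-DEPENDENT radius coefficients, on which §12f's path hypothesis (F-P)
`FramePath` is DERIVED (not posited) from one NAMED smallness binder, the three encoding shapes (F-Ch)/(F-Co)/(F-An) hold, and
§12's `MarginCauchy` (`c₀ = 2`), `CollarDecay` (normalized gauge) and §12g's `fluctDampedOne_of_collar_normalized` (`ρ = 2`) are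
INSTANTIATED on the printed radius factors of [III] (2.34)–(2.37), (2.39) — with the fit proved NECESSARY, and the halving of p. 277 read
off as a bound on the displacement's per-layer decay (cell `pub-balaban`, T4-DAG §5 row T4-U3.E, spine estimate NE5,
boundary-functional member — fan-out prover P3, lineage t4-ne5-p3 gen 9–11; [folklore] kernel mathematics about the typed shapes of
`T4BoundaryRateCollar` §12/§12e/§12f/§12g/§12h, imported and used BY NAME; nothing of the parent or of the first satellite is modified;
v1.3).

HONEST FRAMING (T4-DAG PAGE 1; identical to the parent's).  The cell's T4 target is rung (B)+1: existence AND uniqueness of the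
ε → 0 limit of Bałaban's unit-scale averaged loop expectations on a FIXED finite torus — strictly beyond ultraviolet stability,
NOT infinite volume, NOT a mass gap, NOT the Clay problem.  The boundary-functional member `T4BoundaryCarrier.NE5B` of the spine
estimate NE5 is a TWO-RUN statement and NOTHING OF IT IS PRINTED: the manuscripts under audit construct ONE run.  THIS MODULE IS
A MODEL: its carriers, chart, frame, gauges, radii and tables are TOY OBJECTS defined below (finitely many complex layers), NOT
Bałaban's spaces (2.34)–(2.39) and NOT an instantiation on them; every `theorem` is kernel-checked undergraduate complex analysis
about these toy objects and the imported hypothesis SHAPES.  What a model certifies is INHABITATION and COST: the shapes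
(F-Ch), (F-Co), (F-An), (F-P), `CollarDecay`, `GapShape` are JOINTLY inhabited by a non-affine chart with layer-dependent
coefficients, (F-P) holding BECAUSE OF an explicit inequality between radii, displacement and gaps (`PathFits`) and ONLY because
of it (`exp_framePath_iff`).  The audited manuscripts are quoted for CONTEXT only, by page, from the ×2 renders read as images
([I] = [Balaban1987RG1] pp. 270–273, renders p022–p025; [III] = [Balaban1988Convergent] pp. 259, 261, 277, renders p017, p019,
p035; [B7] = [Balaban1985Averaging] pp. 22, 42, renders `1985-cmp98-averaging` p006, p026 — v1.3);
no disputed step of theirs is used, and the dictionary "toy object ↔ printed object" below is an ANALOGY that asserts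
nothing.  NOT summit progress.

THE DICTIONARY (analogy only).  Layers `n = 0, …, N` ↔ print's layers `X∩(Ω_n∖Ω_{n+1})`, each with its own unit `Lⁿξ` and
coefficient `α_{·,n}` ((2.28) p. 259 *"α_{0,j} = g_jC₀(log g_j⁻²)^{q₀}, α_{1,j} = g_jC₁(log g_j⁻²)^{q₁}"*); the radius
`R j n` of the layer `n` in the space of index `j` ↔ the factor of (2.34) *"|∂U − 1|, |∂𝐔 − 1| < (1 − β(1 − 2^{−(j−n)}))α_{0,n}ξ²(Lⁿξ)^{−2}"*,
typed `printedR a β α j n = a·B14Radii.shrink β (j − n)·α n`; the step creating `X` displaces the layer `m ≤ scale X` of an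
encoded background `z` MULTIPLICATIVELY, `z_m ↦ z_m·exp(𝒜·δ^{scale X − m})`, amplitude `‖𝒜‖ ≤ s`, the older the layer the smaller
the displacement ↔ p. 277 *"The localization of the fluctuation field, and the exponential decay of the minimizing function 𝐇_k
imply that this difference is still much greater than bounds on this function."*; the amplitude path `t ↦ (z_m·exp(t𝒜·δ^{scale X − m}))_m`,
`t ∈ [0,1]`, CURVED in the encoding ↔ print's real interpolation (3.4) p. 270 *"= ∫₀¹ dt (d/dt) 𝐄^{(j)}(U_j(exp iQ_j(ηt𝐇_k(B′))Ū^j_{k+1}))"*,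
p. 271 *"Q_j(ηt𝐇_k(B′)) = B(t)"*, group-valued and not a chord; its velocity ↔ print's `δ𝐇_j` of (3.8), of which p. 271 says
*"In the case when dist^{(ξ)}(X, □) ≥ M(Lʲη)^{−1}, this function satisfies the bound"* (3.9) *"|δ𝐇_j| ≤ B₃ exp(−½δ₀ dist^{(ξ)}(X, □)
− ½δ₀M(Lʲη)^{−1}) × 2Lʲη|ζ_□𝐇_k(B′)| on X,"* *"and the same for derivatives and the second order operators applied to it"* (in
the second of p. 271's two cases, a big domain `X`, p. 273: *"The only difference is that we do not have the exponential factors in (3.9),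
(3.17) connected with the decay rate of the functional derivative (δ/δB)𝐇_j."*); the FIT `PathFits` ↔ the two sentences that keep
print's path inside the parent's space with room for the circles, p. 273 *"We assume also that ε₁ is so small that 𝐇_j(B(t))
satisfies (3.14) with 1/3α₂ on the right-hand side."* and p. 277 *"This is the reason for putting the powers of 1/2 in the
conditions (2.36)–(2.39). The analyticity domains become smaller after each step, but the difference is very small and
exponentially decreasing in the number of steps."*; the admissible tables `ExpAdmT` (real components of ONE function complex
differentiable on the index-`Y` polydisc) ↔ (2.41)(ii) p. 261.

CONTENT.  §13a the model: carriers `layCarriers N` (pieces = layers `Fin (N+1)`, `scale = id`, backgrounds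
`(Fin (N+1) → ℂ) × Fin 2`), generation `expGeneration` (every older layer a parent), chart `expChart N δ s R`, frame `expFrame`
(layer seminorms `‖v_n‖`, encoded domains the open polydiscs `polydisc N R j`), gauges `expGauge` (= `4·‖U′_n − U_n‖`) and
`chordGauge` (= `‖U′_n − U_n‖`), class `ExpAdmT`, the fit `PathFits N R gap δ s := ∀ Y < X, ∀ m ≤ Y, R X m·e^{s δ^{X−m}} +
gap X Y (Y − m) ≤ R Y m`.  §13b the shapes: (F-Ch) `exp_frameChart`, (F-Co) `exp_frameCore`, (F-An) `exp_frameAnalytic` by `rfl`-level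
bookkeeping; **(F-P) DERIVED** `exp_framePath` (`0 ≤ δ ≤ 1`, `s ≤ ½`, `PathFits` ⟹ `FramePath … (expGauge N) gap`): the path is
the restriction to `[0,1] ⊂ ℝ ⊂ ℂ` of the holomorphic amplitude map (`hasDerivAt_pi`, `HasDerivAt.cexp`, the chain rule through
`Complex.ofRealCLM` — the ℝ-structure on the encoding is `NormedSpace.complexToReal`, as in `FramePath`), its points are margin
points by the fit, its velocity is dominated layer-wise by the endpoint gauge through `‖w‖ ≤ 2‖e^w − 1‖` and `‖e^{tw}‖ ≤ 2`
(`‖w‖ ≤ ½`) — the factor `4`; the CHORD between the same endpoints is a path frame for the plain gauge under the same fit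
(`exp_framePath_chord`, via §12f's `framePath_of_segment`; factor `1`): (F-P) does not see which path is used, the constant is a
property of the pair (path, gauge), and a curved path read by an endpoint gauge costs a constant `> 1`.  §13c consequences:
`exp_marginCauchy` (`c₀ = 2`, by `marginCauchy_of_pathFrame`), `exp_collarDecay` (`R j n ≤ b·u n` ⟹ `CollarDecay` for the gauge
rescaled by `u` with `ε = 8bs`, rate `δ`: `‖z_m(e^w − 1)‖ ≤ 2‖z_m‖‖w‖`).  §13d non-vacuity: `zero_mem_core`, `real_mem_supp`, the
clip table `topTable` (admissible, bounded by the top radius, `topTable_abs_le`) whose inserted fluctuation difference at a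
one-layer background is `r·(e^{sδ^{X−Y}} − 1) > 0` (`topTable_fluct`, `topTable_fluct_pos`).  §13e THE PRINTED RADII:
`printedR`, the circles' half of the room `printedGap N a β α X Y j = (a/2)(shrink β j − shrink β (X − Y + j))·α (Y − j)` (the gap
literal of §12g's `gapShape_of_shrink_normalized` with `a/2`), **`printed_pathFits`** (`0 < a`, `0 ≤ β ≤ 1`, `α > 0`, `0 ≤ δ ≤ ½`,
`0 ≤ s ≤ β/4`: `shrink·(e^{sδ^k} − 1) ≤ 2sδ^k ≤ s·2^{−(Y−m)} ≤ ½·(shrink β (Y−m) − shrink β (X−m))`, the last by the halving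
`shrink β p − shrink β (p+1) = β·2^{−(p+1)}` of `B14Radii.shrink_sub_succ`), `printed_collarDecay` (`ε = 8as` in coefficient units),
`printed_marginCauchy`, and **END-TO-END `printed_fluctDampedOne`**: for `0 < β ≤ 1`, `0 ≤ δ ≤ ½`, `0 ≤ s ≤ β/64` the model satisfies
§10's `FluctDampedOne` with the profile `layeredSigma (64s/β) δ 2` — through `fluctDampedOne_of_collar_normalized` with `ρ = 2`
EXACTLY and layer-dependent `α`; `printed_fluct_witness` exhibits a core background with nonzero inserted difference, so the
profile bounds something.  §13f SHARPNESS: `pathFits_of_framePath` — for positive radii and nonnegative gaps (F-P) FORCES the fit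
(the endpoint `t = 1` of any admissible path is a margin point; test it on a one-layer background of modulus just below `R X m`
against the gap vector on that layer), hence **`exp_framePath_iff`**; and `half_of_printed_pathFits_all` — on the printed radii
with `β < 1` and any fixed `s > 0`, the fit at ALL depths `N` forces `δ ≤ ½`: the displacement's per-layer decay ratio cannot
exceed print's halving ratio of the margins (from the top collar: `(1 − β)s(2δ)^N ≤ β/2` for every `N`, and `(2δ)^N` is
unbounded when `2δ > 1`, `pow_unbounded_of_one_lt`) — the model's quantitative face of p. 277's two sentences, and the same
constraint `δρ ≤ 1` that §12's `fluctDampedOne_of_collar` carries for summability, here forced by the margins alone.  §13g (v1.1)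
THE MARGINS BY NAME: the polydiscs are convex (`convex_polydisc`); (F-M) ⟺ the STATIC fit `R X m + gap X Y (Y − m) ≤ R Y m`
(`StaticFits`, `exp_frameMargin_iff_staticFits`) and §12h's (F-E) ⟺ the fit (`exp_frameEndMargin_iff_pathFits`; positive radii,
nonnegative gaps, `0 ≤ δ`, `0 ≤ s`), so §13f's chord path frame is §12h's `framePath_of_convex` instantiated
(`exp_framePath_convex`, the same statement as `exp_framePath_chord`), `exp_framePath_chord_iff_margins` is §12h's equivalence
verbatim, and on this model (F-E), (F-P) for the chord (`exp_frameEndMargin_iff_framePath_chord`), (F-P) for the endpoint gauge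
(`exp_frameEndMargin_iff_framePath_exp`, `δ ≤ 1`, `s ≤ ½`) and `PathFits` are ONE condition, implying (F-M)
(`exp_frameMargin_of_frameEndMargin`).  §13h (v1.1) TWO NEGATIVE CONTROLS on the Cauchy carriers of §8: a frame with DISCONNECTED
encoded domains (two discs, one jumping amplitude) satisfying (F-Ch), (F-Co), (F-G), (F-M), (F-E) with nonempty amplitudes and
positive gaps for which (F-P) FAILS (`jump_not_framePath`, by the intermediate value theorem; `margins_not_framePath`) — §12h's
convexity binder is load-bearing — and a frame with connected NON-CONVEX encoded domains (an annulus, the rotation chart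
`z ↦ z·e^{i𝒜}`) for which (F-P) HOLDS by a curved path while the chord leaves the domain (`rot_framePath`, `rot_segment_fails`,
`annulus_not_convex`; `framePath_not_segment`) — without convexity (F-P) is more than the position of its endpoints, and print's
kind of curved path is then needed and can suffice.
§13i (v1.2) CONVEXITY BOUGHT BY SHRINKING: under a replacement of the encoded domains (`withDom`) the shapes (F-Ch)/(F-Co)/(F-G)
are unchanged, (F-M)/(F-E)/(F-P) are MONOTONE and (F-An) ANTITONE in the domains (`frameMargin_mono`, `frameEndMargin_mono`,
`framePath_mono`, `frameAnalytic_anti`; `marginCauchy_anti` in the admissible class), so a CONVEX INNER CORE `d ⊆ dom` carrying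
(F-M) and (F-E) gives (F-P) and `MarginCauchy` (`c₀ = 2`) for a NON-CONVEX encoding (`framePath_of_convexCore`,
`marginCauchy_of_convexCore`; neither §13h frame has such a core: `jump_no_convexCore`, `rot_no_convexCore`); on the layered model
the `2πi`-periodic «plaquette-like» domains `{‖exp(v_m) − 1‖ < r j m}` are never convex (all radii, `plaqdisc_not_convex'` —
v1.3) and for radii `≤ 1` not connected (`plaqdisc_not_isPreconnected`), contain the convex polydiscs of the exact inner radii `log(1 + r)`
(`polydisc_logR_subset`, `logR_sharp`), and the plaquette frame `plaqFrame` (core = `expFrame` at the shrunk radii, `plaqFrame_core`)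
has (F-P) for the chord and `MarginCauchy` for tables analytic on the non-convex domains from the fit at the shrunk radii
(`plaq_framePath`, `plaq_marginCauchy`), the loss being at most a factor `2` of the margins for `r ≤ 1` (`half_le_logR`,
`pathFits_logR_of_half`).

HAND-OFF (record §13; which binders of §12f's `ne5B_of_pathFrame` this model speaks to).  INHABITED here, jointly, by toy
objects: `FrameChart`, `FrameCore`, `FramePath` (derived from `PathFits`), `FrameAnalytic`, `CollarDecay` (normalized gauge),
`GapShape` with `ρ = 2` (printed radii, via §12g), hence `MarginCauchy` and `FluctDampedOne`.  UNTOUCHED, and unchanged in status: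
the two-run binders `TiltLip`, `OpDisc`, `RepresentsA/B` with both runs' admissibility, the regular inputs' `NE5`,
`EKernelContracts`, `SliceCountGrowing`, the set `W` — NOT PRINTED (the manuscripts construct one run) or typed elsewhere in the
cell; and the INSTANTIATION of the frame shapes on print's spaces (2.34)–(2.39) for one boundary-term family, which owes exactly:
an encoding `E` with (F-Ch)/(F-Co)/(F-An), a path (print's (3.4) or a chord) with the FIT — print's ε₁-smallness of p. 273, a
coupling-side conditional never displayed as an inequality; for a CONVEX encoding exactly the endpoint inclusion (F-E) (§12h, §13g),
for a non-convex one genuinely a path (§13h), unless a convex inner core carries the two inclusions at a named radius loss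
(§13i) — and a layer majorant of (3.9)'s right-hand side as the gauge with
its `CollarDecay` (the per-point decay (190) of [15] is DISPLAYED for one run; the per-collar constant is displayed nowhere).
NE5B stays NOT PRINTED, typed, conditional, never asserted.

SECONDARY CONTEXT (an exposition, not a source of any hypothesis): the AFFINE, single-domain form of the fit device is written
out for φ⁴₃ in [Dimock2013] §4.4 (pp. 27–28 of arXiv:1108.1335v2: Lemma 17 (213) and its proof (217)–(219); locator supplied by the
cell's literature seat, CLAIMS.log 2026-08-19T17:20:30Z) — the fluctuation is a member of a small multiple of the analyticity domain, so the
interpolated field stays in a fixed fraction of it and a Cauchy bound in the interpolation parameter follows; §12e's affine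
frame is the abstract form of that device, the present leaf its multi-layer, non-affine toy.

PRINT'S OWN COORDINATE DICTIONARY (one run; CONTEXT only, located for §13i — v1.3).  The passage between a GROUP coordinate
`|X − 1|` and the LIE-ALGEBRA coordinate `|log X|`, with its price, is printed for matrices in [B7] = [Balaban1985Averaging] p. 22:
*"We will need also inequalities of this type for arbitrary complex matrices X instead of U. For matrices X satisfying
|X − 1| ≦ ½, we have"* (26) *"|log X| ≦ Σ_{n=1}^{∞} (1/n)|X − 1|ⁿ ≦ |X − 1|/(1 − |X − 1|) ≦ 2|X − 1|"*, (27) *"|X − 1| = |e^{log X} − 1| ≦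
e^{|log X|} − 1 ≦ e^{|log X|}|log X| ≦ 2|log X|"* — the first inequality of (27) is, on the commuting scalar toy below, exactly the
inclusion `polydisc_logR_subset` (inner polydisc of radius `log(1 + r)`), and the factors `2` are the shadows `logR_le` /
`half_le_logR`; and [B7] takes the analyticity of its averaging operations in the Lie-algebra variable on a NORM BALL, the group
description being the alternative one, p. 42: *"Let us take a configuration U₀ satisfying (52) and U = U′U₀, U′ = e^{iηA′}, |A′|
bounded by a small constant α₁."* … *"This neighborhood may be also described by the conditions"* (158) *"|U − U₀| = |UU₀⁻¹ − 1| < α₁η"*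
… *"We will prove that Ū^k = \overline{U′U₀}^k is an analytic function of A′"*.  In [III] itself the complex directions of the
spaces of p. 261 ARE Lie-algebra fields — *"(i) 𝐔 = U′U, U has values in the group G"*, *"(iii) U′ = exp iξA′, A′ has values in the
algebra 𝐠^c,"* (2.39) *"Lⁿξ|A′|, (Lⁿξ)²|∇^ξ_U A′| < (1 − β(1 − 2^{−(j−n)}))α_{1,n}"* (render p019 re-read as an image for v1.3): seminorm
bounds, convex in `A′` for a fixed `G`-valued `U` — while (2.34)–(2.35) constrain the plaquette variables of `𝐔 = U′U` and of its
averages, i.e. WORDS in the `exp iξA′(b)` and the `U(b)`, nonlinear in `A′`.  CAVEAT (what does and does not survive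
non-commutativity; nothing is claimed about print's spaces): the INCLUSION half of §13i's toy device survives — in any Banach
algebra `‖exp a − 1‖ ≤ e^{‖a‖} − 1` and `‖a₀⋯a_{k−1} − 1‖ ≤ ∏(1 + ‖a_i − 1‖) − 1`, for conjugated exponential letters
`‖∏ W_i e^{B_i} W′_i − 1‖ ≤ e^{kβ} − 1` (tree theorems, BY NAME, not imported here: `Literature.Analysis.Calculus.norm_exp_sub_one_le`,
`…Balaban1983to89.B7Prop6Bound.prod_sub_one_norm_le`, `…B7Transfer.path_product_sub_one_le`, `…B7Eq167Flat.norm_dprod_sub_one_le`), so a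
word constraint `‖w − 1‖ < r` in letters `e^{A_i}` contains the CONVEX set `Σ‖A_i‖ < log(1 + r)` — a convex inner core at the loss
`log(1 + r)/k` per letter; what does NOT survive is the sharpness (`logR_sharp`), and whether the printed margins `β2^{−(j−n)}` of
(2.34)–(2.35) survive that loss given (2.39) is decided NOWHERE — not in print (ONE run; no such comparison is displayed), not here.
NOTHING about the convexity, connectedness or shape of (2.34)–(2.39) is claimed, and no encoding of them is proposed.

VERSIONS: v1 = p191344 (937 l.); v1.0.1 = this DOCFIX (docstrings only, every code token of v1 byte-identical): the header's
gloss of the big-domain case corrected to *the second of p. 271's two cases* (the two cases sit under the first condition of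
(3.5)); the shrink factor attributed letter-exactly to (2.34)–(2.37), (2.39) (cross-read nicety N1, C-pv16g18-2); the secondary
CONTEXT pointer above. Cross-reads of v1: kernel side C-t4r3-38 (ok, DOCFIX 0), print side C-pv16g18-2 (14/14 passages verbatim,
DOCFIX 0).  v1.1 = v1.0.1 + §13g + §13h appended (every code token of v1.0.1 byte-identical; header: this sentence, the two CONTENT
sentences §13g/§13h, one HAND-OFF clause, the Dimock locator); answers the cross-read of the first satellite's v1.5 (C-pv01-104:
O-1 ⟶ `exp_frameEndMargin_iff_pathFits`; O-2 ⟶ §13h's moral, orientation only).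
v1.2 = v1.1 + §13i appended (every code token of v1.1 byte-identical; header: the title's version / generation stamp, the CONTENT
sentence §13i, one HAND-OFF clause, six Mathlib names in the labels line, this sentence); cross-read of v1.1: C-adv8-93 (CLEAN,
DOCFIX 0); §13i is the typed face of C-pv01-104 O-2 on a model (orientation only; nothing of (2.34)–(2.39) claimed).
v1.3 = v1.2 + four theorems appended to §13i (`single_log_mem_plaqdisc`, `plaqdisc_not_convex_of_one_lt`, `plaqdisc_not_convex'`,
`plaq_dom_not_convex'`: the plaquette-like domains are non-convex for ALL positive radii — cross-read C-pv01-108 D-1; every code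
token of v1.2 byte-identical) and docstring changes: [B7]'s coordinate dictionary (p. 22 (26)–(27); p. 42 (158)) and [III] p. 261
(i)/(iii)/(2.39) quoted as CONTEXT in the header paragraph above and in the §13i text (renders [B7] p006 / p026 and [III] p019 read
as images), four tree theorems on words of exponentials named (not imported), cite list extended, C-pv01-108 D-2 (= the reader's
erratum E-pv01g19-1 of C-pv01-104 O-2's wording) folded in §13h's MORAL and §13i's HAND-OFF MORAL; cross-read of v1.2: C-pv01-108
(XREAD ok — CONSISTENT, ABSOLUTE-RULE 0, kernel objections 0, DOCFIX 2 LOW, both folded here).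

Labels: [folklore] = kernel-checked elementary analysis (Mathlib: `hasDerivAt_pi`, `HasDerivAt.cexp`, `Complex.norm_exp_sub_one_le`,
`Complex.norm_exp_sub_one_sub_id_le`, `Real.abs_exp_sub_one_le`, `Real.add_one_le_exp`, `pow_unbounded_of_one_lt`,
`intermediate_value_Icc`, `Complex.exp_pi_mul_I`, `Real.pi_le_four`, `Complex.norm_exp_sub_sum_le_exp_norm_sub_sum`,
`Real.one_sub_inv_le_log_of_pos`, `Real.log_le_sub_one_of_pos`, `Complex.exp_two_pi_mul_I`, `IsPreconnected.intermediate_value`,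
`DifferentiableOn.mono`); [bookkeeping] =
definitions of toy objects; CONTEXT = quotations locating the analogy.  Cell record `t4/T4-EST-U3-NE5B-P3.md` §13.
[cite: Balaban1987RG1, (3.4) p.270, (3.6)–(3.9) p.271, (3.14)–(3.17) p.272–273; Balaban1988Convergent, (2.28) p.259,
(2.34)–(2.41) p.261, p.277; Balaban1985Averaging, (26)–(31) p.22, (158) p.42; Dimock2013, §4.4 pp.27–28 (arXiv:1108.1335v2),
Lemma 17 (213), (217)–(219)]
-/

namespace Literature.MathematicalPhysics.QuantumFieldTheory.Balaban1983to89.T4BoundaryRateFrame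

open Finset T4OutputRate T4BoundaryCarrier T4BoundaryRate T4BoundaryRateCollar
open scoped BigOperators
open Metric

/-! ### §13a THE MODEL: layered carriers, the exponential chart, the frame, the gauges, the admissible class, the fit -/

/-- The layer of scale `n`, clamped into `Fin (N+1)` (layers above the top are read as the top; only `n ≤ N` is ever
constrained). [bookkeeping] [folklore] -/
def lay (N n : ℕ) : Fin (N + 1) := ⟨min n N, Nat.lt_succ_of_le (min_le_right n N)⟩

/-- [bookkeeping] [folklore] -/
theorem lay_val_of_le {N n : ℕ} (h : n ≤ N) : ((lay N n : Fin (N + 1)) : ℕ) = n := by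
  simp [lay, h]

/-- [bookkeeping] [folklore] -/
@[simp] theorem lay_coe {N : ℕ} (m : Fin (N + 1)) : lay N (m : ℕ) = m := by
  ext
  have := m.isLt
  simp [lay]
  omega

/-- [bookkeeping] [folklore] -/
theorem lay_eq_of_le {N n : ℕ} (h : n ≤ N) : lay N n = ⟨n, Nat.lt_succ_of_le h⟩ := by
  ext
  exact lay_val_of_le h

/-- THE LAYERED TOY CARRIERS [bookkeeping]: pieces = layers `Fin (N+1)`, `scale = id`, `d = 0`; backgrounds of both runs
`(Fin (N+1) → ℂ) × Fin 2` (a complex coordinate per layer and the Re/Im reading tag of §8), `transport = id`, one fluctuation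
label.  A TOY: nothing of Bałaban's. [folklore] -/
abbrev layCarriers (N : ℕ) : T4BoundaryCarrier.Carriers where
  Dom := Fin (N + 1)
  scale := fun X => (X : ℕ)
  d := fun _ => 0
  d_nonneg := fun _ => le_rfl
  BgA := (Fin (N + 1) → ℂ) × Fin 2
  BgB := (Fin (N + 1) → ℂ) × Fin 2
  gauge := fun _ _ => 0
  gauge_nonneg := fun _ _ => le_rfl
  transport := fun U => U
  Fl := Unit
  admFl := Set.univ

/-- The toy generation [bookkeeping]: every strictly older layer is a parent (`parents X = {Y | Y < X}`), no E-parents, zero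
kernels (the kernels play no role in the frame shapes). [folklore] -/
def expGeneration (N : ℕ) : Generation (layCarriers N) where
  parents := fun X => Finset.univ.filter (fun Y => Y < X)
  parents_lt := fun X Y hY => (mem_filter.mp hY).2
  eparents := fun _ => ∅
  eparents_lt := fun _ _ h => by simp at h
  K := fun _ _ => 0
  K_nonneg := fun _ _ => le_rfl
  KE := fun _ _ => 0
  KE_nonneg := fun _ _ => le_rfl

/-- [bookkeeping] [folklore] -/
theorem mem_parents_iff {N : ℕ} (X Y : Fin (N + 1)) : Y ∈ (expGeneration N).parents X ↔ Y < X := by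
  simp [expGeneration]

/-- The COLLAR WEIGHT of the layer `n` under the fluctuation of the step of scale `X` [bookkeeping]: `δ^{X − n}` for `n ≤ X`,
`0` above (layers not yet created are not displaced) — the toy's reading of p. 277 *"the exponential decay of the minimizing
function 𝐇_k"* across collars (ANALOGY; CONTEXT only). [cite: Balaban1988Convergent, p.277] -/
noncomputable def cw (δ : ℝ) (X n : ℕ) : ℝ := if n ≤ X then δ ^ (X - n) else 0

/-- [bookkeeping] [folklore] -/
theorem cw_of_le (δ : ℝ) {X n : ℕ} (h : n ≤ X) : cw δ X n = δ ^ (X - n) := if_pos h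

/-- [bookkeeping] [folklore] -/
theorem cw_of_lt (δ : ℝ) {X n : ℕ} (h : X < n) : cw δ X n = 0 := if_neg (not_le.mpr h)

/-- [bookkeeping] [folklore] -/
theorem cw_nonneg {δ : ℝ} (hδ : 0 ≤ δ) (X n : ℕ) : 0 ≤ cw δ X n := by
  unfold cw; split_ifs
  · exact pow_nonneg hδ _
  · exact le_rfl

/-- [bookkeeping] [folklore] -/
theorem cw_le_one {δ : ℝ} (hδ : 0 ≤ δ) (hδ1 : δ ≤ 1) (X n : ℕ) : cw δ X n ≤ 1 := by
  unfold cw; split_ifs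
  · exact pow_le_one₀ hδ hδ1
  · exact zero_le_one

/-- The ENCODED DOMAIN of index `j` [bookkeeping]: the open polydisc constraining the layers `m ≤ j` by the radius table
`R j m` (index `j`, layer `m`), higher layers free — the toy's reading of the layered space of index `j`, (2.34)–(2.39) p. 261
imposed *"on X∩(Ω_n∖Ω_{n+1}) for n = 1,.... j−1, or on X∩Ω_j for n = j"* (ANALOGY; CONTEXT only).
[cite: Balaban1988Convergent, (2.34)–(2.39) p.261] -/
def polydisc (N : ℕ) (R : ℕ → ℕ → ℝ) (j : ℕ) : Set (Fin (N + 1) → ℂ) :=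
  {v | ∀ m : Fin (N + 1), (m : ℕ) ≤ j → ‖v m‖ < R j m}

/-- **THE EXPONENTIAL CHART** [bookkeeping]: amplitudes `‖𝒜‖ ≤ s`, core backgrounds = the encoded polydisc of the step's own
index `scale X`, and the MULTIPLICATIVE displacement `z_m ↦ z_m·exp(𝒜·δ^{scale X − m})` of every layer `m ≤ scale X` — genuinely
NON-AFFINE in the amplitude (the displacement depends on the point), as print's `U_j(exp iQ_j(ηt𝐇_k(B′))Ū^j_{k+1})` of (3.4)
p. 270 is (ANALOGY; CONTEXT only).  `chart X U 0 = U` by `exp 0 = 1`. [cite: Balaban1987RG1, (3.4) p.270] -/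
noncomputable def expChart (N : ℕ) (δ s : ℝ) (R : ℕ → ℕ → ℝ) : FluctChart (layCarriers N) ℂ where
  supp := fun _ => closedBall (0 : ℂ) s
  core := fun X => {U | U.1 ∈ polydisc N R X}
  chart := fun X U 𝒜 => (fun m => U.1 m * Complex.exp (𝒜 * (cw δ X m : ℂ)), U.2)
  zero := 0
  chart_zero := fun X U => by simp

/-- The toy ENCODING FRAME [bookkeeping]: `E = Fin (N+1) → ℂ` (sup norm, `NormedSpace ℂ`), layer seminorm `n` = modulus of the
coordinate `lay N n`, `pt z i = (z, i)`, displacement `disp X z 𝒜 = (z_m(exp(𝒜·δ^{scale X − m}) − 1))_m`, encoded domains the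
polydiscs `polydisc N R`. [folklore] -/
noncomputable def expFrame (N : ℕ) (δ : ℝ) (R : ℕ → ℕ → ℝ) :
    CplxFrame (layCarriers N) ℂ (Fin (N + 1) → ℂ) where
  semi := fun n => (normSeminorm ℂ ℂ).comp (LinearMap.proj (lay N n))
  pt := fun z i => (z, i)
  disp := fun X z 𝒜 => fun m => z m * (Complex.exp (𝒜 * (cw δ X m : ℂ)) - 1)
  dom := fun Y => polydisc N R Y

/-- [bookkeeping] [folklore] -/
@[simp] theorem expFrame_semi (N : ℕ) (δ : ℝ) (R : ℕ → ℕ → ℝ) (n : ℕ) (v : Fin (N + 1) → ℂ) :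
    (expFrame N δ R).semi n v = ‖v (lay N n)‖ := rfl

/-- The toy LAYER GAUGE for the CURVED path [bookkeeping]: `dist n U′ U = 4·‖U′_n − U_n‖` — four times the modulus of the
layer-`n` coordinate difference.  The factor `4` is what an ENDPOINT-reading gauge pays for dominating the velocity of the
curved amplitude path (`exp_framePath`: `‖w‖ ≤ 2‖e^w − 1‖` and `‖e^{tw}‖ ≤ 2` for `‖w‖ ≤ ½`); the chord pays `1` (`chordGauge`). [folklore] -/
noncomputable def expGauge (N : ℕ) : LayerGauge (layCarriers N) where
  dist := fun n U' U => 4 * ‖U'.1 (lay N n) - U.1 (lay N n)‖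
  dist_nonneg := fun _ _ _ => by positivity
  dist_self := fun _ _ => by simp

/-- [bookkeeping] [folklore] -/
@[simp] theorem expGauge_dist (N : ℕ) (n : ℕ) (U' U : (Fin (N + 1) → ℂ) × Fin 2) :
    (expGauge N).dist n U' U = 4 * ‖U'.1 (lay N n) - U.1 (lay N n)‖ := rfl

/-- The toy ADMISSIBLE ONE-TABLE CLASS [bookkeeping]: for every piece `Y` (and the one label) the table on encoded points is a
real component (`cpart`, §8) of ONE function complex differentiable on the encoded domain `polydisc N R Y` — the reading
(F-An) of (2.41)(ii) p. 261 *"(ii) it has an extension to an analytic function on the space Ũ^c_j(X, α̃₀, α̃₁)"* (ANALOGY;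
CONTEXT only). [cite: Balaban1988Convergent, (2.41) p.261] -/
def ExpAdmT (N : ℕ) (R : ℕ → ℕ → ℝ) : (ℕ → ℝ) → BTable (layCarriers N) ((Fin (N + 1) → ℂ) × Fin 2) → Prop :=
  fun _ h => ∀ (Y : Fin (N + 1)) (a : Unit), ∃ hc : (Fin (N + 1) → ℂ) → ℂ,
    DifferentiableOn ℂ hc (polydisc N R Y) ∧ ∀ w ∈ polydisc N R Y, ∀ i : Fin 2, h Y (w, i) a = cpart i (hc w)

/-- **THE FIT** — the model's NAMED SMALLNESS BINDER [bookkeeping]: for every parent `Y < X` and every layer `m ≤ Y` the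
parent constrains, the step-`X` radius of the layer inflated by the maximal displacement factor `e^{s·δ^{X − m}}`, plus the
circles' room `gap X Y (Y − m)` on that layer, fits inside the parent's radius: `R X m·e^{sδ^{X−m}} + gap X Y (Y − m) ≤ R Y m`.
The toy face of the two printed sentences keeping the path in the space with a third of the room left for the circles —
[I] p. 273 *"We assume also that ε₁ is so small that 𝐇_j(B(t)) satisfies (3.14) with 1/3α₂ on the right-hand side."* and
[III] p. 277 *"The analyticity domains become smaller after each step, but the difference is very small and exponentially
decreasing in the number of steps. The localization of the fluctuation field, and the exponential decay of the minimizing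
function 𝐇_k imply that this difference is still much greater than bounds on this function."* — which print ASSUMES /
ASSERTS and never displays as an inequality (ANALOGY; CONTEXT only; asserted here for nothing of Bałaban's).  On the model it
is EXACTLY what (F-P) costs (`exp_framePath_iff`). [cite: Balaban1987RG1, (3.14)–(3.17) p.272–273; Balaban1988Convergent, p.277] -/
def PathFits (N : ℕ) (R : ℕ → ℕ → ℝ) (gap : Fin (N + 1) → Fin (N + 1) → ℕ → ℝ) (δ s : ℝ) : Prop :=
  ∀ X Y : Fin (N + 1), Y < X → ∀ m : Fin (N + 1), m ≤ Y →
    R X m * Real.exp (s * δ ^ ((X : ℕ) - m)) + gap X Y ((Y : ℕ) - m) ≤ R Y m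

/-! ### §13b THE FRAME SHAPES ON THE MODEL: (F-Ch), (F-Co), (F-An) by bookkeeping; (F-P) DERIVED from the fit -/

/-- (F-Ch) ON THE MODEL [folklore]: the chart is the frame displacement of the encoded point (`z_m e^{w} = z_m + z_m(e^{w} − 1)`). -/
theorem exp_frameChart (N : ℕ) (δ s : ℝ) (R : ℕ → ℕ → ℝ) : FrameChart (expFrame N δ R) (expChart N δ s R) := by
  intro X z i _ 𝒜 _
  refine Prod.ext ?_ rfl
  funext m
  show z m * Complex.exp (𝒜 * (cw δ X m : ℂ)) = (z + fun m => z m * (Complex.exp (𝒜 * (cw δ X m : ℂ)) - 1)) m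
  simp only [Pi.add_apply]
  ring

/-- (F-Co) ON THE MODEL [folklore]: every background is an encoded point. -/
theorem exp_frameCore (N : ℕ) (δ s : ℝ) (R : ℕ → ℕ → ℝ) : FrameCore (expFrame N δ R) (expChart N δ s R) :=
  fun _ U _ => ⟨U.1, U.2, rfl⟩

/-- (F-An) ON THE MODEL [folklore]: the class `ExpAdmT` is the shape's own wording. -/
theorem exp_frameAnalytic (N : ℕ) (δ : ℝ) (R : ℕ → ℕ → ℝ) (W : Set (ℕ → ℝ)) :
    FrameAnalytic (expFrame N δ R) W (ExpAdmT N R) :=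
  fun _ _ _ hh Y a _ => hh Y a

/-- Chain rule through `ℝ ⊂ ℂ` for vector-valued maps [folklore]: a complex derivative of `h : ℂ → E` at a real point is the
real derivative of `t ↦ h t` there, `E` carrying the ℝ-structure `NormedSpace.complexToReal` (the one `FramePath` uses). -/
theorem hasDerivAt_comp_ofReal {E : Type*} [NormedAddCommGroup E] [NormedSpace ℂ E] {h : ℂ → E} {e : E} {t : ℝ}
    (hf : HasDerivAt h e (t : ℂ)) : HasDerivAt (fun y : ℝ => h (y : ℂ)) e t := by
  have h1 := ((hf.hasFDerivAt.restrictScalars ℝ).comp t Complex.ofRealCLM.hasFDerivAt).hasDerivAt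
  have h2 : HasDerivAt (h ∘ Complex.ofReal) e t := h1.congr_deriv (by simp)
  exact h2

/-- `‖w‖ ≤ 2‖e^w − 1‖` for `‖w‖ ≤ ½` [folklore] (`Complex.norm_exp_sub_one_sub_id_le`). -/
theorem norm_le_two_mul_norm_exp_sub_one {w : ℂ} (hw : ‖w‖ ≤ 1 / 2) : ‖w‖ ≤ 2 * ‖Complex.exp w - 1‖ := by
  have h1 : ‖Complex.exp w - 1 - w‖ ≤ ‖w‖ ^ 2 := Complex.norm_exp_sub_one_sub_id_le (by linarith)
  have h2 : ‖w‖ ^ 2 ≤ ‖w‖ / 2 := by nlinarith [norm_nonneg w]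
  have h3 : ‖w‖ ≤ ‖Complex.exp w - 1‖ + ‖Complex.exp w - 1 - w‖ := by
    calc ‖w‖ = ‖(Complex.exp w - 1) - (Complex.exp w - 1 - w)‖ := by rw [sub_sub_cancel]
      _ ≤ ‖Complex.exp w - 1‖ + ‖Complex.exp w - 1 - w‖ := norm_sub_le _ _
  linarith

/-- `‖e^u‖ ≤ 2` for `‖u‖ ≤ ½` [folklore] (`e^{1/2}·e^{1/2} = e < 3`). -/
theorem norm_exp_le_two {u : ℂ} (hu : ‖u‖ ≤ 1 / 2) : ‖Complex.exp u‖ ≤ 2 := by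
  rw [Complex.norm_exp]
  have h1 : u.re ≤ 1 / 2 := (Complex.re_le_norm u).trans hu
  have h2 : Real.exp u.re ≤ Real.exp (1 / 2) := Real.exp_le_exp_of_le h1
  have h3 : Real.exp (1 / 2) * Real.exp (1 / 2) = Real.exp 1 := by rw [← Real.exp_add]; norm_num
  nlinarith [Real.exp_one_lt_d9, Real.exp_pos (1 / 2 : ℝ)]

/-- `‖e^u‖ ≤ e^{‖u‖}` [folklore]. -/
theorem norm_exp_le_exp_norm (u : ℂ) : ‖Complex.exp u‖ ≤ Real.exp ‖u‖ := by
  rw [Complex.norm_exp]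
  exact Real.exp_le_exp_of_le (Complex.re_le_norm u)

/-- **(F-P) DERIVED ON THE MODEL** [folklore]: for `0 ≤ δ ≤ 1`, `s ≤ ½` and the FIT, the exponential chart satisfies §12f's
`FramePath` for the gauge `expGauge` (factor `4`) — with print's OWN kind of path, the CURVED amplitude path
`γ t = (z_m·exp(t𝒜·δ^{scale X − m}))_m`, `t ∈ [0,1]` (the restriction to `[0,1] ⊂ ℝ ⊂ ℂ` of a holomorphic map; velocity
`γ′ t = (z_m·w_m·exp(t w_m))_m`, `w_m = 𝒜·δ^{scale X − m}`, by `hasDerivAt_pi` + `HasDerivAt.cexp` + `hasDerivAt_comp_ofReal`):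
`γ 0 = z`, `γ 1 =` the displaced point; every `γ t` is a MARGIN POINT because `‖γ t‖_m ≤ ‖z_m‖e^{sδ^{X−m}} < R X m·e^{sδ^{X−m}}`
and the fit adds the circles' room inside `R Y m`; the velocity obeys `‖γ′ t‖_n ≤ 4‖z_n(e^{w_n} − 1)‖ = expGauge.dist n (chart) (pt)`.
ANALOGY with [I] pp. 270–273 ((3.4), `B(t)`, (3.8)–(3.9), *"satisfies (3.14) with 1/3α₂"*) — CONTEXT only; a toy theorem
about toy objects. [cite: Balaban1987RG1, (3.4) p.270, (3.7)–(3.9) p.271, (3.14)–(3.17) p.272–273] -/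
theorem exp_framePath (N : ℕ) {δ s : ℝ} {R : ℕ → ℕ → ℝ} {gap : Fin (N + 1) → Fin (N + 1) → ℕ → ℝ}
    (hδ : 0 ≤ δ) (hδ1 : δ ≤ 1) (hs : s ≤ 1 / 2) (hfit : PathFits N R gap δ s) :
    FramePath (expFrame N δ R) (expGeneration N) (expChart N δ s R) (expGauge N) gap := by
  intro X z i hz 𝒜 h𝒜
  have h𝒜' : ‖𝒜‖ ≤ s := mem_closedBall_zero_iff.mp h𝒜
  have hs0 : 0 ≤ s := (norm_nonneg 𝒜).trans h𝒜'
  have hz' : ∀ m : Fin (N + 1), (m : ℕ) ≤ X → ‖z m‖ < R X m := hz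
  -- the layer rates
  set w : Fin (N + 1) → ℂ := fun m => 𝒜 * (cw δ X m : ℂ) with hw
  have hwn : ∀ m, ‖w m‖ ≤ s * cw δ X m := by
    intro m
    rw [hw, norm_mul, Complex.norm_real, Real.norm_of_nonneg (cw_nonneg hδ _ _)]
    exact mul_le_mul_of_nonneg_right h𝒜' (cw_nonneg hδ _ _)
  have hwhalf : ∀ m, ‖w m‖ ≤ 1 / 2 := by
    intro m
    calc ‖w m‖ ≤ s * cw δ X m := hwn m
      _ ≤ 1 / 2 * 1 := mul_le_mul hs (cw_le_one hδ hδ1 _ _) (cw_nonneg hδ _ _) (by norm_num)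
      _ = 1 / 2 := by ring
  -- the holomorphic amplitude path and its velocity
  set Φ : ℂ → (Fin (N + 1) → ℂ) := fun ζ m => z m * Complex.exp (ζ * w m) with hΦ
  set Φ' : ℂ → (Fin (N + 1) → ℂ) := fun ζ m => z m * (w m * Complex.exp (ζ * w m)) with hΦ'
  have hderivC : ∀ ζ : ℂ, HasDerivAt Φ (Φ' ζ) ζ := by
    intro ζ
    rw [hasDerivAt_pi]
    intro m
    simp only [hΦ, hΦ']
    have h1 : HasDerivAt (fun ζ : ℂ => ζ * w m) (w m) ζ := by
      simpa using (hasDerivAt_id ζ).mul_const (w m)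
    have h2 : HasDerivAt (fun ζ : ℂ => Complex.exp (ζ * w m)) (Complex.exp (ζ * w m) * w m) ζ := h1.cexp
    refine (h2.const_mul (z m)).congr_deriv ?_
    ring
  refine ⟨fun t => Φ (t : ℂ), fun t => Φ' (t : ℂ), ?_, ?_, ?_, ?_, ?_⟩
  · funext m; simp [hΦ]
  · funext m
    simp only [hΦ, Pi.add_apply, Complex.ofReal_one, one_mul]
    show z m * Complex.exp (w m) = z m + z m * (Complex.exp (𝒜 * (cw δ X m : ℂ)) - 1)
    rw [hw]
    ring
  · intro t _
    exact (hasDerivAt_comp_ofReal (hderivC (t : ℂ))).hasDerivWithinAt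
  · -- margin points
    intro t ht Y hY v hv m hm
    have hYX : Y < X := (mem_parents_iff X Y).mp hY
    have hmX : (m : ℕ) ≤ X := le_trans hm (le_of_lt hYX)
    have ht0 : 0 ≤ t := ht.1
    have ht1 : t ≤ 1 := ht.2
    -- the gap constraint on the layer m
    have hj : (Y : ℕ) - m ∈ range ((layCarriers N).scale Y + 1) := mem_range.mpr (by
      show (Y : ℕ) - m < (Y : ℕ) + 1; omega)
    have hvm : ‖v m‖ ≤ gap X Y ((Y : ℕ) - m) := by
      have h1 := hv ((Y : ℕ) - m) hj
      rw [expFrame_semi] at h1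
      have h2 : (layCarriers N).scale Y - ((Y : ℕ) - m) = (m : ℕ) := by
        show (Y : ℕ) - ((Y : ℕ) - m) = (m : ℕ); omega
      rwa [h2, lay_coe] at h1
    -- the path point on the layer m
    have hexp : ‖Complex.exp ((t : ℂ) * w m)‖ ≤ Real.exp (s * δ ^ ((X : ℕ) - m)) := by
      refine (norm_exp_le_exp_norm _).trans (Real.exp_le_exp_of_le ?_)
      rw [norm_mul, Complex.norm_real, Real.norm_of_nonneg ht0, ← cw_of_le δ hmX]
      calc t * ‖w m‖ ≤ 1 * (s * cw δ X m) := mul_le_mul ht1 (hwn m) (norm_nonneg _) zero_le_one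
        _ = s * cw δ X m := one_mul _
    show ‖(Φ (t : ℂ) + v) m‖ < R Y m
    rw [Pi.add_apply]
    calc ‖Φ (t : ℂ) m + v m‖ ≤ ‖Φ (t : ℂ) m‖ + ‖v m‖ := norm_add_le _ _
      _ = ‖z m‖ * ‖Complex.exp ((t : ℂ) * w m)‖ + ‖v m‖ := by rw [hΦ]; simp only [norm_mul]
      _ < R X m * Real.exp (s * δ ^ ((X : ℕ) - m)) + gap X Y ((Y : ℕ) - m) := by
          have hR : ‖z m‖ < R X m := hz' m hmX
          have hE : 0 < Real.exp (s * δ ^ ((X : ℕ) - m)) := Real.exp_pos _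
          have h3 : ‖z m‖ * ‖Complex.exp ((t : ℂ) * w m)‖ ≤ ‖z m‖ * Real.exp (s * δ ^ ((X : ℕ) - m)) :=
            mul_le_mul_of_nonneg_left hexp (norm_nonneg _)
          have h4 : ‖z m‖ * Real.exp (s * δ ^ ((X : ℕ) - m)) < R X m * Real.exp (s * δ ^ ((X : ℕ) - m)) :=
            mul_lt_mul_of_pos_right hR hE
          linarith
      _ ≤ R Y m := hfit X Y hYX m hm
  · -- velocity dominated by the gauge
    intro t ht n
    have ht0 : 0 ≤ t := ht.1
    have ht1 : t ≤ 1 := ht.2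
    set m := lay N n with hm
    rw [expFrame_semi, expGauge_dist]
    show ‖Φ' (t : ℂ) m‖ ≤ 4 * ‖z m * Complex.exp (𝒜 * (cw δ X m : ℂ)) - z m‖
    have htw : ‖(t : ℂ) * w m‖ ≤ 1 / 2 := by
      rw [norm_mul, Complex.norm_real, Real.norm_of_nonneg ht0]
      calc t * ‖w m‖ ≤ 1 * (1 / 2) := mul_le_mul ht1 (hwhalf m) (norm_nonneg _) zero_le_one
        _ = 1 / 2 := one_mul _
    have hfac : z m * Complex.exp (𝒜 * (cw δ X m : ℂ)) - z m = z m * (Complex.exp (w m) - 1) := by rw [hw]; ring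
    calc ‖Φ' (t : ℂ) m‖ = ‖z m‖ * (‖w m‖ * ‖Complex.exp ((t : ℂ) * w m)‖) := by
          simp only [hΦ', norm_mul]
      _ ≤ ‖z m‖ * (2 * ‖Complex.exp (w m) - 1‖ * 2) :=
          mul_le_mul_of_nonneg_left (mul_le_mul (norm_le_two_mul_norm_exp_sub_one (hwhalf m))
            (norm_exp_le_two htw) (norm_nonneg _) (by positivity)) (norm_nonneg _)
      _ = 4 * ‖z m * (Complex.exp (w m) - 1)‖ := by rw [norm_mul]; ring
      _ = 4 * ‖z m * Complex.exp (𝒜 * (cw δ X m : ℂ)) - z m‖ := by rw [hfac]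

/-! ### §13c CONSEQUENCES: `MarginCauchy` with `c₀ = 2`; `CollarDecay` in layer units -/

/-- `MarginCauchy` WITH `c₀ = 2` ON THE MODEL [folklore]: §12f's `marginCauchy_of_pathFrame` fed with the four derived shapes;
the gaps positive. -/
theorem exp_marginCauchy (N : ℕ) {δ s : ℝ} {R : ℕ → ℕ → ℝ} {gap : Fin (N + 1) → Fin (N + 1) → ℕ → ℝ}
    (hδ : 0 ≤ δ) (hδ1 : δ ≤ 1) (hs : s ≤ 1 / 2) (hfit : PathFits N R gap δ s)
    (hgap : ∀ X Y : Fin (N + 1), Y < X → ∀ j ∈ range ((Y : ℕ) + 1), 0 < gap X Y j) (W : Set (ℕ → ℝ)) (κ : ℝ) :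
    MarginCauchy (expGeneration N) (expChart N δ s R) W κ (ExpAdmT N R) (expGauge N) gap 2 :=
  marginCauchy_of_pathFrame (exp_frameChart N δ s R) (exp_frameCore N δ s R) (exp_framePath N hδ hδ1 hs hfit)
    (exp_frameAnalytic N δ R W) fun X Y hY j hj => hgap X Y ((mem_parents_iff X Y).mp hY) j hj

/-- `CollarDecay` ON THE MODEL, NORMALIZED GAUGE [folklore]: if the radii are dominated in layer units, `R j n ≤ b·u n`
(`n ≤ j ≤ N`), then for `0 ≤ δ ≤ 1`, `s ≤ ½` the gauge rescaled by `u` (§12g `LayerGauge.rescale`) decays across collars at the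
rate `δ` with constant `ε = 8bs`: `4‖z_n(e^{w_n} − 1)‖ ≤ 4·(b u n)·2‖w_n‖ ≤ 8bs·δ^{X−n}·u n` (`Complex.norm_exp_sub_one_le`). -/
theorem exp_collarDecay (N : ℕ) {δ s b : ℝ} {R : ℕ → ℕ → ℝ} {u : ℕ → ℝ} (hu : ∀ n, 0 < u n)
    (hδ : 0 ≤ δ) (hδ1 : δ ≤ 1) (hs : s ≤ 1 / 2) (hb : 0 ≤ b)
    (hRu : ∀ j n : ℕ, n ≤ j → j ≤ N → R j n ≤ b * u n) :
    CollarDecay (expChart N δ s R) ((expGauge N).rescale u hu) (8 * b * s) δ := by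
  intro X U hU 𝒜 h𝒜 n hn
  have hnX : n ≤ (X : ℕ) := le_of_lt hn
  have hnN : n ≤ N := by have := X.isLt; omega
  have h𝒜' : ‖𝒜‖ ≤ s := mem_closedBall_zero_iff.mp h𝒜
  have hs0 : 0 ≤ s := (norm_nonneg 𝒜).trans h𝒜'
  have hlay : lay N n = ⟨n, Nat.lt_succ_of_le hnN⟩ := lay_eq_of_le hnN
  rw [LayerGauge.rescale_dist, expGauge_dist, div_le_iff₀ (hu n), hlay]
  set m : Fin (N + 1) := ⟨n, Nat.lt_succ_of_le hnN⟩ with hm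
  have hmn : (m : ℕ) = n := rfl
  have hUm : ‖U.1 m‖ < R X m := hU m (by rw [hmn]; exact hnX)
  have hRm : R X m ≤ b * u n := by rw [hmn]; exact hRu X n hnX (Nat.lt_succ_iff.mp X.isLt)
  have hcw : cw δ X m = δ ^ ((X : ℕ) - n) := by rw [hmn]; exact cw_of_le δ hnX
  set wm : ℂ := 𝒜 * (cw δ X m : ℂ) with hwm
  have hwn : ‖wm‖ ≤ s * δ ^ ((X : ℕ) - n) := by
    rw [hwm, norm_mul, Complex.norm_real, hcw, Real.norm_of_nonneg (pow_nonneg hδ _)]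
    exact mul_le_mul_of_nonneg_right h𝒜' (pow_nonneg hδ _)
  have hw1 : ‖wm‖ ≤ 1 := by
    calc ‖wm‖ ≤ s * δ ^ ((X : ℕ) - n) := hwn
      _ ≤ 1 / 2 * 1 := mul_le_mul hs (pow_le_one₀ hδ hδ1) (pow_nonneg hδ _) (by norm_num)
      _ ≤ 1 := by norm_num
  show 4 * ‖U.1 m * Complex.exp (𝒜 * (cw δ X m : ℂ)) - U.1 m‖ ≤ 8 * b * s * δ ^ ((X : ℕ) - n) * u n
  have hfac : U.1 m * Complex.exp (𝒜 * (cw δ X m : ℂ)) - U.1 m = U.1 m * (Complex.exp wm - 1) := by rw [hwm]; ring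
  rw [hfac, norm_mul]
  calc 4 * (‖U.1 m‖ * ‖Complex.exp wm - 1‖) ≤ 4 * ((b * u n) * (2 * ‖wm‖)) :=
        mul_le_mul_of_nonneg_left (mul_le_mul (hUm.le.trans hRm) (Complex.norm_exp_sub_one_le hw1) (norm_nonneg _)
          (mul_nonneg hb (hu n).le)) (by norm_num)
    _ ≤ 4 * ((b * u n) * (2 * (s * δ ^ ((X : ℕ) - n)))) :=
        mul_le_mul_of_nonneg_left (mul_le_mul_of_nonneg_left (mul_le_mul_of_nonneg_left hwn (by norm_num))
          (mul_nonneg hb (hu n).le)) (by norm_num)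
    _ = 8 * b * s * δ ^ ((X : ℕ) - n) * u n := by ring

/-! ### §13d NON-VACUITY: core points, amplitudes, the clip table and its inserted difference -/

/-- Non-vacuity [folklore]: the origin is a core background of every step (positive radii). -/
theorem zero_mem_core (N : ℕ) {δ s : ℝ} {R : ℕ → ℕ → ℝ} (hR : ∀ j n, 0 < R j n) (X : Fin (N + 1)) (i : Fin 2) :
    ((fun _ => (0 : ℂ)), i) ∈ (expChart N δ s R).core X := fun m _ => by simpa using hR X m

/-- Non-vacuity [folklore]: the real amplitude `s ≥ 0` is admissible. -/
theorem real_mem_supp (N : ℕ) {δ s : ℝ} {R : ℕ → ℕ → ℝ} (hs : 0 ≤ s) (X : Fin (N + 1)) :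
    (s : ℂ) ∈ (expChart N δ s R).supp X := by
  show (s : ℂ) ∈ closedBall (0 : ℂ) s
  rw [mem_closedBall_zero_iff, Complex.norm_real, Real.norm_of_nonneg hs]

/-- THE CLIP TABLE [bookkeeping]: on the piece `Y`, the Re/Im part (by the tag) of the TOP coordinate `v_Y`, clipped to `0`
off the encoded domain of index `Y` — an admissible, bounded toy table with a nonzero inserted fluctuation difference. [folklore] -/
noncomputable def topTable (N : ℕ) (R : ℕ → ℕ → ℝ) : BTable (layCarriers N) ((Fin (N + 1) → ℂ) × Fin 2) :=
  fun Y U _ => cpart U.2 ((polydisc N R Y).indicator (fun v => v Y) U.1)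

/-- The clip table is admissible [folklore]: on `polydisc N R Y` it is the real component of the coordinate projection
(`ContinuousLinearMap.proj`, complex-linear hence complex differentiable). -/
theorem expAdmT_topTable (N : ℕ) (R : ℕ → ℕ → ℝ) (g : ℕ → ℝ) : ExpAdmT N R g (topTable N R) := by
  intro Y a
  refine ⟨fun v => v Y, (ContinuousLinearMap.proj (R := ℂ) (φ := fun _ : Fin (N + 1) => ℂ) Y).differentiable
    |>.differentiableOn, fun w hw i => ?_⟩
  show cpart i ((polydisc N R Y).indicator (fun v => v Y) w) = cpart i (w Y)
  rw [Set.indicator_of_mem hw]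

/-- The clip table is bounded by the top radius `R Y Y` [folklore] (`abs_cpart_le`; positive radii). -/
theorem topTable_abs_le (N : ℕ) {R : ℕ → ℕ → ℝ} (hR : ∀ j n, 0 < R j n) (Y : Fin (N + 1))
    (U : (Fin (N + 1) → ℂ) × Fin 2) (a : Unit) : |topTable N R Y U a| ≤ R Y Y := by
  unfold topTable
  refine (abs_cpart_le U.2 _).trans ?_
  by_cases hU : U.1 ∈ polydisc N R Y
  · rw [Set.indicator_of_mem hU]
    exact (hU Y le_rfl).le
  · rw [Set.indicator_of_notMem hU, norm_zero]
    exact (hR _ _).le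

/-- THE INSERTED FLUCTUATION DIFFERENCE OF THE CLIP TABLE, COMPUTED [folklore]: at the one-layer background `r·e_Y` (tag Re),
real amplitude `s`, parent `Y < X`: `fluct = r·(e^{s·δ^{X−Y}} − 1)` — provided both the background and its displacement lie in
the parent's domain (`r < R X Y`, `r·e^{sδ^{X−Y}} < R Y Y`). -/
theorem topTable_fluct (N : ℕ) {δ s r : ℝ} {R : ℕ → ℕ → ℝ} (hR : ∀ j n, 0 < R j n) (hδ : 0 ≤ δ) (hs : 0 ≤ s)
    {X Y : Fin (N + 1)} (hYX : Y < X) (hr : 0 ≤ r) (hrX : r < R X Y)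
    (hrY : r * Real.exp (s * δ ^ ((X : ℕ) - Y)) < R Y Y) :
    fluct (expChart N δ s R) (topTable N R) X Y (Function.update (fun _ => (0 : ℂ)) Y (r : ℂ), (0 : Fin 2)) (s : ℂ) () =
      r * (Real.exp (s * δ ^ ((X : ℕ) - Y)) - 1) := by
  have hYX' : (Y : ℕ) ≤ X := le_of_lt hYX
  set q : ℝ := s * δ ^ ((X : ℕ) - Y) with hq
  have hq0 : 0 ≤ q := by positivity
  have hE1 : 1 ≤ Real.exp q := Real.one_le_exp hq0
  have hrY' : r < R Y Y := lt_of_le_of_lt (by nlinarith) hrY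
  set z : Fin (N + 1) → ℂ := Function.update (fun _ => (0 : ℂ)) Y (r : ℂ) with hz
  -- the displaced point
  have hdisp : (fun m => z m * Complex.exp ((s : ℂ) * (cw δ X m : ℂ))) =
      Function.update (fun _ => (0 : ℂ)) Y ((r * Real.exp q : ℝ) : ℂ) := by
    funext m
    by_cases hmY : m = Y
    · subst hmY
      rw [hz, Function.update_self, Function.update_self, cw_of_le δ hYX', Complex.ofReal_mul, Complex.ofReal_exp,
        hq, Complex.ofReal_mul, Complex.ofReal_pow]
    · rw [hz, Function.update_of_ne hmY, Function.update_of_ne hmY, zero_mul]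
  have hmem : ∀ ρ : ℝ, 0 ≤ ρ → ρ < R Y Y → Function.update (fun _ => (0 : ℂ)) Y (ρ : ℂ) ∈ polydisc N R Y := by
    intro ρ hρ0 hρ m hm
    by_cases hmY : m = Y
    · subst hmY
      rw [Function.update_self, Complex.norm_real, Real.norm_of_nonneg hρ0]
      exact hρ
    · rw [Function.update_of_ne hmY, norm_zero]
      exact hR _ _
  unfold fluct topTable
  show cpart 0 ((polydisc N R Y).indicator (fun v => v Y) (fun m => z m * Complex.exp ((s : ℂ) * (cw δ X m : ℂ)))) -
      cpart 0 ((polydisc N R Y).indicator (fun v => v Y) z) = r * (Real.exp q - 1)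
  rw [hdisp, Set.indicator_of_mem (hmem _ (by positivity) hrY), Set.indicator_of_mem (hmem _ hr hrY'),
    Function.update_self, Function.update_self]
  simp only [cpart, Complex.ofReal_re]
  norm_num
  ring

/-- … which is POSITIVE for `δ, s, r > 0` [folklore]: the shapes instantiated below bound a nonzero quantity. -/
theorem topTable_fluct_pos {δ s r : ℝ} (hδ : 0 < δ) (hs : 0 < s) (hr : 0 < r) (k : ℕ) :
    0 < r * (Real.exp (s * δ ^ k) - 1) := by
  have : 0 < s * δ ^ k := by positivity
  have h1 : 1 < Real.exp (s * δ ^ k) := Real.one_lt_exp_iff.mpr this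
  nlinarith

/-! ### §13e THE PRINTED RADII: the fit for `δ ≤ ½`, `s ≤ β/4`; END-TO-END `FluctDampedOne` with `ρ = 2` and layer-dependent `α` -/

/-- **THE PRINTED RADII, TYPED ON THE MODEL** [bookkeeping]: index `j`, layer `n` ↦ `a·shrink β (j − n)·α n` with the tree's
`B14Radii.shrink β m = 1 − β(1 − 2^{−m})` (pv02) — the displayed factor of (2.34)–(2.37) and (2.39) p. 261 ((2.38) carries
none), e.g. (2.34) *"|∂U − 1|, |∂𝐔 − 1|
< (1 − β(1 − 2^{−(j−n)}))α_{0,n}ξ²(Lⁿξ)^{−2}"*, with the LAYER-DEPENDENT coefficient `α n` of (2.28) p. 259 and an overall unit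
`a > 0`; p. 261 *"The number β is a small positive constant, but not too small, e.g., we can take β = 1/4."* (CONTEXT; the
table is a toy object, no law for `α` asserted). [cite: Balaban1988Convergent, (2.28) p.259, (2.34)–(2.39) p.261] -/
noncomputable def printedR (a β : ℝ) (α : ℕ → ℝ) : ℕ → ℕ → ℝ := fun j n => a * B14Radii.shrink β (j - n) * α n

/-- THE CIRCLES' HALF OF THE ROOM [bookkeeping]: `gap X Y j = (a/2)·(shrink β j − shrink β (scale X − scale Y + j))·α(scale Y − j)`
— half the difference between the parent's (index `scale Y`) and the step's (index `scale X`) printed radii on the layer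
`scale Y − j`; literally the gap of §12g's `gapShape_of_shrink_normalized` with unit `a/2` (so `GapShape` with `ρ = 2` EXACTLY
and `g₀ = (a/2)β/2` in normalized units).  The other half is the PATH's room (`printed_pathFits`) — print's thirds of p. 273
(*"with 1/3α₂"*) read as halves, a convention. [cite: Balaban1987RG1, (3.14)–(3.17) p.272–273; Balaban1988Convergent, (2.34)–(2.39) p.261, p.277] -/
noncomputable def printedGap (N : ℕ) (a β : ℝ) (α : ℕ → ℝ) : Fin (N + 1) → Fin (N + 1) → ℕ → ℝ := fun X Y j =>
  a / 2 * (B14Radii.shrink β j - B14Radii.shrink β ((layCarriers N).scale X - (layCarriers N).scale Y + j)) *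
    α ((layCarriers N).scale Y - j)

/-- `0 ≤ shrink β m` for `0 ≤ β ≤ 1` [folklore]. -/
theorem shrink_nonneg {β : ℝ} (hβ : 0 ≤ β) (hβ1 : β ≤ 1) (m : ℕ) : 0 ≤ B14Radii.shrink β m := by
  unfold B14Radii.shrink
  have h1 : (0 : ℝ) ≤ (1 / 2 : ℝ) ^ m := by positivity
  have h2 : (1 / 2 : ℝ) ^ m ≤ 1 := pow_le_one₀ (by norm_num) (by norm_num)
  nlinarith

/-- The printed factors STRICTLY decrease in the index (`β > 0`) [folklore] (`B14Radii.shrink_antitone`, `shrink_succ_lt`). -/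
theorem shrink_sub_shrink_pos {β : ℝ} (hβ : 0 < β) {j k : ℕ} (h : j < k) :
    0 < B14Radii.shrink β j - B14Radii.shrink β k := by
  have h1 : B14Radii.shrink β k ≤ B14Radii.shrink β (j + 1) := B14Radii.shrink_antitone hβ.le (by omega)
  have h2 := B14Radii.shrink_succ_lt hβ j
  linarith

/-- Positive radii for `β < 1` [folklore] (`B14Radii.shrink_pos`) (print: `β = 1/4`). -/
theorem printedR_pos {a β : ℝ} {α : ℕ → ℝ} (ha : 0 < a) (hβ : 0 ≤ β) (hβ1 : β < 1) (hα : ∀ n, 0 < α n) (j n : ℕ) :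
    0 < printedR a β α j n :=
  mul_pos (mul_pos ha (B14Radii.shrink_pos hβ hβ1 _)) (hα n)

/-- The printed radii are dominated in coefficient units: `printedR a β α j n ≤ a·α n` [folklore] (`shrink_le_one`). -/
theorem printedR_le {a β : ℝ} {α : ℕ → ℝ} (ha : 0 ≤ a) (hβ : 0 ≤ β) (hα : ∀ n, 0 < α n) (j n : ℕ) :
    printedR a β α j n ≤ a * α n := by
  unfold printedR
  calc a * B14Radii.shrink β (j - n) * α n ≤ a * 1 * α n :=
        mul_le_mul_of_nonneg_right (mul_le_mul_of_nonneg_left (B14Radii.shrink_le_one hβ _) ha) (hα n).le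
    _ = a * α n := by ring

/-- The circles' room is positive for a genuine parent (`Y < X`, `β > 0`) [folklore]. -/
theorem printedGap_pos (N : ℕ) {a β : ℝ} {α : ℕ → ℝ} (ha : 0 < a) (hβ : 0 < β) (hα : ∀ n, 0 < α n)
    (X Y : Fin (N + 1)) (hYX : Y < X) (j : ℕ) : 0 < printedGap N a β α X Y j := by
  have hYX' : (Y : ℕ) < X := hYX
  unfold printedGap
  refine mul_pos (mul_pos (half_pos ha) (shrink_sub_shrink_pos hβ ?_)) (hα _)
  show j < (X : ℕ) - Y + j
  omega

/-- **THE PRINTED RADII FIT** [folklore]: for `0 < a`, `0 ≤ β ≤ 1`, `α > 0`, `0 ≤ δ ≤ ½` and `0 ≤ s ≤ β/4` the fit `PathFits`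
holds with the circles' half `printedGap`.  Per layer `m ≤ Y < X`, after dividing by `a·α m > 0`, with `k = X − m ≥ p + 1`,
`p = Y − m`: `shrink β k·(e^{sδ^k} − 1) ≤ 2sδ^k ≤ 2s·2^{−k} ≤ s·2^{−p} ≤ (β/4)·2^{−p} = ½·β·2^{−(p+1)} ≤ ½(shrink β p − shrink β k)`
(`Real.abs_exp_sub_one_le`; the halving `B14Radii.shrink_sub_succ`).  The two printed mechanisms meet here: the
displacement's decay per collar (`δ ≤ ½`) against the halving of the margins (p. 277 *"This is the reason for putting the
powers of 1/2 in the conditions (2.36)–(2.39)."*) — `half_of_printed_pathFits_all` shows `δ ≤ ½` cannot be relaxed uniformly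
in the depth.  A toy theorem (CONTEXT quotations only). [cite: Balaban1988Convergent, (2.34)–(2.39) p.261, p.277] -/
theorem printed_pathFits (N : ℕ) {a β δ s : ℝ} {α : ℕ → ℝ} (ha : 0 < a) (hβ : 0 ≤ β) (hβ1 : β ≤ 1)
    (hα : ∀ n, 0 < α n) (hδ : 0 ≤ δ) (hδ2 : δ ≤ 1 / 2) (hs0 : 0 ≤ s) (hs : s ≤ β / 4) :
    PathFits N (printedR a β α) (printedGap N a β α) δ s := by
  intro X Y hYX m hmY
  have hYX' : (Y : ℕ) < X := hYX
  have hmY' : (m : ℕ) ≤ Y := hmY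
  have e1 : (layCarriers N).scale X - (layCarriers N).scale Y + ((Y : ℕ) - m) = (X : ℕ) - m := by
    show (X : ℕ) - Y + ((Y : ℕ) - m) = (X : ℕ) - m; omega
  have e2 : (layCarriers N).scale Y - ((Y : ℕ) - m) = (m : ℕ) := by
    show (Y : ℕ) - ((Y : ℕ) - m) = (m : ℕ); omega
  unfold printedR printedGap
  rw [e1, e2]
  -- abbreviations
  set p : ℕ := (Y : ℕ) - m with hp
  set k : ℕ := (X : ℕ) - m with hk
  have hpk : p + 1 ≤ k := by omega
  set q : ℝ := s * δ ^ k with hq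
  have hq0 : 0 ≤ q := by positivity
  have hδk : δ ^ k ≤ (1 / 2 : ℝ) ^ k := pow_le_pow_left₀ hδ hδ2 k
  have hhk : (1 / 2 : ℝ) ^ k ≤ (1 / 2 : ℝ) ^ (p + 1) := pow_le_pow_of_le_one (by norm_num) (by norm_num) hpk
  have hq1 : q ≤ 1 := by
    have : δ ^ k ≤ 1 := pow_le_one₀ hδ (by linarith)
    calc q = s * δ ^ k := hq
      _ ≤ 1 / 4 * 1 := mul_le_mul (by linarith) this (pow_nonneg hδ _) (by norm_num)
      _ ≤ 1 := by norm_num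
  have hexp : Real.exp q - 1 ≤ 2 * q := by
    have h := Real.abs_exp_sub_one_le (x := q) (by rw [abs_of_nonneg hq0]; exact hq1)
    rw [abs_of_nonneg hq0] at h
    exact (le_abs_self _).trans h
  have hexp0 : 0 ≤ Real.exp q - 1 := by linarith [Real.add_one_le_exp q]
  have hshk1 : B14Radii.shrink β k ≤ 1 := B14Radii.shrink_le_one hβ k
  have hshk0 : 0 ≤ B14Radii.shrink β k := shrink_nonneg hβ hβ1 k
  have hdiff : B14Radii.shrink β p - B14Radii.shrink β k = β * ((1 / 2 : ℝ) ^ p - (1 / 2 : ℝ) ^ k) := by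
    unfold B14Radii.shrink; ring
  have key : B14Radii.shrink β k * (Real.exp q - 1) ≤ (B14Radii.shrink β p - B14Radii.shrink β k) / 2 := by
    calc B14Radii.shrink β k * (Real.exp q - 1) ≤ 1 * (2 * q) := mul_le_mul hshk1 hexp hexp0 zero_le_one
      _ = 2 * (s * δ ^ k) := by rw [one_mul, hq]
      _ ≤ 2 * (s * (1 / 2 : ℝ) ^ (p + 1)) :=
          mul_le_mul_of_nonneg_left (mul_le_mul_of_nonneg_left (hδk.trans hhk) hs0) (by norm_num)
      _ = s * (1 / 2 : ℝ) ^ p := by rw [pow_succ]; ring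
      _ ≤ β / 4 * (1 / 2 : ℝ) ^ p := mul_le_mul_of_nonneg_right hs (by positivity)
      _ = β * ((1 / 2 : ℝ) ^ p - (1 / 2 : ℝ) ^ (p + 1)) / 2 := by rw [pow_succ]; ring
      _ ≤ β * ((1 / 2 : ℝ) ^ p - (1 / 2 : ℝ) ^ k) / 2 := by
          have : (1 / 2 : ℝ) ^ k ≤ (1 / 2 : ℝ) ^ (p + 1) := hhk
          nlinarith
      _ = (B14Radii.shrink β p - B14Radii.shrink β k) / 2 := by rw [hdiff]
  have hpos : 0 < a * α m := mul_pos ha (hα m)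
  have key' := mul_le_mul_of_nonneg_left key hpos.le
  nlinarith [key']

/-- `CollarDecay` FOR THE PRINTED RADII IN COEFFICIENT UNITS [folklore]: gauge rescaled by `α`, `ε = 8as`, rate `δ`
(`exp_collarDecay` with `b = a`, `u = α`, by `printedR_le`) — the normalized collar-decay binder of §12g's
`fluctDampedOne_of_collar_normalized`, here a theorem about the toy chart. -/
theorem printed_collarDecay (N : ℕ) {a β δ s : ℝ} {α : ℕ → ℝ} (ha : 0 ≤ a) (hβ : 0 ≤ β) (hα : ∀ n, 0 < α n)
    (hδ : 0 ≤ δ) (hδ1 : δ ≤ 1) (hs : s ≤ 1 / 2) :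
    CollarDecay (expChart N δ s (printedR a β α)) ((expGauge N).rescale α hα) (8 * a * s) δ :=
  exp_collarDecay N hα hδ hδ1 hs ha fun j n _ _ => printedR_le ha hβ hα j n

/-- `MarginCauchy` (`c₀ = 2`) FOR THE PRINTED RADII [folklore]: `exp_marginCauchy` with `printed_pathFits` and positive rooms. -/
theorem printed_marginCauchy (N : ℕ) {a β δ s : ℝ} {α : ℕ → ℝ} (ha : 0 < a) (hβ : 0 < β) (hβ1 : β ≤ 1)
    (hα : ∀ n, 0 < α n) (hδ : 0 ≤ δ) (hδ2 : δ ≤ 1 / 2) (hs0 : 0 ≤ s) (hs : s ≤ β / 4) (W : Set (ℕ → ℝ)) (κ : ℝ) :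
    MarginCauchy (expGeneration N) (expChart N δ s (printedR a β α)) W κ (ExpAdmT N (printedR a β α)) (expGauge N)
      (printedGap N a β α) 2 :=
  exp_marginCauchy N hδ (by linarith) (by linarith) (printed_pathFits N ha hβ.le hβ1 hα hδ hδ2 hs0 hs)
    (fun X Y hYX j _ => printedGap_pos N ha hβ hα X Y hYX j) W κ

/-- **END-TO-END ON THE PRINTED RADII** [folklore]: for `0 < a`, `0 < β ≤ 1`, `α > 0` layer-dependent, `0 ≤ δ ≤ ½`,
`0 ≤ s ≤ β/64`, the exponential layered model satisfies §10's `FluctDampedOne` (parent module) with the layered profile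
`layeredSigma (layCarriers N) (64·s/β) δ 2` — obtained THROUGH §12g's `fluctDampedOne_of_collar_normalized` (unit `a/2`, `ρ = 2`
EXACTLY, `δρ ≤ 1` from `δ ≤ ½`, smallness `2ε ≤ g₀` i.e. `16as ≤ aβ/4` i.e. `s ≤ β/64`) from `printed_marginCauchy` and
`printed_collarDecay`, the coefficient `2·(8as)/((a/2)β/2) = 64s/β`.  What this certifies: the binders `MarginCauchy` (via a
DERIVED path frame), `GapShape` (printed radii, layer-dependent coefficients) and `CollarDecay` (normalized gauge) of §12/§12g are
JOINTLY INHABITED by a non-affine chart, and the machine runs end to end on them; `printed_fluct_witness` shows the bound is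
about a nonzero quantity.  It certifies NOTHING about Bałaban's objects; NE5B stays NOT PRINTED. -/
theorem printed_fluctDampedOne (N : ℕ) {a β δ s : ℝ} {α : ℕ → ℝ} (ha : 0 < a) (hβ : 0 < β) (hβ1 : β ≤ 1)
    (hα : ∀ n, 0 < α n) (hδ : 0 ≤ δ) (hδ2 : δ ≤ 1 / 2) (hs0 : 0 ≤ s) (hs : s ≤ β / 64) (W : Set (ℕ → ℝ)) (κ : ℝ) :
    FluctDampedOne (expGeneration N) (expChart N δ s (printedR a β α)) W κ (ExpAdmT N (printedR a β α))
      (layeredSigma (layCarriers N) (64 * s / β) δ 2) := by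
  have hs4 : s ≤ β / 4 := by linarith
  have hs2 : s ≤ 1 / 2 := by linarith
  have hMC := printed_marginCauchy N ha hβ hβ1 hα hδ hδ2 hs0 hs4 W κ
  have hCD := printed_collarDecay N ha.le hβ.le hα hδ (by linarith) hs2
  have h := fluctDampedOne_of_collar_normalized (a := a / 2) (β := β) hα hMC hCD (by norm_num) (half_pos ha) hβ
    (by positivity) hδ hδ2 (by nlinarith)
  have hcoef : 2 * (8 * a * s) / (a / 2 * β / 2) = 64 * s / β := by
    field_simp
    ring
  rw [hcoef] at h
  exact h

/-! ### §13f SHARPNESS: the fit is necessary; the chord; the halving bounds the decay; a witness -/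

/-- **THE FIT IS NECESSARY** [folklore]: for positive radii, nonnegative gaps and `s ≥ 0`, §12f's `FramePath` for the
exponential chart (ANY layer gauge `lg` — only the endpoint clause is used) FORCES `PathFits`: were `R X m·e^{sδ^{X−m}} +
gap X Y (Y − m) > R Y m` for some parent `Y < X` and layer `m ≤ Y`, take the one-layer core background `r·e_m` with
`max(0, (R Y m − gap)/e^{sδ^{X−m}}) < r < R X m` (`exists_between`) and the real amplitude `s`; the endpoint `γ 1 = ` the
displaced point must be a margin point, but adding the gap vector `gap·e_m` to it leaves the parent's polydisc on the layer `m`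
(`r·e^{sδ^{X−m}} + gap ≥ R Y m`).  So (F-P) on this model holds iff the fit does — the hypothesis shape has an exact price. -/
theorem pathFits_of_framePath (N : ℕ) {δ s : ℝ} {R : ℕ → ℕ → ℝ} {gap : Fin (N + 1) → Fin (N + 1) → ℕ → ℝ}
    {lg : LayerGauge (layCarriers N)} (hs : 0 ≤ s) (hR : ∀ j n, 0 < R j n) (hgap : ∀ X Y j, 0 ≤ gap X Y j)
    (hP : FramePath (expFrame N δ R) (expGeneration N) (expChart N δ s R) lg gap) :
    PathFits N R gap δ s := by
  intro X Y hYX m hmY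
  have hYX' : (Y : ℕ) < X := hYX
  have hmY' : (m : ℕ) ≤ Y := hmY
  have hmX : (m : ℕ) ≤ X := by omega
  by_contra hlt
  rw [not_le] at hlt
  set q : ℝ := s * δ ^ ((X : ℕ) - m) with hq
  set g : ℝ := gap X Y ((Y : ℕ) - m) with hg
  have hE : 0 < Real.exp q := Real.exp_pos q
  have hg0 : 0 ≤ g := hgap _ _ _
  -- the modulus of the core point on the layer m
  obtain ⟨r, hr1, hr2⟩ := exists_between (show max 0 ((R Y m - g) / Real.exp q) < R X m from
    max_lt (hR _ _) (by rw [div_lt_iff₀ hE]; linarith))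
  have hr0 : 0 ≤ r := le_trans (le_max_left _ _) hr1.le
  have hrq : R Y m - g < r * Real.exp q := by
    have h1 := lt_of_le_of_lt (le_max_right _ _) hr1
    rwa [div_lt_iff₀ hE] at h1
  -- the core point, the amplitude, the endpoint of the posited path
  set z : Fin (N + 1) → ℂ := Function.update (fun _ => (0 : ℂ)) m (r : ℂ) with hz
  have hzcore : (expFrame N δ R).pt z 0 ∈ (expChart N δ s R).core X := by
    intro k hk
    show ‖z k‖ < R X k
    by_cases hkm : k = m
    · subst hkm
      rw [hz, Function.update_self, Complex.norm_real, Real.norm_of_nonneg hr0]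
      exact hr2
    · rw [hz, Function.update_of_ne hkm, norm_zero]
      exact hR _ _
  obtain ⟨γ, γ', _, hγ1, _, hγm, _⟩ := hP X z 0 hzcore (s : ℂ) (real_mem_supp N hs X)
  have hend := hγm 1 ⟨zero_le_one, le_rfl⟩
  rw [hγ1] at hend
  -- the test vector: the gap on the layer m, zero elsewhere
  set v : Fin (N + 1) → ℂ := Function.update (fun _ => (0 : ℂ)) m (g : ℂ) with hv
  have hvgap : ∀ j ∈ range ((layCarriers N).scale Y + 1),
      (expFrame N δ R).semi ((layCarriers N).scale Y - j) v ≤ gap X Y j := by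
    intro j hj
    have hjY : j ≤ (Y : ℕ) := Nat.lt_succ_iff.mp (mem_range.mp hj)
    have hYN : (Y : ℕ) ≤ N := Nat.lt_succ_iff.mp Y.isLt
    rw [expFrame_semi]
    show ‖v (lay N ((Y : ℕ) - j))‖ ≤ gap X Y j
    by_cases hjm : (Y : ℕ) - j = (m : ℕ)
    · have hj' : (Y : ℕ) - m = j := by omega
      rw [hjm, lay_coe, hv, Function.update_self, Complex.norm_real, Real.norm_of_nonneg hg0, hg, hj']
    · have hne : lay N ((Y : ℕ) - j) ≠ m := fun h => hjm (by rw [← h, lay_val_of_le (by omega)])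
      rw [hv, Function.update_of_ne hne, norm_zero]
      exact hgap _ _ _
  have hdom := hend Y ((mem_parents_iff X Y).mpr hYX) v hvgap
  have hlayer : ‖(z + (expFrame N δ R).disp X z (s : ℂ) + v) m‖ < R Y m := hdom m hmY'
  have hval : (z + (expFrame N δ R).disp X z (s : ℂ) + v) m = ((r * Real.exp q + g : ℝ) : ℂ) := by
    show z m + z m * (Complex.exp ((s : ℂ) * (cw δ X m : ℂ)) - 1) + v m = ((r * Real.exp q + g : ℝ) : ℂ)
    rw [hz, hv, Function.update_self, Function.update_self, cw_of_le δ hmX, hq]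
    push_cast
    ring
  rw [hval, Complex.norm_real, Real.norm_of_nonneg (by positivity)] at hlayer
  linarith

/-- **(F-P) ⟺ THE FIT** on the exponential layered model (`0 ≤ δ ≤ 1`, `0 ≤ s ≤ ½`, positive radii, nonnegative gaps)
[folklore]: `exp_framePath` and `pathFits_of_framePath`. -/
theorem exp_framePath_iff (N : ℕ) {δ s : ℝ} {R : ℕ → ℕ → ℝ} {gap : Fin (N + 1) → Fin (N + 1) → ℕ → ℝ}
    (hδ : 0 ≤ δ) (hδ1 : δ ≤ 1) (hs0 : 0 ≤ s) (hs : s ≤ 1 / 2) (hR : ∀ j n, 0 < R j n)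
    (hgap : ∀ X Y j, 0 ≤ gap X Y j) :
    FramePath (expFrame N δ R) (expGeneration N) (expChart N δ s R) (expGauge N) gap ↔ PathFits N R gap δ s :=
  ⟨pathFits_of_framePath N hs0 hR hgap, exp_framePath N hδ hδ1 hs⟩

/-- The PLAIN layer gauge [bookkeeping]: `dist n U′ U = ‖U′_n − U_n‖` (factor `1`; `expGauge = 4·chordGauge`). [folklore] -/
noncomputable def chordGauge (N : ℕ) : LayerGauge (layCarriers N) where
  dist := fun n U' U => ‖U'.1 (lay N n) - U.1 (lay N n)‖
  dist_nonneg := fun _ _ _ => norm_nonneg _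
  dist_self := fun _ _ => by simp

/-- [bookkeeping] [folklore] -/
@[simp] theorem chordGauge_dist {N : ℕ} (n : ℕ) (U' U : (Fin (N + 1) → ℂ) × Fin 2) :
    (chordGauge N).dist n U' U = ‖U'.1 (lay N n) - U.1 (lay N n)‖ := rfl

/-- [bookkeeping] [folklore] -/
theorem expGauge_eq_four_mul {N : ℕ} (n : ℕ) (U' U : (Fin (N + 1) → ℂ) × Fin 2) :
    (expGauge N).dist n U' U = 4 * (chordGauge N).dist n U' U := rfl

/-- (F-G) for the plain gauge [folklore]: the layer seminorm of the displacement IS the plain gauge reading (equality). -/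
theorem exp_frameGauge_chord (N : ℕ) (δ s : ℝ) (R : ℕ → ℕ → ℝ) :
    FrameGauge (expFrame N δ R) (expChart N δ s R) (chordGauge N) := by
  intro X z i _ 𝒜 _ n
  rw [expFrame_semi, chordGauge_dist]
  show ‖z (lay N n) * (Complex.exp (𝒜 * (cw δ X (lay N n) : ℂ)) - 1)‖ ≤
    ‖z (lay N n) * Complex.exp (𝒜 * (cw δ X (lay N n) : ℂ)) - z (lay N n)‖
  rw [mul_sub, mul_one]

/-- **THE CHORD IS A PATH FRAME TOO, FACTOR 1** [folklore]: under the same fit (`0 ≤ δ`; no bound on `s` needed) the STRAIGHT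
segment from `z` to the displaced point (§12f's `framePath_of_segment`) consists of margin points — its layer-`m` coordinate is
`z_m(1 + t(e^{w_m} − 1)) = z_m((1 − t) + t e^{w_m})`, of modulus `≤ ‖z_m‖·e^{sδ^{X−m}}` by convexity — and its constant
velocity is read exactly by `chordGauge`.  MORAL, for the hand-off: (F-P) does not see WHICH path is used; print's path
((3.4) p. 270, `B(t)`) is curved in any encoding and an endpoint gauge then pays a constant (`4` here, crude), while a chord —
available whenever the encoded domains are convex along it — pays `1`; the constant enters only `ε` of `CollarDecay`. -/
theorem exp_framePath_chord (N : ℕ) {δ s : ℝ} {R : ℕ → ℕ → ℝ} {gap : Fin (N + 1) → Fin (N + 1) → ℕ → ℝ}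
    (hδ : 0 ≤ δ) (hfit : PathFits N R gap δ s) :
    FramePath (expFrame N δ R) (expGeneration N) (expChart N δ s R) (chordGauge N) gap := by
  refine framePath_of_segment (exp_frameGauge_chord N δ s R) fun X z i hz 𝒜 h𝒜 t ht => ?_
  intro Y hY v hv m hm
  have hYX : Y < X := (mem_parents_iff X Y).mp hY
  have hmX : (m : ℕ) ≤ X := le_trans hm (le_of_lt hYX)
  have ht0 : 0 ≤ t := ht.1
  have ht1 : t ≤ 1 := ht.2
  have h𝒜' : ‖𝒜‖ ≤ s := mem_closedBall_zero_iff.mp h𝒜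
  have hs0 : 0 ≤ s := (norm_nonneg 𝒜).trans h𝒜'
  have hzm : ‖z m‖ < R X m := hz m hmX
  have hj : (Y : ℕ) - m ∈ range ((layCarriers N).scale Y + 1) := mem_range.mpr (by
    show (Y : ℕ) - m < (Y : ℕ) + 1; omega)
  have hvm : ‖v m‖ ≤ gap X Y ((Y : ℕ) - m) := by
    have h1 := hv ((Y : ℕ) - m) hj
    rw [expFrame_semi] at h1
    have h2 : (layCarriers N).scale Y - ((Y : ℕ) - m) = (m : ℕ) := by
      show (Y : ℕ) - ((Y : ℕ) - m) = (m : ℕ); omega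
    rwa [h2, lay_coe] at h1
  set wm : ℂ := 𝒜 * (cw δ X m : ℂ) with hwm
  have hwn : ‖wm‖ ≤ s * δ ^ ((X : ℕ) - m) := by
    rw [hwm, norm_mul, Complex.norm_real, cw_of_le δ hmX, Real.norm_of_nonneg (pow_nonneg hδ _)]
    exact mul_le_mul_of_nonneg_right h𝒜' (pow_nonneg hδ _)
  set q : ℝ := s * δ ^ ((X : ℕ) - m) with hq
  have hE1 : 1 ≤ Real.exp q := Real.one_le_exp (by positivity)
  have hE2 : ‖Complex.exp wm‖ ≤ Real.exp q := (norm_exp_le_exp_norm wm).trans (Real.exp_le_exp.mpr hwn)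
  -- the chord point's layer-m factor
  have key : ‖1 + (t : ℂ) * (Complex.exp wm - 1)‖ ≤ Real.exp q := by
    have h1 : 1 + (t : ℂ) * (Complex.exp wm - 1) = ((1 - t : ℝ) : ℂ) + (t : ℂ) * Complex.exp wm := by
      push_cast; ring
    rw [h1]
    calc ‖((1 - t : ℝ) : ℂ) + (t : ℂ) * Complex.exp wm‖ ≤ ‖((1 - t : ℝ) : ℂ)‖ + ‖(t : ℂ) * Complex.exp wm‖ :=
          norm_add_le _ _
      _ = (1 - t) + t * ‖Complex.exp wm‖ := by
          rw [Complex.norm_real, Real.norm_of_nonneg (by linarith), norm_mul, Complex.norm_real,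
            Real.norm_of_nonneg ht0]
      _ ≤ (1 - t) * Real.exp q + t * Real.exp q := by nlinarith
      _ = Real.exp q := by ring
  show ‖(z + (t : ℂ) • (fun m => z m * (Complex.exp (𝒜 * (cw δ X m : ℂ)) - 1)) + v) m‖ < R Y m
  have hpt : (z + (t : ℂ) • (fun m => z m * (Complex.exp (𝒜 * (cw δ X m : ℂ)) - 1)) + v) m =
      z m * (1 + (t : ℂ) * (Complex.exp wm - 1)) + v m := by
    simp only [Pi.add_apply, Pi.smul_apply, smul_eq_mul, hwm]
    ring
  rw [hpt]
  calc ‖z m * (1 + (t : ℂ) * (Complex.exp wm - 1)) + v m‖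
        ≤ ‖z m * (1 + (t : ℂ) * (Complex.exp wm - 1))‖ + ‖v m‖ := norm_add_le _ _
    _ = ‖z m‖ * ‖1 + (t : ℂ) * (Complex.exp wm - 1)‖ + ‖v m‖ := by rw [norm_mul]
    _ < R X m * Real.exp q + gap X Y ((Y : ℕ) - m) := by
        have h3 : ‖z m‖ * ‖1 + (t : ℂ) * (Complex.exp wm - 1)‖ ≤ ‖z m‖ * Real.exp q :=
          mul_le_mul_of_nonneg_left key (norm_nonneg _)
        have h4 : ‖z m‖ * Real.exp q < R X m * Real.exp q := mul_lt_mul_of_pos_right hzm (Real.exp_pos q)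
        linarith
    _ ≤ R Y m := hfit X Y hYX m hm

/-- **THE HALVING BOUNDS THE DISPLACEMENT'S DECAY: `δ ≤ ½` IS FORCED UNIFORMLY IN THE DEPTH** [folklore]: on the printed radii
with `0 ≤ β < 1` (print: `β = 1/4`), `a > 0`, `α > 0` and ANY fixed amplitude room `s > 0`, if the fit holds at every depth `N`
then `δ ≤ ½`.  From the top collar alone (`X = N`, `Y = N − 1`, layer `m = 0`): `shrink β N·(e^{sδ^N} − 1) ≤ ½(shrink β (N−1) −
shrink β N) = ½β·2^{−N}`, and `shrink β N ≥ 1 − β`, `e^{q} − 1 ≥ q`, so `(1 − β)s(2δ)^N ≤ β/2` for all `N` — impossible when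
`2δ > 1` (`pow_unbounded_of_one_lt`).  The model's quantitative face of p. 277: the margins' difference is *"exponentially
decreasing in the number of steps"* (ratio `½` per layer, the powers of `1/2` of (2.36)–(2.39)), so a displacement profile
geometric in the layer must decay at least as fast — the same product condition `δρ ≤ 1` (`ρ = 2`) that §12's
`fluctDampedOne_of_collar` needs for summability, here forced by the margins.  Print's decay (*"the exponential decay of the
minimizing function 𝐇_k"*, in the ξ-scale distance) is not a geometric-in-the-layer profile; the toy only fixes what "much
greater" must mean for one. (CONTEXT quotations; a toy theorem.) [cite: Balaban1988Convergent, (2.34)–(2.39) p.261, p.277] -/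
theorem half_of_printed_pathFits_all {a β δ s : ℝ} {α : ℕ → ℝ} (ha : 0 < a) (hβ : 0 ≤ β) (hβ1 : β < 1)
    (hα : ∀ n, 0 < α n) (hδ : 0 ≤ δ) (hs : 0 < s)
    (h : ∀ N : ℕ, PathFits N (printedR a β α) (printedGap N a β α) δ s) : δ ≤ 1 / 2 := by
  by_contra hlt
  rw [not_le] at hlt
  have h2δ : 1 < 2 * δ := by linarith
  -- the bound every depth N ≥ 1 imposes: (1 - β) s (2δ)^N ≤ β/2
  have bound : ∀ N : ℕ, 1 ≤ N → (1 - β) * s * (2 * δ) ^ N ≤ β / 2 := by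
    intro N hN
    have hfit := h N (Fin.last N) ⟨N - 1, by omega⟩ (by show N - 1 < N; omega) 0 (Fin.zero_le _)
    -- unfold the printed data at X = last, Y = N - 1, m = 0
    have e0 : ((0 : Fin (N + 1)) : ℕ) = 0 := rfl
    have eX : ((Fin.last N : Fin (N + 1)) : ℕ) = N := rfl
    simp only [printedR, printedGap, eX, e0, Nat.sub_zero] at hfit
    have e1 : N - (N - 1) + (N - 1) = N := by omega
    have e2 : N - 1 - (N - 1) = 0 := by omega
    rw [e1, e2] at hfit
    -- hfit : a * shrink β N * α 0 * exp (s * δ ^ N) + a / 2 * (shrink β (N - 1) - shrink β N) * α 0 ≤ a * shrink β (N - 1) * α 0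
    have hsucc : B14Radii.shrink β (N - 1) - B14Radii.shrink β N = β * (1 / 2 : ℝ) ^ N := by
      have := B14Radii.shrink_sub_succ β (N - 1)
      rwa [show N - 1 + 1 = N by omega] at this
    have hshN : 1 - β ≤ B14Radii.shrink β N := by
      unfold B14Radii.shrink
      have : (0 : ℝ) ≤ (1 / 2 : ℝ) ^ N := by positivity
      nlinarith
    have hq : s * δ ^ N ≤ Real.exp (s * δ ^ N) - 1 := by linarith [Real.add_one_le_exp (s * δ ^ N)]
    have hpos : 0 < a * α 0 := mul_pos ha (hα 0)
    -- divide by a α 0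
    have key : B14Radii.shrink β N * (Real.exp (s * δ ^ N) - 1) ≤ β * (1 / 2 : ℝ) ^ N / 2 := by
      rw [← hsucc]
      by_contra hk
      rw [not_le] at hk
      have := mul_lt_mul_of_pos_left hk hpos
      nlinarith
    have hδN : 0 ≤ δ ^ N := pow_nonneg hδ N
    have step : (1 - β) * (s * δ ^ N) ≤ β * (1 / 2 : ℝ) ^ N / 2 := by
      calc (1 - β) * (s * δ ^ N) ≤ B14Radii.shrink β N * (Real.exp (s * δ ^ N) - 1) :=
            mul_le_mul hshN hq (by positivity) ((sub_nonneg.mpr hβ1.le).trans hshN)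
        _ ≤ β * (1 / 2 : ℝ) ^ N / 2 := key
    -- multiply by 2^N
    have h2N : (0 : ℝ) < 2 ^ N := by positivity
    have hhalf : (1 / 2 : ℝ) ^ N * 2 ^ N = 1 := by rw [← mul_pow]; norm_num
    calc (1 - β) * s * (2 * δ) ^ N = (1 - β) * (s * δ ^ N) * 2 ^ N := by rw [mul_pow]; ring
      _ ≤ β * (1 / 2 : ℝ) ^ N / 2 * 2 ^ N := mul_le_mul_of_nonneg_right step h2N.le
      _ = β / 2 := by rw [div_mul_eq_mul_div, mul_assoc, hhalf, mul_one]
  -- but (2δ)^N is unbounded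
  have hc : 0 < (1 - β) * s := mul_pos (by linarith) hs
  obtain ⟨N, hN⟩ := pow_unbounded_of_one_lt (β / 2 / ((1 - β) * s) + 1) h2δ
  have hN1 : 1 ≤ N + 1 := by omega
  have hb := bound (N + 1) hN1
  have hmono : (2 * δ) ^ N ≤ (2 * δ) ^ (N + 1) := pow_le_pow_right₀ h2δ.le (by omega)
  have : (1 - β) * s * (2 * δ) ^ N ≤ β / 2 := le_trans (mul_le_mul_of_nonneg_left hmono hc.le) hb
  have h' : (2 * δ) ^ N ≤ β / 2 / ((1 - β) * s) := by rw [le_div_iff₀ hc]; linarith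
  linarith

/-- NON-VACUITY OF THE END-TO-END INSTANCE [folklore]: for `β < 1`, `δ, s > 0` and any genuine parent `Y < X` there is a core
background of the step `X` (one layer, modulus `min(R X Y/2, R Y Y/(2e^{sδ^{X−Y}}))`) at which the clip table's inserted
fluctuation difference at the real amplitude `s` is STRICTLY POSITIVE — the profile of `printed_fluctDampedOne` bounds a nonzero
quantity of an admissible (`expAdmT_topTable`), bounded (`topTable_abs_le`) table. -/
theorem printed_fluct_witness (N : ℕ) {a β δ s : ℝ} {α : ℕ → ℝ} (ha : 0 < a) (hβ : 0 ≤ β) (hβ1 : β < 1)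
    (hα : ∀ n, 0 < α n) (hδ : 0 < δ) (hs : 0 < s) {X Y : Fin (N + 1)} (hYX : Y < X) :
    ∃ U ∈ (expChart N δ s (printedR a β α)).core X,
      0 < fluct (expChart N δ s (printedR a β α)) (topTable N (printedR a β α)) X Y U (s : ℂ) () := by
  have hR : ∀ j n, 0 < printedR a β α j n := printedR_pos ha hβ hβ1 hα
  set q : ℝ := s * δ ^ ((X : ℕ) - Y) with hq
  have hE : 0 < Real.exp q := Real.exp_pos q
  have hE1 : 1 ≤ Real.exp q := Real.one_le_exp (by positivity)
  set r : ℝ := min (printedR a β α X Y / 2) (printedR a β α Y Y / (2 * Real.exp q)) with hr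
  have hr0 : 0 < r := lt_min (half_pos (hR _ _)) (div_pos (hR _ _) (by positivity))
  have hrX : r < printedR a β α X Y := lt_of_le_of_lt (min_le_left _ _) (by linarith [hR X Y])
  have hrY : r * Real.exp q < printedR a β α Y Y := by
    have h1 : r ≤ printedR a β α Y Y / (2 * Real.exp q) := min_le_right _ _
    rw [le_div_iff₀ (by positivity)] at h1
    nlinarith [hR Y Y]
  refine ⟨(Function.update (fun _ => (0 : ℂ)) Y (r : ℂ), 0), ?_, ?_⟩
  · intro m _
    show ‖Function.update (fun _ => (0 : ℂ)) Y (r : ℂ) m‖ < printedR a β α X m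
    by_cases hmY : m = Y
    · subst hmY
      rw [Function.update_self, Complex.norm_real, Real.norm_of_nonneg hr0.le]
      exact hrX
    · rw [Function.update_of_ne hmY, norm_zero]
      exact hR _ _
  · rw [topTable_fluct N hR hδ.le hs.le hYX hr0.le hrX hrY]
    exact topTable_fluct_pos hδ hs hr0 _

/-! ### §13g (F-M) IS THE STATIC FIT AND (F-E) IS THE FIT, BY NAME; §13f's chord path frame is an INSTANCE of §12h

The first satellite's §12h (`T4BoundaryRateCollar.framePath_iff_margins_of_convex`, v1.5) proves, for CONVEX encoded domains
and (F-G), that §12f's path hypothesis (F-P) is equivalent to the two static inclusions (F-M) ∧ (F-E).  On the exponential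
layered model both inclusions have an exact price: (F-M) ⟺ the STATIC fit `R X m + gap X Y (Y − m) ≤ R Y m` and (F-E) ⟺ the fit
`PathFits` (positive radii, nonnegative gaps, `0 ≤ δ`, `0 ≤ s`) — the cross-read opinion C-pv01-104 O-1 made a theorem about
`FrameEndMargin` BY NAME — so §13f's chord path frame `exp_framePath_chord` is re-derived through §12h, and on this model (F-P),
(F-E) and `PathFits` are ONE condition, which implies (F-M).  Toy theorems about the toy objects of §13a. [folklore] -/

/-- The encoded polydiscs are CONVEX [folklore]: coordinate-wise `‖a·x_m + b·y_m‖ ≤ a‖x_m‖ + b‖y_m‖ < R j m` for `a + b = 1`,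
`a, b ≥ 0`.  The ℝ-structure is the one §12h's `Convex ℝ (F.dom Y)` elaborates to (`NormedSpace.complexToReal`, definitionally
the coordinate-wise real action). -/
theorem convex_polydisc (N : ℕ) (R : ℕ → ℕ → ℝ) (j : ℕ) : Convex ℝ (polydisc N R j) := by
  intro x hx y hy a b ha hb hab m hm
  have hxm : ‖x m‖ < R j m := hx m hm
  have hym : ‖y m‖ < R j m := hy m hm
  have h1 : (a • x + b • y) m = (a : ℂ) * x m + (b : ℂ) * y m := by
    simp only [Pi.add_apply, Pi.smul_apply, Complex.real_smul]
  rw [h1]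
  calc ‖(a : ℂ) * x m + (b : ℂ) * y m‖ ≤ ‖(a : ℂ) * x m‖ + ‖(b : ℂ) * y m‖ := norm_add_le _ _
    _ = a * ‖x m‖ + b * ‖y m‖ := by
        rw [norm_mul, norm_mul, Complex.norm_real, Complex.norm_real, Real.norm_of_nonneg ha,
          Real.norm_of_nonneg hb]
    _ < R j m := by
        rcases ha.eq_or_lt with h | ha'
        · rw [← h, zero_add] at hab
          rw [← h, hab, zero_mul, one_mul, zero_add]
          exact hym
        · have h2 : a * ‖x m‖ < a * R j m := mul_lt_mul_of_pos_left hxm ha'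
          have h3 : b * ‖y m‖ ≤ b * R j m := mul_le_mul_of_nonneg_left hym.le hb
          have h4 : a * R j m + b * R j m = R j m := by rw [← add_mul, hab, one_mul]
          linarith

/-- Every parent's encoded domain of the model is convex — in the form §12h's `framePath_of_convex` consumes. [folklore] -/
theorem exp_dom_convex (N : ℕ) (δ : ℝ) (R : ℕ → ℕ → ℝ) (X : Fin (N + 1)) :
    ∀ Y ∈ (expGeneration N).parents X, Convex ℝ ((expFrame N δ R).dom Y) :=
  fun Y _ => convex_polydisc N R Y

/-- **THE STATIC FIT** [bookkeeping]: for every parent `Y < X` and every layer `m ≤ Y`, the step-`X` radius of the layer plus the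
circles' room on it fits inside the parent's radius, `R X m + gap X Y (Y − m) ≤ R Y m` — the fit `PathFits` WITHOUT the
displacement factor `e^{sδ^{X−m}}`; the model's face of the powers of 1/2 alone, p. 277 *"This is the reason for putting the powers
of 1/2 in the conditions (2.36)–(2.39). The analyticity domains become smaller after each step, but the difference is very small and
exponentially decreasing in the number of steps."* (ANALOGY; CONTEXT only; asserted for nothing of Bałaban's).
[cite: Balaban1988Convergent, (2.36)–(2.39) p.261, p.277] -/
def StaticFits (N : ℕ) (R : ℕ → ℕ → ℝ) (gap : Fin (N + 1) → Fin (N + 1) → ℕ → ℝ) : Prop :=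
  ∀ X Y : Fin (N + 1), Y < X → ∀ m : Fin (N + 1), m ≤ Y → R X m + gap X Y ((Y : ℕ) - m) ≤ R Y m

/-- The fit contains the static fit [folklore] (`e^{sδ^{X−m}} ≥ 1` for `s, δ ≥ 0`, nonnegative radii). -/
theorem staticFits_of_pathFits (N : ℕ) {δ s : ℝ} {R : ℕ → ℕ → ℝ} {gap : Fin (N + 1) → Fin (N + 1) → ℕ → ℝ}
    (hδ : 0 ≤ δ) (hs : 0 ≤ s) (hR : ∀ j n, 0 ≤ R j n) (hfit : PathFits N R gap δ s) : StaticFits N R gap := by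
  intro X Y hYX m hm
  have hE1 : 1 ≤ Real.exp (s * δ ^ ((X : ℕ) - m)) := Real.one_le_exp (by positivity)
  have h1 : R X m ≤ R X m * Real.exp (s * δ ^ ((X : ℕ) - m)) := le_mul_of_one_le_right (hR _ _) hE1
  linarith [hfit X Y hYX m hm]

/-- §12f's gap constraint of the parent `Y`, read on a layer `m ≤ scale Y` of the model [folklore]: `‖v_m‖ ≤ gap X Y (Y − m)`. -/
theorem norm_le_gap_of_layer (N : ℕ) {δ : ℝ} {R : ℕ → ℕ → ℝ} {gap : Fin (N + 1) → Fin (N + 1) → ℕ → ℝ}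
    {X Y m : Fin (N + 1)} (hm : (m : ℕ) ≤ Y) {v : Fin (N + 1) → ℂ}
    (hv : ∀ j ∈ range ((layCarriers N).scale Y + 1),
      (expFrame N δ R).semi ((layCarriers N).scale Y - j) v ≤ gap X Y j) :
    ‖v m‖ ≤ gap X Y ((Y : ℕ) - m) := by
  have hj : (Y : ℕ) - m ∈ range ((layCarriers N).scale Y + 1) := mem_range.mpr (by
    show (Y : ℕ) - m < (Y : ℕ) + 1; omega)
  have h1 := hv ((Y : ℕ) - m) hj
  rw [expFrame_semi] at h1
  have h2 : (layCarriers N).scale Y - ((Y : ℕ) - m) = (m : ℕ) := by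
    show (Y : ℕ) - ((Y : ℕ) - m) = (m : ℕ); omega
  rwa [h2, lay_coe] at h1

/-- The one-layer TEST VECTOR `gap X Y (Y − m)·e_m` obeys every gap constraint of the parent `Y` (nonnegative gaps). [folklore] -/
theorem update_gap_le (N : ℕ) {δ : ℝ} {R : ℕ → ℕ → ℝ} {gap : Fin (N + 1) → Fin (N + 1) → ℕ → ℝ}
    (hgap : ∀ X Y j, 0 ≤ gap X Y j) (X Y m : Fin (N + 1)) :
    ∀ j ∈ range ((layCarriers N).scale Y + 1),
      (expFrame N δ R).semi ((layCarriers N).scale Y - j)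
        (Function.update (fun _ => (0 : ℂ)) m ((gap X Y ((Y : ℕ) - m) : ℝ) : ℂ)) ≤ gap X Y j := by
  intro j hj
  have hjY : j ≤ (Y : ℕ) := Nat.lt_succ_iff.mp (mem_range.mp hj)
  have hYN : (Y : ℕ) ≤ N := Nat.lt_succ_iff.mp Y.isLt
  rw [expFrame_semi]
  show ‖Function.update (fun _ => (0 : ℂ)) m ((gap X Y ((Y : ℕ) - m) : ℝ) : ℂ) (lay N ((Y : ℕ) - j))‖ ≤ gap X Y j
  by_cases hjm : (Y : ℕ) - j = (m : ℕ)
  · have hj' : (Y : ℕ) - m = j := by omega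
    rw [hjm, lay_coe, Function.update_self, Complex.norm_real, Real.norm_of_nonneg (hgap _ _ _), hj']
  · have hne : lay N ((Y : ℕ) - j) ≠ m := fun h => hjm (by rw [← h, lay_val_of_le (by omega)])
    rw [Function.update_of_ne hne, norm_zero]
    exact hgap _ _ _

/-- The one-layer background `r·e_m`, `0 ≤ r < R X m`, is a core background of the step `X` (positive radii). [folklore] -/
theorem update_mem_core (N : ℕ) {δ s : ℝ} {R : ℕ → ℕ → ℝ} (hR : ∀ j n, 0 < R j n) (X m : Fin (N + 1))
    {r : ℝ} (hr0 : 0 ≤ r) (hr : r < R X m) :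
    (expFrame N δ R).pt (Function.update (fun _ => (0 : ℂ)) m (r : ℂ)) 0 ∈ (expChart N δ s R).core X := by
  intro k hk
  show ‖Function.update (fun _ => (0 : ℂ)) m (r : ℂ) k‖ < R X k
  by_cases hkm : k = m
  · subst hkm
    rw [Function.update_self, Complex.norm_real, Real.norm_of_nonneg hr0]
    exact hr
  · rw [Function.update_of_ne hkm, norm_zero]
    exact hR _ _

/-- **(F-M) ⟺ THE STATIC FIT** on the model (positive radii, nonnegative gaps; any `δ`, `s`) [folklore]: ⇐ by the triangle
inequality on each constrained layer (`‖z_m + w_m‖ < R X m + gap ≤ R Y m`); ⇒ by the one-layer test — were `R X m + gap > R Y m`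
for a parent `Y < X` and a layer `m ≤ Y`, the core background `r·e_m` with `max(0, R Y m − gap) < r < R X m` (`exists_between`)
plus the test vector `gap·e_m` leaves the parent's polydisc on the layer `m`. -/
theorem exp_frameMargin_iff_staticFits (N : ℕ) {δ s : ℝ} {R : ℕ → ℕ → ℝ}
    {gap : Fin (N + 1) → Fin (N + 1) → ℕ → ℝ} (hR : ∀ j n, 0 < R j n) (hgap : ∀ X Y j, 0 ≤ gap X Y j) :
    FrameMargin (expFrame N δ R) (expGeneration N) (expChart N δ s R) gap ↔ StaticFits N R gap := by
  constructor
  · intro hM X Y hYX m hmY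
    have hmY' : (m : ℕ) ≤ Y := hmY
    by_contra hlt
    rw [not_le] at hlt
    set g : ℝ := gap X Y ((Y : ℕ) - m) with hg
    have hg0 : 0 ≤ g := hgap _ _ _
    obtain ⟨r, hr1, hr2⟩ := exists_between (show max 0 (R Y m - g) < R X m from
      max_lt (hR _ _) (by linarith))
    have hr0 : 0 ≤ r := le_trans (le_max_left _ _) hr1.le
    have hrg : R Y m - g < r := lt_of_le_of_lt (le_max_right _ _) hr1
    set z : Fin (N + 1) → ℂ := Function.update (fun _ => (0 : ℂ)) m (r : ℂ) with hz
    have hdom := hM X Y ((mem_parents_iff X Y).mpr hYX) z 0 (update_mem_core N hR X m hr0 hr2) _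
      (update_gap_le N hgap X Y m)
    have hlayer : ‖(z + Function.update (fun _ => (0 : ℂ)) m ((g : ℝ) : ℂ)) m‖ < R Y m := hdom m hmY'
    have hval : (z + Function.update (fun _ => (0 : ℂ)) m ((g : ℝ) : ℂ)) m = ((r + g : ℝ) : ℂ) := by
      rw [Pi.add_apply, hz, Function.update_self, Function.update_self]
      push_cast
      ring
    rw [hval, Complex.norm_real, Real.norm_of_nonneg (by positivity)] at hlayer
    linarith
  · intro hS X Y hY z i hz w hw m hm
    have hYX : Y < X := (mem_parents_iff X Y).mp hY
    have hYX' : (Y : ℕ) < X := hYX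
    have hmX : (m : ℕ) ≤ X := by omega
    have hzm : ‖z m‖ < R X m := hz m hmX
    have hwm : ‖w m‖ ≤ gap X Y ((Y : ℕ) - m) := norm_le_gap_of_layer N hm hw
    show ‖(z + w) m‖ < R Y m
    rw [Pi.add_apply]
    calc ‖z m + w m‖ ≤ ‖z m‖ + ‖w m‖ := norm_add_le _ _
      _ < R X m + gap X Y ((Y : ℕ) - m) := by linarith
      _ ≤ R Y m := hS X Y hYX m hm

/-- **(F-E) ⟺ THE FIT** [folklore] — the cross-read opinion C-pv01-104 O-1 made a theorem BY NAME: on the exponential layered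
model (`0 ≤ δ`, `0 ≤ s`, positive radii, nonnegative gaps) §12h's end-margin shape `FrameEndMargin` is EXACTLY `PathFits`.
⇒ is the endpoint argument of §13f's `pathFits_of_framePath` run on (F-E) directly (the displaced point of the core background
`r·e_m` at the real amplitude `s` has layer-`m` modulus `r·e^{sδ^{X−m}}`; add the test vector `gap·e_m`); ⇐ is the endpoint
computation `‖z_m e^{w_m} + v_m‖ ≤ ‖z_m‖e^{sδ^{X−m}} + gap X Y (Y − m) < R Y m` (`‖e^u‖ ≤ e^{‖u‖}`).  The toy face of print's two
sentences keeping the END of the path in the space with room for the circles ([I] p. 273 *"We assume also that ε₁ is so small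
that 𝐇_j(B(t)) satisfies (3.14) with 1/3α₂ on the right-hand side."*; [III] p. 277) — CONTEXT only.
[cite: Balaban1987RG1, (3.14) p.272, p.273; Balaban1988Convergent, p.277] -/
theorem exp_frameEndMargin_iff_pathFits (N : ℕ) {δ s : ℝ} {R : ℕ → ℕ → ℝ}
    {gap : Fin (N + 1) → Fin (N + 1) → ℕ → ℝ} (hδ : 0 ≤ δ) (hs : 0 ≤ s) (hR : ∀ j n, 0 < R j n)
    (hgap : ∀ X Y j, 0 ≤ gap X Y j) :
    FrameEndMargin (expFrame N δ R) (expGeneration N) (expChart N δ s R) gap ↔ PathFits N R gap δ s := by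
  constructor
  · intro hE X Y hYX m hmY
    have hYX' : (Y : ℕ) < X := hYX
    have hmY' : (m : ℕ) ≤ Y := hmY
    have hmX : (m : ℕ) ≤ X := by omega
    by_contra hlt
    rw [not_le] at hlt
    set q : ℝ := s * δ ^ ((X : ℕ) - m) with hq
    set g : ℝ := gap X Y ((Y : ℕ) - m) with hg
    have hEq : 0 < Real.exp q := Real.exp_pos q
    have hg0 : 0 ≤ g := hgap _ _ _
    obtain ⟨r, hr1, hr2⟩ := exists_between (show max 0 ((R Y m - g) / Real.exp q) < R X m from
      max_lt (hR _ _) (by rw [div_lt_iff₀ hEq]; linarith))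
    have hr0 : 0 ≤ r := le_trans (le_max_left _ _) hr1.le
    have hrq : R Y m - g < r * Real.exp q := by
      have h1 := lt_of_le_of_lt (le_max_right _ _) hr1
      rwa [div_lt_iff₀ hEq] at h1
    set z : Fin (N + 1) → ℂ := Function.update (fun _ => (0 : ℂ)) m (r : ℂ) with hz
    have hend := hE X z 0 (update_mem_core N hR X m hr0 hr2) (s : ℂ) (real_mem_supp N hs X)
    have hdom := hend Y ((mem_parents_iff X Y).mpr hYX) _ (update_gap_le N hgap X Y m)
    have hlayer : ‖(z + (expFrame N δ R).disp X z (s : ℂ) +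
        Function.update (fun _ => (0 : ℂ)) m ((g : ℝ) : ℂ)) m‖ < R Y m := hdom m hmY'
    have hval : (z + (expFrame N δ R).disp X z (s : ℂ) + Function.update (fun _ => (0 : ℂ)) m ((g : ℝ) : ℂ)) m =
        ((r * Real.exp q + g : ℝ) : ℂ) := by
      show z m + z m * (Complex.exp ((s : ℂ) * (cw δ X m : ℂ)) - 1) +
          Function.update (fun _ => (0 : ℂ)) m ((g : ℝ) : ℂ) m = ((r * Real.exp q + g : ℝ) : ℂ)
      rw [hz, Function.update_self, Function.update_self, cw_of_le δ hmX, hq]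
      push_cast
      ring
    rw [hval, Complex.norm_real, Real.norm_of_nonneg (by positivity)] at hlayer
    linarith
  · intro hfit X z i hz 𝒜 h𝒜 Y hY v hv m hm
    have hYX : Y < X := (mem_parents_iff X Y).mp hY
    have hYX' : (Y : ℕ) < X := hYX
    have hmX : (m : ℕ) ≤ X := by omega
    have h𝒜' : ‖𝒜‖ ≤ s := mem_closedBall_zero_iff.mp h𝒜
    have hzm : ‖z m‖ < R X m := hz m hmX
    have hvm : ‖v m‖ ≤ gap X Y ((Y : ℕ) - m) := norm_le_gap_of_layer N hm hv
    set wm : ℂ := 𝒜 * (cw δ X m : ℂ) with hwm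
    set q : ℝ := s * δ ^ ((X : ℕ) - m) with hq
    have hwn : ‖wm‖ ≤ q := by
      rw [hwm, norm_mul, Complex.norm_real, cw_of_le δ hmX, Real.norm_of_nonneg (pow_nonneg hδ _)]
      exact mul_le_mul_of_nonneg_right h𝒜' (pow_nonneg hδ _)
    have hE2 : ‖Complex.exp wm‖ ≤ Real.exp q := (norm_exp_le_exp_norm wm).trans (Real.exp_le_exp.mpr hwn)
    show ‖(z + (fun m => z m * (Complex.exp (𝒜 * (cw δ X m : ℂ)) - 1)) + v) m‖ < R Y m
    have hpt : (z + (fun m => z m * (Complex.exp (𝒜 * (cw δ X m : ℂ)) - 1)) + v) m =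
        z m * Complex.exp wm + v m := by
      simp only [Pi.add_apply, hwm]
      ring
    rw [hpt]
    calc ‖z m * Complex.exp wm + v m‖ ≤ ‖z m * Complex.exp wm‖ + ‖v m‖ := norm_add_le _ _
      _ = ‖z m‖ * ‖Complex.exp wm‖ + ‖v m‖ := by rw [norm_mul]
      _ < R X m * Real.exp q + gap X Y ((Y : ℕ) - m) := by
          have h3 : ‖z m‖ * ‖Complex.exp wm‖ ≤ ‖z m‖ * Real.exp q :=
            mul_le_mul_of_nonneg_left hE2 (norm_nonneg _)
          have h4 : ‖z m‖ * Real.exp q < R X m * Real.exp q := mul_lt_mul_of_pos_right hzm (Real.exp_pos q)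
          linarith
      _ ≤ R Y m := hfit X Y hYX m hm

/-- (F-E) ⟹ (F-M) on the model [folklore]: the end margin, which carries the room `e^{sδ^{X−m}} ≥ 1`, contains the static one —
on this model the END inclusion is the only condition the margins impose. -/
theorem exp_frameMargin_of_frameEndMargin (N : ℕ) {δ s : ℝ} {R : ℕ → ℕ → ℝ}
    {gap : Fin (N + 1) → Fin (N + 1) → ℕ → ℝ} (hδ : 0 ≤ δ) (hs : 0 ≤ s) (hR : ∀ j n, 0 < R j n)
    (hgap : ∀ X Y j, 0 ≤ gap X Y j)
    (hE : FrameEndMargin (expFrame N δ R) (expGeneration N) (expChart N δ s R) gap) :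
    FrameMargin (expFrame N δ R) (expGeneration N) (expChart N δ s R) gap :=
  (exp_frameMargin_iff_staticFits N hR hgap).2 (staticFits_of_pathFits N hδ hs (fun j n => (hR j n).le)
    ((exp_frameEndMargin_iff_pathFits N hδ hs hR hgap).1 hE))

/-- **§13f's CHORD PATH FRAME RE-DERIVED AS AN INSTANCE OF §12h** [folklore]: `framePath_of_convex` applied to (F-G) for the chord
(`exp_frameGauge_chord`), the convex polydiscs (`exp_dom_convex`), (F-M) from the static fit and (F-E) from the fit.
CONSISTENCY: the same statement as §13f's `exp_framePath_chord` (which needs only `0 ≤ δ` — its direct segment estimate does not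
pass through (F-M)); as proofs of one proposition the two agree. -/
theorem exp_framePath_convex (N : ℕ) {δ s : ℝ} {R : ℕ → ℕ → ℝ} {gap : Fin (N + 1) → Fin (N + 1) → ℕ → ℝ}
    (hδ : 0 ≤ δ) (hs : 0 ≤ s) (hR : ∀ j n, 0 < R j n) (hgap : ∀ X Y j, 0 ≤ gap X Y j)
    (hfit : PathFits N R gap δ s) :
    FramePath (expFrame N δ R) (expGeneration N) (expChart N δ s R) (chordGauge N) gap :=
  framePath_of_convex (exp_frameGauge_chord N δ s R) (exp_dom_convex N δ R)
    ((exp_frameMargin_iff_staticFits N hR hgap).2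
      (staticFits_of_pathFits N hδ hs (fun j n => (hR j n).le) hfit))
    ((exp_frameEndMargin_iff_pathFits N hδ hs hR hgap).2 hfit)

/-- **(F-P) FOR THE CHORD ⟺ (F-M) ∧ (F-E) ON THE MODEL — NO SIGN HYPOTHESES** beyond `0 ≤ s` (the real amplitude `s` makes the
admissible amplitudes nonempty) [folklore]: literally §12h's `framePath_iff_margins_of_convex` on the convex polydisc encoding. -/
theorem exp_framePath_chord_iff_margins (N : ℕ) (δ : ℝ) {s : ℝ} (R : ℕ → ℕ → ℝ)
    (gap : Fin (N + 1) → Fin (N + 1) → ℕ → ℝ) (hs : 0 ≤ s) :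
    FramePath (expFrame N δ R) (expGeneration N) (expChart N δ s R) (chordGauge N) gap ↔
      FrameMargin (expFrame N δ R) (expGeneration N) (expChart N δ s R) gap ∧
        FrameEndMargin (expFrame N δ R) (expGeneration N) (expChart N δ s R) gap :=
  framePath_iff_margins_of_convex (exp_frameGauge_chord N δ s R) (exp_dom_convex N δ R)
    fun X => ⟨(s : ℂ), real_mem_supp N hs X⟩

/-- (F-P) for the chord ⟺ the fit (`0 ≤ δ`, `0 ≤ s`, positive radii, nonnegative gaps) [folklore]: §13f's `pathFits_of_framePath`
(any layer gauge) and `exp_framePath_chord`. -/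
theorem exp_framePath_chord_iff (N : ℕ) {δ s : ℝ} {R : ℕ → ℕ → ℝ} {gap : Fin (N + 1) → Fin (N + 1) → ℕ → ℝ}
    (hδ : 0 ≤ δ) (hs : 0 ≤ s) (hR : ∀ j n, 0 < R j n) (hgap : ∀ X Y j, 0 ≤ gap X Y j) :
    FramePath (expFrame N δ R) (expGeneration N) (expChart N δ s R) (chordGauge N) gap ↔ PathFits N R gap δ s :=
  ⟨pathFits_of_framePath N hs hR hgap, exp_framePath_chord N hδ⟩

/-- **ONE CONDITION** [folklore]: on the model (`0 ≤ δ`, `0 ≤ s`, positive radii, nonnegative gaps) the end-margin shape (F-E) and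
the path hypothesis (F-P) for the chord gauge are equivalent (both being the fit) — HAND-OFF MORAL for a CONVEX encoding: what an
instantiation owes for (F-P) is the endpoint inclusion (F-E), print's assumed ε₁-smallness of p. 273 NAMED as a coupling-side
conditional, and nothing path-shaped (§13h shows this moral is false without convexity). [cite: Balaban1987RG1, p.273] -/
theorem exp_frameEndMargin_iff_framePath_chord (N : ℕ) {δ s : ℝ} {R : ℕ → ℕ → ℝ}
    {gap : Fin (N + 1) → Fin (N + 1) → ℕ → ℝ} (hδ : 0 ≤ δ) (hs : 0 ≤ s) (hR : ∀ j n, 0 < R j n)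
    (hgap : ∀ X Y j, 0 ≤ gap X Y j) :
    FrameEndMargin (expFrame N δ R) (expGeneration N) (expChart N δ s R) gap ↔
      FramePath (expFrame N δ R) (expGeneration N) (expChart N δ s R) (chordGauge N) gap := by
  rw [exp_frameEndMargin_iff_pathFits N hδ hs hR hgap, exp_framePath_chord_iff N hδ hs hR hgap]

/-- … and for `0 ≤ δ ≤ 1`, `0 ≤ s ≤ ½` also equivalent to (F-P) for the endpoint gauge `expGauge` (×4) realised by print's KIND of
curved amplitude path (§13b's `exp_framePath`, §13f's `exp_framePath_iff`). [folklore] -/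
theorem exp_frameEndMargin_iff_framePath_exp (N : ℕ) {δ s : ℝ} {R : ℕ → ℕ → ℝ}
    {gap : Fin (N + 1) → Fin (N + 1) → ℕ → ℝ} (hδ : 0 ≤ δ) (hδ1 : δ ≤ 1) (hs0 : 0 ≤ s) (hs : s ≤ 1 / 2)
    (hR : ∀ j n, 0 < R j n) (hgap : ∀ X Y j, 0 ≤ gap X Y j) :
    FrameEndMargin (expFrame N δ R) (expGeneration N) (expChart N δ s R) gap ↔
      FramePath (expFrame N δ R) (expGeneration N) (expChart N δ s R) (expGauge N) gap := by
  rw [exp_frameEndMargin_iff_pathFits N hδ hs0 hR hgap, exp_framePath_iff N hδ hδ1 hs0 hs hR hgap]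

/-! ### §13h THE CONVEXITY BINDER OF §12h IS LOAD-BEARING: two toy frames on the Cauchy carriers of §8

Two NEGATIVE CONTROLS for the hand-off, on the one-dimensional carriers `cauchyCarriers` (§8) with §8's generation
`cauchyGeneration` (the piece `n + 1` has the single parent `n`) and constant gaps [folklore]:
(i) `twoDiscFrame` / `jumpChart`: every encoded domain the DISCONNECTED union of the unit discs about `0` and `3`, core `‖z‖ < ½`,
ONE admissible amplitude `3`, translation chart — (F-Ch), (F-Co), (F-G), (F-M), (F-E) HOLD, amplitudes nonempty, gaps positive, and
(F-P) FAILS (`jump_not_framePath`: an interpolation path is continuous, its real part takes the value `3/2` by the intermediate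
value theorem, and no margin point has real part `3/2`) — packaged as `margins_not_framePath`: the convexity hypothesis `hdom` of
§12h's `framePath_of_convex` / `framePath_iff_margins_of_convex` cannot be dropped, not even in favour of the other five shapes
jointly.
(ii) `annulusFrame` / `rotChart`: every encoded domain the ANNULUS `½ < ‖z‖ < 3/2` (connected, NOT convex), core `‖z − 1‖ < ⅛`,
ONE admissible amplitude `π`, the ROTATION chart `z ↦ z·e^{i𝒜}` (non-affine) — (F-P) HOLDS with the CURVED path `t ↦ z·e^{iπt}`
(velocity `π‖z‖ ≤ ` the gauge `2·‖−z − z‖ = 4‖z‖`, `Real.pi_le_four`), while the CHORD from `z` to the displaced point `−z` passes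
through `0 ∉ dom` at `t = ½` for `z = 1`: the segment hypothesis of §12f's `framePath_of_segment` FAILS and `Convex ℝ (dom Y)`
FAILS (`framePath_not_segment`).
MORAL (orientation for an instantiation; cross-read C-pv01-104 O-2 notes that (3.14)'s space is an intersection of seminorm balls
in the 𝐀-variable — convex in that coordinate — while on p. 261 (2.34)–(2.35) bound `|∂U − 1|`, `|∂𝐔 − 1|`, `|∂U_{p,X}(M˙(𝐔)) − 1|` for
the group-valued `𝐔 = U′U` and (2.36)–(2.37) bound the algebra-valued current, `|𝐉|`, `|𝐉_{p,X}(M˙(𝐔))|`; wording corrected in v1.3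
after the reader's own erratum E-pv01g19-1, C-pv01-108 D-2): an instantiation
of §12f on print's spaces must SAY which case its encoding is in — convex (then (F-P) costs exactly (F-M) ∧ (F-E): §12h, §13g),
connected but not convex (then (F-P) is MORE than the position of its two endpoints and print's curved path (3.4) p. 270 with its
velocity bound (3.9) p. 271 is genuinely needed — and still inhabitable, as (ii) shows), or disconnected along the displacement
(then no interpolation path exists and the device fails outright, as (i) shows).  Toy theorems about toy objects; nothing of
Bałaban's is claimed and no encoding of (2.34)–(2.39) is proposed here. [cite: Balaban1987RG1, (3.4) p.270, (3.9) p.271, (3.14) p.272;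
Balaban1988Convergent, (2.34)–(2.37) p.261] -/

/-- The JUMP chart [bookkeeping]: ONE admissible amplitude `3` for every output (a `FluctChart` need not admit its `zero`), core
`‖z‖ < ½`, the translation chart of §10b. [folklore] -/
noncomputable def jumpChart : FluctChart cauchyCarriers ℂ where
  supp := fun _ => {3}
  core := fun _ => {U | ‖U.1‖ < 1 / 2}
  chart := fun _ U 𝒜 => (U.1 + 𝒜, U.2)
  zero := 0
  chart_zero := fun _ U => by simp

/-- The TWO-DISC frame [bookkeeping]: `E = ℂ`, every layer seminorm the modulus, `pt z i = (z, i)`, displacement vector `𝒜`, and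
every encoded domain the DISCONNECTED union `ball 0 1 ∪ ball 3 1`. [folklore] -/
noncomputable def twoDiscFrame : CplxFrame cauchyCarriers ℂ ℂ where
  semi := fun _ => normSeminorm ℂ ℂ
  pt := fun z i => (z, i)
  disp := fun _ _ 𝒜 => 𝒜
  dom := fun _ => ball 0 1 ∪ ball 3 1

/-- (F-Ch) for the two-disc frame: the chart is the frame translation. [folklore] -/
theorem jump_frameChart : FrameChart twoDiscFrame jumpChart := fun _ _ _ _ _ _ => rfl

/-- (F-Co) for the two-disc frame: every background is an encoded point. [folklore] -/
theorem jump_frameCore : FrameCore twoDiscFrame jumpChart := fun _ U _ => ⟨U.1, U.2, rfl⟩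

/-- (F-G) for the two-disc frame and §12c's `shiftGauge`: the gauge reads exactly the modulus of the displacement. [folklore] -/
theorem jump_frameGauge : FrameGauge twoDiscFrame jumpChart shiftGauge := by
  intro X z i _ 𝒜 _ n
  simp [twoDiscFrame, jumpChart, shiftGauge]

/-- (F-M) for the two-disc frame, gap `½` [folklore]: the closed disc of radius `½` about a core point `‖z‖ < ½` lies in the LEFT
unit disc. -/
theorem jump_frameMargin :
    FrameMargin twoDiscFrame (cauchyGeneration (1 / 2) one_half_pos) jumpChart (fun _ _ _ => 1 / 2) := by
  intro X Y _ z i hz w hw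
  have h0 : ‖w‖ ≤ 1 / 2 := by simpa [twoDiscFrame] using hw 0 (by simp)
  have hz' : ‖z‖ < 1 / 2 := hz
  show z + w ∈ ball (0 : ℂ) 1 ∪ ball 3 1
  left
  rw [mem_ball, dist_zero_right]
  calc ‖z + w‖ ≤ ‖z‖ + ‖w‖ := norm_add_le _ _
    _ < 1 := by linarith

/-- (F-E) for the two-disc frame, gap `½` [folklore]: the displaced point `z + 3` of a core point carries its closed disc of radius
`½` inside the RIGHT unit disc. -/
theorem jump_frameEndMargin :
    FrameEndMargin twoDiscFrame (cauchyGeneration (1 / 2) one_half_pos) jumpChart (fun _ _ _ => 1 / 2) := by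
  intro X z i hz 𝒜 h𝒜 Y _ w hw
  have h𝒜' : 𝒜 = 3 := h𝒜
  have h0 : ‖w‖ ≤ 1 / 2 := by simpa [twoDiscFrame] using hw 0 (by simp)
  have hz' : ‖z‖ < 1 / 2 := hz
  show z + 𝒜 + w ∈ ball (0 : ℂ) 1 ∪ ball 3 1
  right
  rw [mem_ball, dist_eq_norm, h𝒜']
  have h1 : z + 3 + w - 3 = z + w := by ring
  rw [h1]
  calc ‖z + w‖ ≤ ‖z‖ + ‖w‖ := norm_add_le _ _
    _ < 1 := by linarith

/-- In §8's generation the piece `0` is the parent of the piece `1`. [bookkeeping] [folklore] -/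
theorem cauchy_zero_mem_parents_one (r : ℝ) (hr : 0 < r) : 0 ∈ (cauchyGeneration r hr).parents 1 := by
  show 0 ∈ (cauchyGeneration r hr).parents (0 + 1)
  rw [cauchy_parents_succ]
  exact mem_singleton_self 0

/-- **(F-P) FAILS FOR THE TWO-DISC FRAME** [folklore]: an interpolation path from the core point `0` (step `1`, amplitude `3`) to
the displaced point `3`, differentiable within `[0,1]` hence continuous there, has a point of real part `3/2` (intermediate value
theorem, `intermediate_value_Icc`); a margin point lies in the parent's domain (gap vector `0`), and no point of `ball 0 1 ∪ ball 3 1`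
has real part `3/2` (`|Re u| ≤ ‖u‖`). -/
theorem jump_not_framePath :
    ¬ FramePath twoDiscFrame (cauchyGeneration (1 / 2) one_half_pos) jumpChart shiftGauge (fun _ _ _ => 1 / 2) := by
  intro hP
  have hcore : twoDiscFrame.pt 0 0 ∈ jumpChart.core 1 := by
    show ‖(0 : ℂ)‖ < 1 / 2
    simp
  obtain ⟨γ, γ', h0, h1, hd, hm, -⟩ := hP 1 0 0 hcore 3 rfl
  have hcont : ContinuousOn (fun t => (γ t).re) (Set.Icc (0 : ℝ) 1) :=
    Complex.continuous_re.comp_continuousOn fun t ht => (hd t ht).continuousWithinAt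
  have h0' : (γ 0).re = 0 := by rw [h0]; simp
  have h1' : (γ 1).re = 3 := by
    rw [h1]
    show ((0 : ℂ) + 3).re = 3
    norm_num
  obtain ⟨t, ht, htre⟩ : ∃ t ∈ Set.Icc (0 : ℝ) 1, (γ t).re = 3 / 2 := by
    have h := intermediate_value_Icc zero_le_one hcont
    rw [h0', h1'] at h
    exact h ⟨by norm_num, by norm_num⟩
  have hmem : γ t ∈ ball (0 : ℂ) 1 ∪ ball 3 1 := by
    have h := hm t ht 0 (cauchy_zero_mem_parents_one _ _) 0 (fun j _ => by
      show ‖(0 : ℂ)‖ ≤ 1 / 2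
      simp)
    rw [add_zero] at h
    exact h
  rcases hmem with hb | hb
  · rw [mem_ball, dist_zero_right] at hb
    have h2 : |(γ t).re| ≤ ‖γ t‖ := Complex.abs_re_le_norm (γ t)
    rw [htre] at h2
    norm_num at h2
    linarith
  · rw [mem_ball, dist_eq_norm] at hb
    have h2 : |(γ t - 3).re| ≤ ‖γ t - 3‖ := Complex.abs_re_le_norm (γ t - 3)
    have h3 : (γ t - 3).re = 3 / 2 - 3 := by rw [Complex.sub_re, htre]; norm_num
    rw [h3] at h2
    norm_num at h2
    linarith

/-- **THE FIVE SHAPES, NONEMPTY AMPLITUDES AND POSITIVE GAPS DO NOT GIVE (F-P)** [folklore]: the convexity binder `hdom` of §12h's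
`framePath_of_convex` / `framePath_iff_margins_of_convex` is LOAD-BEARING — witness the two-disc frame. -/
theorem margins_not_framePath :
    ∃ (F : CplxFrame cauchyCarriers ℂ ℂ) (G : Generation cauchyCarriers) (ch : FluctChart cauchyCarriers ℂ)
      (lg : LayerGauge cauchyCarriers) (gap : ℕ → ℕ → ℕ → ℝ),
      FrameChart F ch ∧ FrameCore F ch ∧ FrameGauge F ch lg ∧ FrameMargin F G ch gap ∧ FrameEndMargin F G ch gap ∧
        (∀ X, (ch.supp X).Nonempty) ∧ (∀ X Y j, 0 < gap X Y j) ∧ ¬ FramePath F G ch lg gap :=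
  ⟨twoDiscFrame, cauchyGeneration (1 / 2) one_half_pos, jumpChart, shiftGauge, fun _ _ _ => 1 / 2,
    jump_frameChart, jump_frameCore, jump_frameGauge, jump_frameMargin, jump_frameEndMargin,
    fun _ => ⟨3, rfl⟩, fun _ _ _ => one_half_pos, jump_not_framePath⟩

/-- The ROTATION chart [bookkeeping]: ONE admissible amplitude `π`, core `‖z − 1‖ < ⅛`, and the NON-AFFINE chart `z ↦ z·e^{i𝒜}`
(`e^{i·0} = 1`). [folklore] -/
noncomputable def rotChart : FluctChart cauchyCarriers ℂ where
  supp := fun _ => {(Real.pi : ℂ)}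
  core := fun _ => {U | ‖U.1 - 1‖ < 1 / 8}
  chart := fun _ U 𝒜 => (U.1 * Complex.exp (Complex.I * 𝒜), U.2)
  zero := 0
  chart_zero := fun _ U => by simp

/-- The ANNULUS frame [bookkeeping]: `E = ℂ`, modulus seminorms, `pt z i = (z, i)`, displacement vector `z(e^{i𝒜} − 1)`, and every
encoded domain the annulus `ball 0 (3/2) ∖ closedBall 0 (1/2)` — connected, NOT convex. [folklore] -/
noncomputable def annulusFrame : CplxFrame cauchyCarriers ℂ ℂ where
  semi := fun _ => normSeminorm ℂ ℂ
  pt := fun z i => (z, i)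
  disp := fun _ z 𝒜 => z * (Complex.exp (Complex.I * 𝒜) - 1)
  dom := fun _ => ball 0 (3 / 2) \ closedBall 0 (1 / 2)

/-- The layer gauge of the rotation example [bookkeeping]: twice the modulus of the displacement (the factor a curved path read by
an endpoint gauge pays, cf. §13a's `expGauge`). [folklore] -/
noncomputable def rotGauge : LayerGauge cauchyCarriers where
  dist := fun _ U' U => 2 * ‖U'.1 - U.1‖
  dist_nonneg := fun _ _ _ => by positivity
  dist_self := fun _ U => by simp

/-- (F-Ch) for the annulus frame: `z·e^{i𝒜} = z + z(e^{i𝒜} − 1)`. [folklore] -/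
theorem rot_frameChart : FrameChart annulusFrame rotChart := by
  intro X z i _ 𝒜 _
  show (z * Complex.exp (Complex.I * 𝒜), i) = (z + z * (Complex.exp (Complex.I * 𝒜) - 1), i)
  congr 1
  ring

/-- (F-Co) for the annulus frame. [folklore] -/
theorem rot_frameCore : FrameCore annulusFrame rotChart := fun _ U _ => ⟨U.1, U.2, rfl⟩

/-- (F-G) for the annulus frame and `rotGauge`: `‖z(e^{i𝒜} − 1)‖ ≤ 2‖z·e^{i𝒜} − z‖`. [folklore] -/
theorem rot_frameGauge : FrameGauge annulusFrame rotChart rotGauge := by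
  intro X z i _ 𝒜 _ n
  show ‖z * (Complex.exp (Complex.I * 𝒜) - 1)‖ ≤ 2 * ‖z * Complex.exp (Complex.I * 𝒜) - z‖
  have h1 : z * Complex.exp (Complex.I * 𝒜) - z = z * (Complex.exp (Complex.I * 𝒜) - 1) := by ring
  rw [h1]
  linarith [norm_nonneg (z * (Complex.exp (Complex.I * 𝒜) - 1))]

/-- A core point `‖z − 1‖ < ⅛` has modulus in `(7/8, 9/8)`. [folklore] -/
theorem core_bounds {z : ℂ} (hz : ‖z - 1‖ < 1 / 8) : 7 / 8 < ‖z‖ ∧ ‖z‖ < 9 / 8 := by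
  have h1 : ‖z‖ ≤ ‖z - 1‖ + ‖(1 : ℂ)‖ := by
    calc ‖z‖ = ‖(z - 1) + 1‖ := by rw [sub_add_cancel]
      _ ≤ _ := norm_add_le _ _
  have h2 : ‖(1 : ℂ)‖ ≤ ‖z‖ + ‖z - 1‖ := by
    calc ‖(1 : ℂ)‖ = ‖z - (z - 1)‖ := by rw [sub_sub_cancel]
      _ ≤ _ := norm_sub_le _ _
  rw [norm_one] at h1 h2
  constructor <;> linarith

/-- A point of modulus in `(7/8, 9/8)` carries its closed disc of radius `¼` inside the annulus. [folklore] -/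
theorem mem_annulus {u w : ℂ} (hu1 : 7 / 8 < ‖u‖) (hu2 : ‖u‖ < 9 / 8) (hw : ‖w‖ ≤ 1 / 4) :
    u + w ∈ ball (0 : ℂ) (3 / 2) \ closedBall 0 (1 / 2) := by
  constructor
  · rw [mem_ball, dist_zero_right]
    calc ‖u + w‖ ≤ ‖u‖ + ‖w‖ := norm_add_le _ _
      _ < 3 / 2 := by linarith
  · rw [mem_closedBall, dist_zero_right, not_le]
    have h1 : ‖u‖ ≤ ‖u + w‖ + ‖w‖ := by
      calc ‖u‖ = ‖(u + w) - w‖ := by rw [add_sub_cancel_right]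
        _ ≤ ‖u + w‖ + ‖w‖ := norm_sub_le _ _
    linarith

/-- (F-M) for the annulus frame, gap `¼`. [folklore] -/
theorem rot_frameMargin :
    FrameMargin annulusFrame (cauchyGeneration (1 / 4) (by norm_num)) rotChart (fun _ _ _ => 1 / 4) := by
  intro X Y _ z i hz w hw
  have h0 : ‖w‖ ≤ 1 / 4 := by simpa [annulusFrame] using hw 0 (by simp)
  obtain ⟨hz1, hz2⟩ := core_bounds (show ‖z - 1‖ < 1 / 8 from hz)
  exact mem_annulus hz1 hz2 h0

/-- (F-E) for the annulus frame, gap `¼` [folklore]: the displaced point is `z·e^{iπ} = −z`, of the same modulus. -/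
theorem rot_frameEndMargin :
    FrameEndMargin annulusFrame (cauchyGeneration (1 / 4) (by norm_num)) rotChart (fun _ _ _ => 1 / 4) := by
  intro X z i hz 𝒜 h𝒜 Y _ w hw
  have h𝒜' : 𝒜 = (Real.pi : ℂ) := h𝒜
  have h0 : ‖w‖ ≤ 1 / 4 := by simpa [annulusFrame] using hw 0 (by simp)
  obtain ⟨hz1, hz2⟩ := core_bounds (show ‖z - 1‖ < 1 / 8 from hz)
  show z + z * (Complex.exp (Complex.I * 𝒜) - 1) + w ∈ ball (0 : ℂ) (3 / 2) \ closedBall 0 (1 / 2)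
  have h1 : z + z * (Complex.exp (Complex.I * 𝒜) - 1) = -z := by
    rw [h𝒜', mul_comm Complex.I, Complex.exp_pi_mul_I]; ring
  rw [h1]
  exact mem_annulus (by rwa [norm_neg]) (by rwa [norm_neg]) h0

/-- **(F-P) HOLDS FOR THE ANNULUS FRAME, BY A CURVED PATH** [folklore]: the rotation path `t ↦ z·e^{iπt}` (the restriction to
`[0,1] ⊂ ℝ ⊂ ℂ` of a holomorphic map, `HasDerivAt.cexp` + `hasDerivAt_comp_ofReal`) runs from `z` to `−z` through points of
modulus `‖z‖ ∈ (7/8, 9/8)` (`‖e^{ix}‖ = 1`), all margin points (`mem_annulus`); its velocity has modulus `π‖z‖ ≤ 4‖z‖ = ` the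
gauge reading `2‖−z − z‖` (`Real.pi_le_four`). -/
theorem rot_framePath :
    FramePath annulusFrame (cauchyGeneration (1 / 4) (by norm_num)) rotChart rotGauge (fun _ _ _ => 1 / 4) := by
  intro X z i hz 𝒜 h𝒜
  have h𝒜' : 𝒜 = (Real.pi : ℂ) := h𝒜
  subst h𝒜'
  obtain ⟨hz1, hz2⟩ := core_bounds (show ‖z - 1‖ < 1 / 8 from hz)
  set c : ℂ := Complex.I * (Real.pi : ℂ) with hc
  set Φ : ℂ → ℂ := fun ζ => z * Complex.exp (ζ * c) with hΦ
  set Φ' : ℂ → ℂ := fun ζ => z * (c * Complex.exp (ζ * c)) with hΦ'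
  have hderiv : ∀ ζ : ℂ, HasDerivAt Φ (Φ' ζ) ζ := by
    intro ζ
    have h1 : HasDerivAt (fun ζ : ℂ => ζ * c) c ζ := by simpa using (hasDerivAt_id ζ).mul_const c
    have h2 : HasDerivAt (fun ζ : ℂ => Complex.exp (ζ * c)) (Complex.exp (ζ * c) * c) ζ := h1.cexp
    refine (h2.const_mul z).congr_deriv ?_
    simp only [hΦ']
    ring
  have hnorm : ∀ t : ℝ, ‖Complex.exp ((t : ℂ) * c)‖ = 1 := by
    intro t
    have h1 : (t : ℂ) * c = ((t * Real.pi : ℝ) : ℂ) * Complex.I := by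
      rw [hc]; push_cast; ring
    rw [h1, Complex.norm_exp_ofReal_mul_I]
  refine ⟨fun t => Φ (t : ℂ), fun t => Φ' (t : ℂ), ?_, ?_, ?_, ?_, ?_⟩
  · simp [hΦ]
  · simp only [hΦ, Complex.ofReal_one, one_mul]
    show z * Complex.exp c = z + z * (Complex.exp (Complex.I * (Real.pi : ℂ)) - 1)
    rw [hc]
    ring
  · intro t _
    exact (hasDerivAt_comp_ofReal (hderiv (t : ℂ))).hasDerivWithinAt
  · intro t _ Y _ w hw
    have h0 : ‖w‖ ≤ 1 / 4 := by simpa [annulusFrame] using hw 0 (by simp)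
    have hu : ‖Φ (t : ℂ)‖ = ‖z‖ := by
      simp only [hΦ, norm_mul, hnorm, mul_one]
    show Φ (t : ℂ) + w ∈ ball (0 : ℂ) (3 / 2) \ closedBall 0 (1 / 2)
    exact mem_annulus (by rw [hu]; exact hz1) (by rw [hu]; exact hz2) h0
  · intro t _ n
    show ‖Φ' (t : ℂ)‖ ≤ 2 * ‖z * Complex.exp (Complex.I * (Real.pi : ℂ)) - z‖
    have hval : z * Complex.exp (Complex.I * (Real.pi : ℂ)) - z = ((-2 : ℝ) : ℂ) * z := by
      rw [mul_comm Complex.I, Complex.exp_pi_mul_I]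
      push_cast
      ring
    have hcn : ‖c‖ = Real.pi := by
      rw [hc, norm_mul, Complex.norm_I, Complex.norm_real, Real.norm_of_nonneg Real.pi_pos.le, one_mul]
    have h1 : ‖Φ' (t : ℂ)‖ = Real.pi * ‖z‖ := by
      have h2 : Φ' (t : ℂ) = z * (c * Complex.exp ((t : ℂ) * c)) := rfl
      rw [h2, norm_mul, norm_mul, hnorm, hcn]
      ring
    rw [hval, h1, norm_mul, Complex.norm_real, Real.norm_eq_abs, abs_neg, abs_two]
    nlinarith [Real.pi_le_four, norm_nonneg z]

/-- The annulus is NOT convex [folklore]: `1` and `−1` belong to it, their midpoint `0` does not. -/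
theorem annulus_not_convex (Y : ℕ) : ¬ Convex ℝ (annulusFrame.dom Y) := by
  intro h
  have h1 : (1 : ℂ) ∈ annulusFrame.dom Y := by
    show (1 : ℂ) ∈ ball (0 : ℂ) (3 / 2) \ closedBall 0 (1 / 2)
    constructor
    · rw [mem_ball, dist_zero_right, norm_one]; norm_num
    · rw [mem_closedBall, dist_zero_right, norm_one]; norm_num
  have h2 : (-1 : ℂ) ∈ annulusFrame.dom Y := by
    show (-1 : ℂ) ∈ ball (0 : ℂ) (3 / 2) \ closedBall 0 (1 / 2)
    constructor
    · rw [mem_ball, dist_zero_right, norm_neg, norm_one]; norm_num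
    · rw [mem_closedBall, dist_zero_right, norm_neg, norm_one]; norm_num
  have h3 := h h1 h2 (by norm_num : (0 : ℝ) ≤ 1 / 2) (by norm_num : (0 : ℝ) ≤ 1 / 2) (by norm_num)
  have h4 : (1 / 2 : ℝ) • (1 : ℂ) + (1 / 2 : ℝ) • (-1 : ℂ) = 0 := by
    rw [← Complex.coe_smul, ← Complex.coe_smul, smul_eq_mul, smul_eq_mul]
    push_cast
    ring
  rw [h4] at h3
  have h5 : (0 : ℂ) ∈ ball (0 : ℂ) (3 / 2) \ closedBall 0 (1 / 2) := h3
  exact h5.2 (mem_closedBall_self (by norm_num))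

/-- **THE CHORD LEAVES THE MARGIN SET** [folklore]: for the core point `z = 1` of the step `1` and the amplitude `π`, the chord
point at `t = ½` is `1 + ½(−1 − 1) = 0`, which is not even in the parent's encoded domain — the segment hypothesis of §12f's
`framePath_of_segment` fails for the annulus frame. -/
theorem rot_segment_fails :
    ¬ (∀ (X : ℕ) (z : ℂ) (i : Fin 2), annulusFrame.pt z i ∈ rotChart.core X → ∀ 𝒜 ∈ rotChart.supp X,
        ∀ t ∈ Set.Icc (0 : ℝ) 1, z + (t : ℂ) • annulusFrame.disp X z 𝒜 ∈
          marginPts annulusFrame (cauchyGeneration (1 / 4) (by norm_num)) (fun _ _ _ => 1 / 4) X) := by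
  intro h
  have hcore : annulusFrame.pt 1 0 ∈ rotChart.core 1 := by
    show ‖(1 : ℂ) - 1‖ < 1 / 8
    simp
  have hmid := h 1 1 0 hcore (Real.pi : ℂ) rfl (1 / 2) ⟨by norm_num, by norm_num⟩
  have hdom := hmid 0 (cauchy_zero_mem_parents_one _ _) 0 (fun j _ => by
    show ‖(0 : ℂ)‖ ≤ 1 / 4
    simp)
  have hval : (1 : ℂ) + (((1 / 2 : ℝ) : ℝ) : ℂ) • annulusFrame.disp 1 1 (Real.pi : ℂ) + 0 = 0 := by
    show (1 : ℂ) + (((1 / 2 : ℝ) : ℝ) : ℂ) • (1 * (Complex.exp (Complex.I * (Real.pi : ℂ)) - 1)) + 0 = 0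
    rw [mul_comm Complex.I, Complex.exp_pi_mul_I, smul_eq_mul]
    push_cast
    ring
  rw [hval] at hdom
  have h5 : (0 : ℂ) ∈ ball (0 : ℂ) (3 / 2) \ closedBall 0 (1 / 2) := hdom
  exact h5.2 (mem_closedBall_self (by norm_num))

/-- **(F-P) WITHOUT CONVEXITY AND WITHOUT THE CHORD** [folklore]: there is a frame on the Cauchy carriers satisfying all of (F-Ch),
(F-Co), (F-G), (F-M), (F-E) AND (F-P) whose encoded domains are NOT convex and for which the chord's segment hypothesis FAILS —
§12h's `framePath_of_convex` is not the only road to (F-P); print's kind of curved path is another, and for such encodings a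
necessary one.  Witness the annulus frame. -/
theorem framePath_not_segment :
    ∃ (F : CplxFrame cauchyCarriers ℂ ℂ) (G : Generation cauchyCarriers) (ch : FluctChart cauchyCarriers ℂ)
      (lg : LayerGauge cauchyCarriers) (gap : ℕ → ℕ → ℕ → ℝ),
      FrameChart F ch ∧ FrameCore F ch ∧ FrameGauge F ch lg ∧ FrameMargin F G ch gap ∧ FrameEndMargin F G ch gap ∧
        FramePath F G ch lg gap ∧ (∀ Y, ¬ Convex ℝ (F.dom Y)) ∧
        ¬ (∀ (X : ℕ) (z : ℂ) (i : Fin 2), F.pt z i ∈ ch.core X → ∀ 𝒜 ∈ ch.supp X,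
            ∀ t ∈ Set.Icc (0 : ℝ) 1, z + (t : ℂ) • F.disp X z 𝒜 ∈ marginPts F G gap X) :=
  ⟨annulusFrame, cauchyGeneration (1 / 4) (by norm_num), rotChart, rotGauge, fun _ _ _ => 1 / 4,
    rot_frameChart, rot_frameCore, rot_frameGauge, rot_frameMargin, rot_frameEndMargin, rot_framePath,
    annulus_not_convex, rot_segment_fails⟩

/-! ### §13i CONVEXITY BOUGHT BY SHRINKING: the frame shapes under a change of the encoded domains; a convex INNER CORE carrying
the two margins gives (F-P) and `MarginCauchy` for a NON-CONVEX encoding; the periodic «plaquette-like» domains of the layered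
model, their exact inner polydiscs of radii `log(1 + r)`, and the factor-2 radius loss

THE STRUCTURAL POINT [folklore].  Of the frame shapes of §12e/§12f/§12h three do not see the encoded domains `dom` at all —
(F-Ch), (F-Co), (F-G) (`frameChart_withDom_iff`, `frameCore_withDom_iff`, `frameGauge_withDom_iff`, for the domain
replacement `withDom F d`) —, three are MONOTONE in them — (F-M), (F-E), (F-P) (`frameMargin_mono`, `frameEndMargin_mono`,
`framePath_mono`, through `marginPts_mono`) —, (F-An) is ANTITONE (`frameAnalytic_anti`, `DifferentiableOn.mono`), and §12's
`MarginCauchy` does not mention the encoding and is antitone in the admissible class (`marginCauchy_anti`).  CONSEQUENCE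
(`framePath_of_convexCore`, `marginCauchy_of_convexCore`): §12h's convexity binder need not be asked of the encoded domains
`dom Y` themselves — it suffices that INSIDE each `dom Y` there is a CONVEX set `d Y` such that the shrunk encoding `withDom F d`
still carries the two static inclusions (F-M) and (F-E); then the ORIGINAL encoding has (F-P) (the chord through the core's
margin points, `segment_mem_marginPts`) and, with (F-An) on the original domains, `MarginCauchy` with `c₀ = 2`.  Convexity is
BOUGHT by shrinking, and the price is named: the margins are asked of the smaller sets.  NEGATIVE CONTROLS: neither toy frame of
§13h admits such a core (`jump_no_convexCore` — the displacement jumps between components; `rot_no_convexCore` — the chord of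
the rotation leaves the annulus), so the present case is a THIRD one, distinct from both.

THE TOY [folklore; the dictionary is an ANALOGY, print quoted for CONTEXT only].  On the layered carriers of §13a the
PLAQUETTE-LIKE encoded domains `plaqdisc N r j = {v | ‖exp(v_m) − 1‖ < r j m for m ≤ j}` — the toy reading of a constraint on
GROUP-valued variables, (2.34) p. 261 *"|∂U − 1|, |∂𝐔 − 1| < (1 − β(1 − 2^{−(j−n)}))α_{0,n}ξ²(Lⁿξ)^{−2}"*, pulled back to
Lie-algebra coordinates `∂U = exp(v)` — are invariant under `v_m ↦ v_m + 2πi` (`single_two_pi_mem_plaqdisc`) and therefore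
NEVER convex (`plaqdisc_not_convex'`, ALL radii — v1.3, cross-read C-pv01-108 D-1: for `r ≤ 2` `0` and `2πi·e_m` in, the midpoint
`πi·e_m` out, `‖e^{πi} − 1‖ = 2`, `plaqdisc_not_convex`; for `r > 1` `log(r − 1) + (π/2)i` and `log(r − 1) + (3π/2)i` in, the
midpoint's image `−(r − 1)` at distance exactly `r`, `plaqdisc_not_convex_of_one_lt`), for radii `≤ 1` not
even connected (`plaqdisc_not_isPreconnected`: the hyperplanes `Im v_m = π` are avoided, `not_mem_plaqdisc_of_im_eq_pi`), yet
they contain the CONVEX polydiscs of radii `logR r j m = log(1 + r j m)` (`polydisc_logR_subset`, by `‖e^u − 1‖ ≤ e^{‖u‖} − 1`),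
the LARGEST polydiscs inside (`logR_sharp`: the real point `log(1 + r)·e_m`).  The plaquette frame `plaqFrame N δ r` is the
exponential encoding of §13a at the shrunk radii with these domains (`withDom`); its convex core is `expFrame N δ (logR r)` by
`rfl` (`plaqFrame_core`), so the core's (F-M) and (F-E) are BY NAME (§13g) the static fit and the fit `PathFits N (logR r) gap δ s`
at the shrunk radii, and `plaq_framePath` / `plaq_marginCauchy` deliver (F-P) for the chord gauge and `MarginCauchy` (`c₀ = 2`)
for tables analytic on the non-convex plaquette-like domains (`PlaqAdmT`).  THE PRICE, named (`pathFits_logR_of_half`): for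
`0 < r ≤ 1` a fit of the UNSHRUNK radii into HALF the parent's radius gives the fit at the shrunk radii, since `log(1 + r) ≤ r`
(`logR_le`) and `r/2 ≤ log(1 + r)` (`half_le_logR`) — a factor `2` of the margins, uniformly in the layers.  PRINT STATES THIS
PRICE ITSELF, for matrices (one run; CONTEXT; v1.3): [B7] = [Balaban1985Averaging] p. 22, *"For matrices X satisfying |X − 1| ≦ ½,
we have"* (26) *"|log X| ≦ Σ_{n=1}^{∞} (1/n)|X − 1|ⁿ ≦ |X − 1|/(1 − |X − 1|) ≦ 2|X − 1|"*, (27) *"|X − 1| = |e^{log X} − 1| ≦ e^{|log X|} − 1 ≦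
e^{|log X|}|log X| ≦ 2|log X|"* — `polydisc_logR_subset` is (27)'s first inequality read on commuting scalar layers (where it is
sharp, `logR_sharp`), `logR_le` / `half_le_logR` the factors `2`; and [B7] p. 42 parametrises the neighbourhood on which its
averages are analytic by the Lie-algebra variable on a norm ball, *"U = U′U₀, U′ = e^{iηA′}, |A′| bounded by a small constant α₁"*,
with the group-coordinate description as the alternative: *"This neighborhood may be also described by the conditions"* (158)
*"|U − U₀| = |UU₀⁻¹ − 1| < α₁η"*.

HAND-OFF MORAL (orientation for an instantiation; it completes §13h's: cross-read C-pv01-104 O-2 observed that (3.14)'s space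
is an intersection of seminorm balls in the 𝐀-variable — convex in that coordinate — while on p. 261 (2.34)–(2.35) bound
`|∂U − 1|`, `|∂𝐔 − 1|`, `|∂U_{p,X}(M˙(𝐔)) − 1|` for the group-valued `𝐔 = U′U` and (2.36)–(2.37) the algebra-valued current `|𝐉|`,
`|𝐉_{p,X}(M˙(𝐔))|`; v1.3 wording, C-pv01-108 D-2).  An encoding of such constraints in Lie-algebra coordinates has periodic, hence non-convex (for small
radii disconnected) encoded domains; §12h / §13g are then applied NOT to those domains but to a convex inner core (a polydisc in
one period), at the cost of asking (F-M) / (F-E) of the core — i.e. the room of p. 277 *"This is the reason for putting the powers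
of 1/2 in the conditions (2.36)–(2.39). The analyticity domains become smaller after each step, but the difference is very small
and exponentially decreasing in the number of steps."* and the assumed smallness of [I] p. 273 *"We assume also that ε₁ is so
small that 𝐇_j(B(t)) satisfies (3.14) with 1/3α₂ on the right-hand side."* measured in the core, with a radius loss of the kind
`log(1 + r)` against `r`.  Toy theorems about toy objects: NOTHING is claimed here about the convexity, connectedness or shape of
print's spaces (2.34)–(2.39), no encoding of them is proposed, and NE5B stays NOT PRINTED.  (CAVEAT, v1.3: (2.34)–(2.35) bound
WORDS in the letters `exp iξA′(b)`, `U(b)` of p. 261 (i)/(iii) — nonlinear in the Lie-algebra field `A′` of (2.39) —, so (26)–(27)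
price a change of coordinates; the inclusion of a convex core `Σ‖A_i‖ < log(1 + r)` in a word constraint `‖w − 1‖ < r` survives
non-commutativity (tree: `Literature.Analysis.Calculus.norm_exp_sub_one_le`, `…B7Prop6Bound.prod_sub_one_norm_le`,
`…B7Transfer.path_product_sub_one_le`; header paragraph PRINT'S OWN COORDINATE DICTIONARY), its sharpness and the survival of the
printed margins do not follow and are not claimed.)
[cite: Balaban1988Convergent, (2.34)–(2.39) p.261, p.277; Balaban1987RG1, (3.14) p.272, p.273; Balaban1985Averaging, (26)–(31) p.22,
(158) p.42] -/

section Core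

variable {C : T4BoundaryCarrier.Carriers} {A : Type} {E : Type*} [NormedAddCommGroup E] [NormedSpace ℂ E]

/-- RESTRICTING / REPLACING THE ENCODED DOMAINS [bookkeeping]: the same encoding (seminorms, points, displacement) with the
encoded domains `d`. [folklore] -/
def withDom (F : CplxFrame C A E) (d : C.Dom → Set E) : CplxFrame C A E :=
  { F with dom := d }

/-- [bookkeeping] [folklore] -/
@[simp] theorem withDom_semi (F : CplxFrame C A E) (d : C.Dom → Set E) : (withDom F d).semi = F.semi := rfl

/-- [bookkeeping] [folklore] -/
@[simp] theorem withDom_pt (F : CplxFrame C A E) (d : C.Dom → Set E) : (withDom F d).pt = F.pt := rfl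

/-- [bookkeeping] [folklore] -/
@[simp] theorem withDom_disp (F : CplxFrame C A E) (d : C.Dom → Set E) : (withDom F d).disp = F.disp := rfl

/-- [bookkeeping] [folklore] -/
@[simp] theorem withDom_dom (F : CplxFrame C A E) (d : C.Dom → Set E) : (withDom F d).dom = d := rfl

/-- [bookkeeping] [folklore] -/
theorem withDom_self (F : CplxFrame C A E) : withDom F F.dom = F := rfl

/-- [bookkeeping] [folklore] -/
theorem withDom_withDom (F : CplxFrame C A E) (d d' : C.Dom → Set E) : withDom (withDom F d) d' = withDom F d' := rfl

/-- (F-Ch) DOES NOT SEE THE ENCODED DOMAINS. [folklore] -/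
theorem frameChart_withDom_iff (F : CplxFrame C A E) (d : C.Dom → Set E) (ch : FluctChart C A) :
    FrameChart (withDom F d) ch ↔ FrameChart F ch := Iff.rfl

/-- (F-Co) DOES NOT SEE THE ENCODED DOMAINS. [folklore] -/
theorem frameCore_withDom_iff (F : CplxFrame C A E) (d : C.Dom → Set E) (ch : FluctChart C A) :
    FrameCore (withDom F d) ch ↔ FrameCore F ch := Iff.rfl

/-- (F-G) DOES NOT SEE THE ENCODED DOMAINS. [folklore] -/
theorem frameGauge_withDom_iff (F : CplxFrame C A E) (d : C.Dom → Set E) (ch : FluctChart C A) (lg : LayerGauge C) :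
    FrameGauge (withDom F d) ch lg ↔ FrameGauge F ch lg := Iff.rfl

/-- MARGIN POINTS ARE MONOTONE IN THE ENCODED DOMAINS [folklore]: enlarging every parent's domain enlarges the margin set. -/
theorem marginPts_mono {F : CplxFrame C A E} {G : Generation C} {gap : C.Dom → C.Dom → ℕ → ℝ} {X : C.Dom}
    {d d' : C.Dom → Set E} (hsub : ∀ Y ∈ G.parents X, d Y ⊆ d' Y) :
    marginPts (withDom F d) G gap X ⊆ marginPts (withDom F d') G gap X :=
  fun _ hz Y hY w hw => hsub Y hY (hz Y hY w hw)

/-- (F-M) IS MONOTONE IN THE ENCODED DOMAINS. [folklore] -/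
theorem frameMargin_mono {F : CplxFrame C A E} {G : Generation C} {ch : FluctChart C A}
    {gap : C.Dom → C.Dom → ℕ → ℝ} {d d' : C.Dom → Set E} (hsub : ∀ Y, d Y ⊆ d' Y)
    (hM : FrameMargin (withDom F d) G ch gap) : FrameMargin (withDom F d') G ch gap :=
  fun X Y hY z i hz w hw => hsub Y (hM X Y hY z i hz w hw)

/-- (F-E) IS MONOTONE IN THE ENCODED DOMAINS. [folklore] -/
theorem frameEndMargin_mono {F : CplxFrame C A E} {G : Generation C} {ch : FluctChart C A}
    {gap : C.Dom → C.Dom → ℕ → ℝ} {d d' : C.Dom → Set E} (hsub : ∀ Y, d Y ⊆ d' Y)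
    (hE : FrameEndMargin (withDom F d) G ch gap) : FrameEndMargin (withDom F d') G ch gap :=
  fun X z i hz 𝒜 h𝒜 => marginPts_mono (fun Y _ => hsub Y) (hE X z i hz 𝒜 h𝒜)

/-- (F-P) IS MONOTONE IN THE ENCODED DOMAINS [folklore]: the same path, its points margin points of the larger encoding. -/
theorem framePath_mono {F : CplxFrame C A E} {G : Generation C} {ch : FluctChart C A} {lg : LayerGauge C}
    {gap : C.Dom → C.Dom → ℕ → ℝ} {d d' : C.Dom → Set E} (hsub : ∀ Y, d Y ⊆ d' Y)
    (hP : FramePath (withDom F d) G ch lg gap) : FramePath (withDom F d') G ch lg gap := by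
  intro X z i hz 𝒜 h𝒜
  obtain ⟨γ, γ', h0, h1, hd, hm, hv⟩ := hP X z i hz 𝒜 h𝒜
  exact ⟨γ, γ', h0, h1, hd, fun t ht => marginPts_mono (fun Y _ => hsub Y) (hm t ht), hv⟩

/-- (F-An) IS ANTITONE IN THE ENCODED DOMAINS [folklore]: a function complex differentiable on the larger domain is so on the
smaller (`DifferentiableOn.mono`), and reads the same tables there. -/
theorem frameAnalytic_anti {F : CplxFrame C A E} {W : Set (ℕ → ℝ)} {AdmT : (ℕ → ℝ) → BTable C C.BgB → Prop}
    {d d' : C.Dom → Set E} (hsub : ∀ Y, d Y ⊆ d' Y) (hAn : FrameAnalytic (withDom F d') W AdmT) :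
    FrameAnalytic (withDom F d) W AdmT := by
  intro g hg h hh Y a ha
  obtain ⟨hc, hdiff, hread⟩ := hAn g hg h hh Y a ha
  exact ⟨hc, hdiff.mono (hsub Y), fun w hw i => hread w (hsub Y hw) i⟩

/-- `MarginCauchy` IS ANTITONE IN THE ADMISSIBLE CLASS [folklore]: it is a statement about every admissible table. -/
theorem marginCauchy_anti {G : Generation C} {ch : FluctChart C A} {W : Set (ℕ → ℝ)} {κ : ℝ}
    {AdmT AdmT' : (ℕ → ℝ) → BTable C C.BgB → Prop} {lg : LayerGauge C} {gap : C.Dom → C.Dom → ℕ → ℝ} {c₀ : ℝ}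
    (himp : ∀ g h, AdmT' g h → AdmT g h) (hMC : MarginCauchy G ch W κ AdmT lg gap c₀) :
    MarginCauchy G ch W κ AdmT' lg gap c₀ :=
  fun g hg h hh => hMC g hg h (himp g h hh)

/-- A SEGMENT BETWEEN MARGIN POINTS OF A CONVEX ENCODING CONSISTS OF MARGIN POINTS [folklore] (`convex_marginPts`; the
ℝ-structure is `NormedSpace.complexToReal`, the real parameter entering through `ℝ ⊂ ℂ`). -/
theorem segment_mem_marginPts {F : CplxFrame C A E} {G : Generation C} {gap : C.Dom → C.Dom → ℕ → ℝ} {X : C.Dom}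
    (hdom : ∀ Y ∈ G.parents X, Convex ℝ (F.dom Y)) {z v : E} (h0 : z ∈ marginPts F G gap X)
    (h1 : z + v ∈ marginPts F G gap X) {t : ℝ} (ht : t ∈ Set.Icc (0 : ℝ) 1) :
    z + (t : ℂ) • v ∈ marginPts F G gap X := by
  have h := convex_marginPts hdom h0 h1 (sub_nonneg.2 ht.2) ht.1 (sub_add_cancel 1 t)
  have heq : z + (t : ℂ) • v = (1 - t) • z + t • (z + v) := by
    rw [Complex.coe_smul, smul_add, sub_smul, one_smul]; abel
  rw [heq]; exact h

/-- **A CONVEX INNER CORE GIVES (F-P)** [folklore]: if inside every parent's encoded domain `dom Y` there is a CONVEX set `d Y`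
such that the SHRUNK encoding `withDom F d` still satisfies the two static inclusions (F-M) and (F-E), then the ORIGINAL
encoding satisfies the path hypothesis (F-P) (gauge from (F-G)) — the chord runs through margin points of the core
(`framePath_of_convex` on the core), which are margin points of `F` (`framePath_mono`).  Convexity of `dom Y` itself is NOT
needed: it is BOUGHT by shrinking to `d`, at the price of the margins being asked of the smaller sets. -/
theorem framePath_of_convexCore {F : CplxFrame C A E} {G : Generation C} {ch : FluctChart C A} {lg : LayerGauge C}
    {gap : C.Dom → C.Dom → ℕ → ℝ} {d : C.Dom → Set E} (hG : FrameGauge F ch lg) (hsub : ∀ Y, d Y ⊆ F.dom Y)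
    (hconv : ∀ X : C.Dom, ∀ Y ∈ G.parents X, Convex ℝ (d Y)) (hM : FrameMargin (withDom F d) G ch gap)
    (hE : FrameEndMargin (withDom F d) G ch gap) : FramePath F G ch lg gap := by
  rw [← withDom_self F]
  exact framePath_mono hsub (framePath_of_convex ((frameGauge_withDom_iff F d ch lg).2 hG) hconv hM hE)

/-- **`MarginCauchy` FROM A CONVEX INNER CORE** [folklore]: (F-Ch), (F-Co), (F-G) for the encoding (they do not see the domains),
a convex inner core `d ⊆ dom` carrying (F-M) and (F-E), (F-An) on the ORIGINAL domains (antitone: it restricts to the core) and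
positive gaps give §12's `MarginCauchy` with `c₀ = 2` — §12f's `marginCauchy_of_pathFrame` run on the core encoding. -/
theorem marginCauchy_of_convexCore {F : CplxFrame C A E} {G : Generation C} {ch : FluctChart C A} {W : Set (ℕ → ℝ)}
    {κ : ℝ} {AdmT : (ℕ → ℝ) → BTable C C.BgB → Prop} {lg : LayerGauge C} {gap : C.Dom → C.Dom → ℕ → ℝ}
    {d : C.Dom → Set E} (hCh : FrameChart F ch) (hCo : FrameCore F ch) (hG : FrameGauge F ch lg)
    (hsub : ∀ Y, d Y ⊆ F.dom Y) (hconv : ∀ X : C.Dom, ∀ Y ∈ G.parents X, Convex ℝ (d Y))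
    (hM : FrameMargin (withDom F d) G ch gap) (hE : FrameEndMargin (withDom F d) G ch gap)
    (hAn : FrameAnalytic F W AdmT)
    (hgap : ∀ (X : C.Dom), ∀ Y ∈ G.parents X, ∀ j ∈ range (C.scale Y + 1), 0 < gap X Y j) :
    MarginCauchy G ch W κ AdmT lg gap 2 :=
  marginCauchy_of_pathFrame ((frameChart_withDom_iff F d ch).2 hCh) ((frameCore_withDom_iff F d ch).2 hCo)
    (framePath_of_convex ((frameGauge_withDom_iff F d ch lg).2 hG) hconv hM hE)
    (frameAnalytic_anti (d' := F.dom) hsub ((withDom_self F).symm ▸ hAn)) hgap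

/-- **NO CONVEX CORE RESCUES THE TWO-DISC FRAME** [folklore]: for §13h's jump chart no convex inner core `d ⊆ ball 0 1 ∪ ball 3 1`
carries both (F-M) and (F-E) — else `framePath_of_convexCore` would contradict `jump_not_framePath`.  Shrinking buys convexity only
where the displacement does not leave the component. -/
theorem jump_no_convexCore (d : ℕ → Set ℂ) (hsub : ∀ Y, d Y ⊆ twoDiscFrame.dom Y) (hconv : ∀ Y, Convex ℝ (d Y)) :
    ¬ (FrameMargin (withDom twoDiscFrame d) (cauchyGeneration (1 / 2) one_half_pos) jumpChart (fun _ _ _ => 1 / 2) ∧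
        FrameEndMargin (withDom twoDiscFrame d) (cauchyGeneration (1 / 2) one_half_pos) jumpChart (fun _ _ _ => 1 / 2)) :=
  fun h => jump_not_framePath (framePath_of_convexCore jump_frameGauge hsub (fun _ Y _ => hconv Y) h.1 h.2)

/-- **NO CONVEX CORE FOR THE ANNULUS FRAME EITHER** [folklore]: for §13h's rotation chart no convex inner core of the annulus
carries both (F-M) and (F-E) — the chord between the two endpoints would consist of margin points of the core
(`segment_mem_marginPts`), hence of the annulus frame (`marginPts_mono`), contradicting `rot_segment_fails`.  There the CURVED path
is genuinely needed; shrinking does not help. -/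
theorem rot_no_convexCore (d : ℕ → Set ℂ) (hsub : ∀ Y, d Y ⊆ annulusFrame.dom Y) (hconv : ∀ Y, Convex ℝ (d Y)) :
    ¬ (FrameMargin (withDom annulusFrame d) (cauchyGeneration (1 / 4) (by norm_num)) rotChart (fun _ _ _ => 1 / 4) ∧
        FrameEndMargin (withDom annulusFrame d) (cauchyGeneration (1 / 4) (by norm_num)) rotChart
          (fun _ _ _ => 1 / 4)) := by
  rintro ⟨hM, hE⟩
  refine rot_segment_fails fun X z i hz 𝒜 h𝒜 t ht => ?_
  have h0 : z ∈ marginPts (withDom annulusFrame d) (cauchyGeneration (1 / 4) (by norm_num)) (fun _ _ _ => 1 / 4) X :=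
    (frameMargin_iff_marginPts _ _ _ _).1 hM X z i hz
  have h1 := hE X z i hz 𝒜 h𝒜
  have hseg := segment_mem_marginPts (F := withDom annulusFrame d) (fun Y _ => hconv Y) h0 h1 ht
  rw [← withDom_self annulusFrame]
  exact marginPts_mono (fun Y _ => hsub Y) hseg

end Core

/-! #### §13i, the toy: the plaquette-like domains of the layered model, their inner polydiscs, the plaquette frame -/

/-- THE LOGARITHMIC RADIUS LOSS [bookkeeping]: `logR r j m = log(1 + r j m)` — the exact inradius of `{‖e^u − 1‖ < r j m}`. [folklore] -/
noncomputable def logR (r : ℕ → ℕ → ℝ) : ℕ → ℕ → ℝ := fun j m => Real.log (1 + r j m)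

/-- [bookkeeping] [folklore] -/
theorem logR_apply (r : ℕ → ℕ → ℝ) (j m : ℕ) : logR r j m = Real.log (1 + r j m) := rfl

/-- `0 < log(1 + r)` for `0 < r`. [folklore] -/
theorem logR_pos {r : ℕ → ℕ → ℝ} {j m : ℕ} (hr : 0 < r j m) : 0 < logR r j m := by
  rw [logR_apply]
  exact Real.log_pos (by linarith)

/-- THE LOSS IS A LOSS: `log(1 + r) ≤ r` (`−1 < r`). [folklore] -/
theorem logR_le {r : ℕ → ℕ → ℝ} {j m : ℕ} (hr : -1 < r j m) : logR r j m ≤ r j m := by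
  have h := Real.log_le_sub_one_of_pos (by linarith : 0 < 1 + r j m)
  rw [logR_apply]; linarith

/-- THE LOSS IS AT MOST A FACTOR `2` for `0 ≤ r ≤ 1`: `r/2 ≤ r/(1 + r) ≤ log(1 + r)` (`Real.one_sub_inv_le_log_of_pos`). [folklore] -/
theorem half_le_logR {r : ℕ → ℕ → ℝ} {j m : ℕ} (hr0 : 0 ≤ r j m) (hr1 : r j m ≤ 1) : r j m / 2 ≤ logR r j m := by
  have hpos : 0 < 1 + r j m := by linarith
  have h := Real.one_sub_inv_le_log_of_pos hpos
  have h1 : 1 - (1 + r j m)⁻¹ = r j m / (1 + r j m) := by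
    field_simp
    ring
  have h2 : r j m / 2 ≤ r j m / (1 + r j m) := div_le_div_of_nonneg_left hr0 hpos (by linarith)
  rw [logR_apply]; linarith

/-- THE PLAQUETTE-LIKE ENCODED DOMAIN of index `j` [bookkeeping]: the layers `m ≤ j` constrained through the EXPONENTIAL,
`‖exp(v_m) − 1‖ < r j m`, higher layers free — the toy reading of a constraint on GROUP-valued variables ((2.34) p. 261, quoted in
the section text) pulled back to Lie-algebra coordinates `∂U = exp(v)`: invariant under `v_m ↦ v_m + 2πi`, hence never convex (`plaqdisc_not_convex'`,
all radii) (ANALOGY; CONTEXT only; no encoding of (2.34)–(2.39) is proposed). [cite: Balaban1988Convergent, (2.34) p.261] -/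
def plaqdisc (N : ℕ) (r : ℕ → ℕ → ℝ) (j : ℕ) : Set (Fin (N + 1) → ℂ) :=
  {v | ∀ m : Fin (N + 1), (m : ℕ) ≤ j → ‖Complex.exp (v m) - 1‖ < r j m}

/-- **THE INNER POLYDISC** [folklore]: the polydisc of radii `log(1 + r)` lies inside the plaquette-like domain
(`‖e^u − 1‖ ≤ e^{‖u‖} − 1 < r`, `Complex.norm_exp_sub_sum_le_exp_norm_sub_sum` with one Taylor term; the same elementary bound is
landed elsewhere in the library as `Literature.Probability.LatticeModels.norm_cexp_sub_one_le_exp_norm_sub_one`, not imported here). -/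
theorem polydisc_logR_subset (N : ℕ) {r : ℕ → ℕ → ℝ} (hr : ∀ j m, 0 < r j m) (j : ℕ) :
    polydisc N (logR r) j ⊆ plaqdisc N r j := by
  intro v hv m hm
  have h1 : ‖v m‖ < Real.log (1 + r j m) := hv m hm
  have h2 : Real.exp ‖v m‖ < 1 + r j m := by
    calc Real.exp ‖v m‖ < Real.exp (Real.log (1 + r j m)) := Real.exp_lt_exp.2 h1
      _ = 1 + r j m := Real.exp_log (by linarith [hr j m])
  have h3 : ‖Complex.exp (v m) - 1‖ ≤ Real.exp ‖v m‖ - 1 := by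
    simpa [Finset.sum_range_one] using Complex.norm_exp_sub_sum_le_exp_norm_sub_sum (v m) 1
  show ‖Complex.exp (v m) - 1‖ < r j m
  linarith

/-- **THE INNER POLYDISC IS THE LARGEST** [folklore]: a polydisc (positive radii) inside the plaquette-like domain has radii
`≤ log(1 + r)` on every constrained layer — test the REAL point `log(1 + r j m)·e_m`, where `e^t − 1 = r j m` exactly.  The
logarithmic loss is the price of convexity-by-polydisc, not an artefact of the estimate. -/
theorem logR_sharp (N : ℕ) {r ρ : ℕ → ℕ → ℝ} {j : ℕ} (hr : ∀ m, 0 < r j m) (hρ : ∀ m, 0 < ρ j m)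
    (hsub : polydisc N ρ j ⊆ plaqdisc N r j) (m : Fin (N + 1)) (hm : (m : ℕ) ≤ j) : ρ j m ≤ logR r j m := by
  by_contra hlt
  rw [not_le] at hlt
  set t : ℝ := Real.log (1 + r j m) with ht
  have ht0 : 0 ≤ t := (Real.log_pos (by linarith [hr m])).le
  have hmem : (Pi.single m (t : ℂ) : Fin (N + 1) → ℂ) ∈ polydisc N ρ j := by
    intro k _
    by_cases hk : k = m
    · subst hk
      rw [Pi.single_eq_same, Complex.norm_real, Real.norm_of_nonneg ht0]
      exact hlt
    · rw [Pi.single_eq_of_ne hk, norm_zero]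
      exact hρ k
  have h := hsub hmem m hm
  rw [Pi.single_eq_same, ← Complex.ofReal_exp, ht, Real.exp_log (by linarith [hr m]), ← Complex.ofReal_one,
    ← Complex.ofReal_sub, Complex.norm_real, add_sub_cancel_left, Real.norm_of_nonneg (hr m).le] at h
  exact lt_irrefl _ h

/-- `0` is in every plaquette-like domain (positive radii). [folklore] -/
theorem zero_mem_plaqdisc (N : ℕ) {r : ℕ → ℕ → ℝ} {j : ℕ} (hr : ∀ m, 0 < r j m) :
    (0 : Fin (N + 1) → ℂ) ∈ plaqdisc N r j := fun m _ => by simpa using hr m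

/-- … and so is `2πi·e_{m₀}` (`e^{2πi} = 1`): the domains are `2πi`-PERIODIC in every layer. [folklore] -/
theorem single_two_pi_mem_plaqdisc (N : ℕ) {r : ℕ → ℕ → ℝ} {j : ℕ} (hr : ∀ m, 0 < r j m) (m₀ : Fin (N + 1)) :
    (Pi.single m₀ (2 * Real.pi * Complex.I) : Fin (N + 1) → ℂ) ∈ plaqdisc N r j := by
  intro m _
  by_cases hk : m = m₀
  · subst hk
    rw [Pi.single_eq_same, Complex.exp_two_pi_mul_I, sub_self, norm_zero]
    exact hr m
  · rw [Pi.single_eq_of_ne hk, Complex.exp_zero, sub_self, norm_zero]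
    exact hr m

/-- **THE PLAQUETTE-LIKE DOMAINS ARE NOT CONVEX** [folklore]: `0` and `2πi·e_{m₀}` belong, their midpoint `πi·e_{m₀}` does not
(`‖e^{πi} − 1‖ = 2 ≥ r j m₀`) — for any constrained layer `m₀ ≤ j` with `r j m₀ ≤ 2`. -/
theorem plaqdisc_not_convex (N : ℕ) {r : ℕ → ℕ → ℝ} {j : ℕ} (hr : ∀ m, 0 < r j m) (m₀ : Fin (N + 1))
    (hm₀ : (m₀ : ℕ) ≤ j) (hr2 : r j m₀ ≤ 2) : ¬ Convex ℝ (plaqdisc N r j) := by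
  intro h
  have h3 := h (zero_mem_plaqdisc N hr) (single_two_pi_mem_plaqdisc N hr m₀) (by norm_num : (0 : ℝ) ≤ 1 / 2)
    (by norm_num : (0 : ℝ) ≤ 1 / 2) (by norm_num)
  have h4 := h3 m₀ hm₀
  have h5 : ((1 / 2 : ℝ) • (0 : Fin (N + 1) → ℂ) +
      (1 / 2 : ℝ) • (Pi.single m₀ (2 * Real.pi * Complex.I) : Fin (N + 1) → ℂ)) m₀ = Real.pi * Complex.I := by
    rw [Pi.add_apply, Pi.smul_apply, Pi.smul_apply, Pi.zero_apply, smul_zero, zero_add, Pi.single_eq_same,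
      Complex.real_smul]
    push_cast
    ring
  rw [h5, Complex.exp_pi_mul_I] at h4
  norm_num at h4
  linarith

/-- On the hyperplane `Im v_{m₀} = π` the plaquette-like constraint of a constrained layer `m₀ ≤ j` with `r j m₀ ≤ 1` FAILS:
`‖e^u − 1‖ ≥ |Re(e^u − 1)| = e^{Re u} + 1 > 1` (`Complex.exp_re`, `cos π = −1`). [folklore] -/
theorem not_mem_plaqdisc_of_im_eq_pi (N : ℕ) {r : ℕ → ℕ → ℝ} {j : ℕ} (m₀ : Fin (N + 1)) (hm₀ : (m₀ : ℕ) ≤ j)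
    (hr1 : r j m₀ ≤ 1) {v : Fin (N + 1) → ℂ} (hv : (v m₀).im = Real.pi) : v ∉ plaqdisc N r j := by
  intro h
  have h1 := h m₀ hm₀
  have hre : (Complex.exp (v m₀) - 1).re = -(Real.exp (v m₀).re + 1) := by
    rw [Complex.sub_re, Complex.exp_re, hv, Real.cos_pi, Complex.one_re]; ring
  have h2 : |(Complex.exp (v m₀) - 1).re| ≤ ‖Complex.exp (v m₀) - 1‖ := Complex.abs_re_le_norm _
  rw [hre, abs_neg, abs_of_pos (by positivity)] at h2
  linarith [Real.exp_pos (v m₀).re]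

/-- **FOR RADII `≤ 1` THE PLAQUETTE-LIKE DOMAINS ARE NOT EVEN CONNECTED** [folklore]: `0` and `2πi·e_{m₀}` belong, and a
preconnected set containing both meets the hyperplane `Im v_{m₀} = π` (the intermediate value theorem for the continuous
function `v ↦ Im v_{m₀}`, `IsPreconnected.intermediate_value`), which the domain avoids.  CONTRAST with §13h(i): there
disconnectedness killed (F-P) because the displacement JUMPED between components; here core points and displaced points stay in
ONE inner polydisc and (F-P) holds (`plaq_framePath`) — what decides is where the two endpoints sit, not the connectedness of
`dom`. -/
theorem plaqdisc_not_isPreconnected (N : ℕ) {r : ℕ → ℕ → ℝ} {j : ℕ} (hr : ∀ m, 0 < r j m) (m₀ : Fin (N + 1))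
    (hm₀ : (m₀ : ℕ) ≤ j) (hr1 : r j m₀ ≤ 1) : ¬ IsPreconnected (plaqdisc N r j) := by
  intro h
  have hf : ContinuousOn (fun v : Fin (N + 1) → ℂ => (v m₀).im) (plaqdisc N r j) :=
    (Complex.continuous_im.comp (continuous_apply m₀)).continuousOn
  have hIcc := h.intermediate_value (zero_mem_plaqdisc N hr) (single_two_pi_mem_plaqdisc N hr m₀) hf
  have hpi : Real.pi ∈ Set.Icc ((fun v : Fin (N + 1) → ℂ => (v m₀).im) 0)
      ((fun v : Fin (N + 1) → ℂ => (v m₀).im) (Pi.single m₀ (2 * Real.pi * Complex.I))) := by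
    have him : (2 * (Real.pi : ℂ) * Complex.I).im = 2 * Real.pi := by simp
    simp only [Pi.zero_apply, Complex.zero_im, Pi.single_eq_same, him]
    constructor <;> linarith [Real.pi_pos]
  obtain ⟨v, hv, hvim⟩ := hIcc hpi
  exact not_mem_plaqdisc_of_im_eq_pi N m₀ hm₀ hr1 hvim hv

/-- The exponential frame's encoded domains ARE the polydiscs: replacing them by the polydiscs changes nothing (`rfl`).
[bookkeeping] [folklore] -/
theorem exp_withDom_polydisc (N : ℕ) (δ : ℝ) (R : ℕ → ℕ → ℝ) :
    withDom (expFrame N δ R) (fun Y => polydisc N R Y) = expFrame N δ R := rfl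

/-- THE PLAQUETTE FRAME [bookkeeping]: the exponential encoding of §13a at the SHRUNK radii `logR r` (seminorms, points,
displacement unchanged) with the encoded domains REPLACED by the plaquette-like domains `plaqdisc N r`. [folklore] -/
noncomputable def plaqFrame (N : ℕ) (δ : ℝ) (r : ℕ → ℕ → ℝ) : CplxFrame (layCarriers N) ℂ (Fin (N + 1) → ℂ) :=
  withDom (expFrame N δ (logR r)) (fun Y => plaqdisc N r Y)

/-- Its convex inner core is the exponential frame at the shrunk radii, by `rfl`. [bookkeeping] [folklore] -/
theorem plaqFrame_core (N : ℕ) (δ : ℝ) (r : ℕ → ℕ → ℝ) :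
    withDom (plaqFrame N δ r) (fun Y => polydisc N (logR r) Y) = expFrame N δ (logR r) := rfl

/-- [bookkeeping] [folklore] -/
theorem plaqFrame_dom (N : ℕ) (δ : ℝ) (r : ℕ → ℕ → ℝ) (Y : Fin (N + 1)) :
    (plaqFrame N δ r).dom Y = plaqdisc N r Y := rfl

/-- The plaquette frame's encoded domains are NOT convex (positive radii, `r j 0 ≤ 2`: the layer `0` is constrained at every
index). [folklore] -/
theorem plaq_dom_not_convex (N : ℕ) (δ : ℝ) {r : ℕ → ℕ → ℝ} (hr : ∀ j m, 0 < r j m) (hr2 : ∀ j, r j 0 ≤ 2)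
    (Y : Fin (N + 1)) : ¬ Convex ℝ ((plaqFrame N δ r).dom Y) := by
  rw [plaqFrame_dom]
  exact plaqdisc_not_convex N (hr Y) 0 (Nat.zero_le _) (hr2 Y)

/-- … while the inner cores are convex and inside. [folklore] -/
theorem plaq_core_subset (N : ℕ) (δ : ℝ) {r : ℕ → ℕ → ℝ} (hr : ∀ j m, 0 < r j m) (Y : Fin (N + 1)) :
    polydisc N (logR r) Y ⊆ (plaqFrame N δ r).dom Y :=
  polydisc_logR_subset N hr Y

/-- The ADMISSIBLE ONE-TABLE CLASS ON THE PLAQUETTE-LIKE DOMAINS [bookkeeping]: real components of ONE function complex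
differentiable on `plaqdisc N r Y` (the analogue of `ExpAdmT` on the larger, non-convex domains). [folklore] -/
def PlaqAdmT (N : ℕ) (r : ℕ → ℕ → ℝ) : (ℕ → ℝ) → BTable (layCarriers N) ((Fin (N + 1) → ℂ) × Fin 2) → Prop :=
  fun _ h => ∀ (Y : Fin (N + 1)) (a : Unit), ∃ hc : (Fin (N + 1) → ℂ) → ℂ,
    DifferentiableOn ℂ hc (plaqdisc N r Y) ∧ ∀ w ∈ plaqdisc N r Y, ∀ i : Fin 2, h Y (w, i) a = cpart i (hc w)

/-- (F-An) for the plaquette frame is the class's own wording. [folklore] -/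
theorem plaq_frameAnalytic (N : ℕ) (δ : ℝ) (r : ℕ → ℕ → ℝ) (W : Set (ℕ → ℝ)) :
    FrameAnalytic (plaqFrame N δ r) W (PlaqAdmT N r) :=
  fun _ _ _ hh Y a _ => hh Y a

/-- Tables analytic on the plaquette-like domains are analytic on the inner polydiscs: `PlaqAdmT N r ⊆ ExpAdmT N (logR r)`. [folklore] -/
theorem expAdmT_of_plaqAdmT (N : ℕ) {r : ℕ → ℕ → ℝ} (hr : ∀ j m, 0 < r j m) (g : ℕ → ℝ)
    (h : BTable (layCarriers N) ((Fin (N + 1) → ℂ) × Fin 2)) (hh : PlaqAdmT N r g h) : ExpAdmT N (logR r) g h := by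
  intro Y a
  obtain ⟨hc, hdiff, hread⟩ := hh Y a
  exact ⟨hc, hdiff.mono (polydisc_logR_subset N hr Y), fun w hw i => hread w (polydisc_logR_subset N hr Y hw) i⟩

/-- (F-Ch), (F-Co), (F-G) for the plaquette frame (domain-free: those of the exponential frame at radii `logR r`). [folklore] -/
theorem plaq_frameChart (N : ℕ) (δ s : ℝ) (r : ℕ → ℕ → ℝ) :
    FrameChart (plaqFrame N δ r) (expChart N δ s (logR r)) :=
  (frameChart_withDom_iff _ _ _).2 (exp_frameChart N δ s (logR r))

/-- [folklore] -/
theorem plaq_frameCore (N : ℕ) (δ s : ℝ) (r : ℕ → ℕ → ℝ) :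
    FrameCore (plaqFrame N δ r) (expChart N δ s (logR r)) :=
  (frameCore_withDom_iff _ _ _).2 (exp_frameCore N δ s (logR r))

/-- [folklore] -/
theorem plaq_frameGauge_chord (N : ℕ) (δ s : ℝ) (r : ℕ → ℕ → ℝ) :
    FrameGauge (plaqFrame N δ r) (expChart N δ s (logR r)) (chordGauge N) :=
  (frameGauge_withDom_iff _ _ _ _).2 (exp_frameGauge_chord N δ s (logR r))

/-- **(F-P) ON THE NON-CONVEX PLAQUETTE FRAME, FROM THE TWO MARGINS OF ITS CONVEX CORE** [folklore]: `framePath_of_convexCore`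
with the core = the polydiscs of radii `log(1 + r)`; the margins of the core are those of the exponential frame at the shrunk
radii, i.e. BY NAME (§13g) the static fit and the fit at radii `logR r`. -/
theorem plaq_framePath_of_margins (N : ℕ) {δ s : ℝ} {r : ℕ → ℕ → ℝ}
    {gap : Fin (N + 1) → Fin (N + 1) → ℕ → ℝ} (hr : ∀ j m, 0 < r j m)
    (hM : FrameMargin (expFrame N δ (logR r)) (expGeneration N) (expChart N δ s (logR r)) gap)
    (hE : FrameEndMargin (expFrame N δ (logR r)) (expGeneration N) (expChart N δ s (logR r)) gap) :
    FramePath (plaqFrame N δ r) (expGeneration N) (expChart N δ s (logR r)) (chordGauge N) gap :=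
  framePath_of_convexCore (d := fun Y => polydisc N (logR r) Y) (plaq_frameGauge_chord N δ s r)
    (fun Y => polydisc_logR_subset N hr Y) (fun _ Y _ => convex_polydisc N (logR r) Y)
    (by rw [plaqFrame_core]; exact hM) (by rw [plaqFrame_core]; exact hE)

/-- **(F-P) ON THE PLAQUETTE FRAME FROM THE FIT AT THE SHRUNK RADII** [folklore] (`0 ≤ δ`, `0 ≤ s`, positive radii, nonnegative
gaps): the fit `PathFits N (logR r) gap δ s` is (F-E) of the core (`exp_frameEndMargin_iff_pathFits`) and contains (F-M) of the
core (`staticFits_of_pathFits`, `exp_frameMargin_iff_staticFits`). -/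
theorem plaq_framePath (N : ℕ) {δ s : ℝ} {r : ℕ → ℕ → ℝ} {gap : Fin (N + 1) → Fin (N + 1) → ℕ → ℝ}
    (hδ : 0 ≤ δ) (hs : 0 ≤ s) (hr : ∀ j m, 0 < r j m) (hgap : ∀ X Y j, 0 ≤ gap X Y j)
    (hfit : PathFits N (logR r) gap δ s) :
    FramePath (plaqFrame N δ r) (expGeneration N) (expChart N δ s (logR r)) (chordGauge N) gap :=
  have hR : ∀ j n, 0 < logR r j n := fun j n => logR_pos (hr j n)
  plaq_framePath_of_margins N hr
    ((exp_frameMargin_iff_staticFits N hR hgap).2 (staticFits_of_pathFits N hδ hs (fun j n => (hR j n).le) hfit))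
    ((exp_frameEndMargin_iff_pathFits N hδ hs hR hgap).2 hfit)

/-- CONSISTENCY [folklore]: the same conclusion by monotonicity alone — §13f's chord path frame of the exponential encoding at
radii `logR r` (`exp_framePath_chord`, any `s`, `0 ≤ δ`) transported to the larger plaquette-like domains by `framePath_mono`. -/
theorem plaq_framePath' (N : ℕ) {δ s : ℝ} {r : ℕ → ℕ → ℝ} {gap : Fin (N + 1) → Fin (N + 1) → ℕ → ℝ}
    (hδ : 0 ≤ δ) (hr : ∀ j m, 0 < r j m) (hfit : PathFits N (logR r) gap δ s) :
    FramePath (plaqFrame N δ r) (expGeneration N) (expChart N δ s (logR r)) (chordGauge N) gap :=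
  framePath_mono (F := expFrame N δ (logR r)) (d := fun Y => polydisc N (logR r) Y)
    (fun Y => polydisc_logR_subset N hr Y) (by rw [exp_withDom_polydisc]; exact exp_framePath_chord N hδ hfit)

/-- **`MarginCauchy` (`c₀ = 2`) FOR TABLES ANALYTIC ON THE NON-CONVEX PLAQUETTE-LIKE DOMAINS** [folklore]: from the fit at the
shrunk radii, through the convex core (`marginCauchy_of_convexCore`). -/
theorem plaq_marginCauchy (N : ℕ) {δ s : ℝ} {r : ℕ → ℕ → ℝ} {gap : Fin (N + 1) → Fin (N + 1) → ℕ → ℝ}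
    (hδ : 0 ≤ δ) (hs : 0 ≤ s) (hr : ∀ j m, 0 < r j m)
    (hgap : ∀ X Y : Fin (N + 1), Y < X → ∀ j ∈ range ((Y : ℕ) + 1), 0 < gap X Y j) (hgap0 : ∀ X Y j, 0 ≤ gap X Y j)
    (hfit : PathFits N (logR r) gap δ s) (W : Set (ℕ → ℝ)) (κ : ℝ) :
    MarginCauchy (expGeneration N) (expChart N δ s (logR r)) W κ (PlaqAdmT N r) (chordGauge N) gap 2 :=
  have hR : ∀ j n, 0 < logR r j n := fun j n => logR_pos (hr j n)
  marginCauchy_of_convexCore (d := fun Y => polydisc N (logR r) Y) (plaq_frameChart N δ s r) (plaq_frameCore N δ s r)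
    (plaq_frameGauge_chord N δ s r) (fun Y => polydisc_logR_subset N hr Y) (fun _ Y _ => convex_polydisc N (logR r) Y)
    (by rw [plaqFrame_core]
        exact (exp_frameMargin_iff_staticFits N hR hgap0).2
          (staticFits_of_pathFits N hδ hs (fun j n => (hR j n).le) hfit))
    (by rw [plaqFrame_core]; exact (exp_frameEndMargin_iff_pathFits N hδ hs hR hgap0).2 hfit)
    (plaq_frameAnalytic N δ r W) fun X Y hY j hj => hgap X Y ((mem_parents_iff X Y).mp hY) j hj

/-- **THE PRICE: THE FIT AT THE SHRUNK RADII FROM A FIT WITH HALVED TARGET** [folklore]: for radii `0 < r ≤ 1`, if the UNSHRUNK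
radius inflated by the displacement factor plus the circles' room fits inside HALF the parent's unshrunk radius, then the fit holds
at the shrunk radii `logR r` (`log(1 + r) ≤ r` on the left, `r/2 ≤ log(1 + r)` on the right) — convexity bought for a factor `2`
of the margins. -/
theorem pathFits_logR_of_half (N : ℕ) {δ s : ℝ} {r : ℕ → ℕ → ℝ} {gap : Fin (N + 1) → Fin (N + 1) → ℕ → ℝ}
    (hr : ∀ j m, 0 < r j m) (hr1 : ∀ j m, r j m ≤ 1)
    (hhalf : ∀ X Y : Fin (N + 1), Y < X → ∀ m : Fin (N + 1), m ≤ Y →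
      r X m * Real.exp (s * δ ^ ((X : ℕ) - m)) + gap X Y ((Y : ℕ) - m) ≤ r Y m / 2) :
    PathFits N (logR r) gap δ s := by
  intro X Y hYX m hm
  have h1 : logR r X m * Real.exp (s * δ ^ ((X : ℕ) - m)) ≤ r X m * Real.exp (s * δ ^ ((X : ℕ) - m)) :=
    mul_le_mul_of_nonneg_right (logR_le (by linarith [hr X m])) (Real.exp_pos _).le
  have h2 : r Y m / 2 ≤ logR r Y m := half_le_logR (hr Y m).le (hr1 Y m)
  linarith [hhalf X Y hYX m hm]

/-! ### §13i — addendum (v1.3): THE PLAQUETTE-LIKE DOMAINS ARE NON-CONVEX FOR ALL RADII (cross-read C-pv01-108 D-1)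

`plaqdisc_not_convex` used the period (`0`, `2πi·e_{m₀}` in, `πi·e_{m₀}` out) and needs `r j m₀ ≤ 2`; for `r j m₀ > 1` the points
`log(r − 1) + (π/2)i`, `log(r − 1) + (3π/2)i` (images `±(r − 1)i`) are in and their midpoint (image `−(r − 1)`, at distance exactly
`r` from `1`) is out.  Together: no positive radius makes a constrained layer's domain convex. [folklore] -/

/-- The points `log(r − 1) + θi` at a constrained layer `m₀` with `cos θ = 0`, `sin²θ = 1` (images `±(r − 1)i`, at distance
`√(1 + (r − 1)²) < r` from `1` when `1 < r = r j m₀`) belong to the plaquette-like domain. [folklore] -/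
theorem single_log_mem_plaqdisc (N : ℕ) {r : ℕ → ℕ → ℝ} {j : ℕ} (hr : ∀ m, 0 < r j m) (m₀ : Fin (N + 1))
    (h1 : 1 < r j m₀) {θ : ℝ} (hc : Real.cos θ = 0) (hs : Real.sin θ ^ 2 = 1) :
    (Pi.single m₀ ((Real.log (r j m₀ - 1) : ℂ) + θ * Complex.I) : Fin (N + 1) → ℂ) ∈ plaqdisc N r j := by
  intro m _
  by_cases hk : m = m₀
  · rw [hk, Pi.single_eq_same]
    set a : ℝ := Real.log (r j m₀ - 1) with ha
    have hea : Real.exp a = r j m₀ - 1 := Real.exp_log (by linarith)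
    have hzre : ((a : ℂ) + θ * Complex.I).re = a := by simp
    have hzim : ((a : ℂ) + θ * Complex.I).im = θ := by simp
    have hre : (Complex.exp ((a : ℂ) + θ * Complex.I) - 1).re = -1 := by
      rw [Complex.sub_re, Complex.exp_re, Complex.one_re, hzre, hzim, hc]; ring
    have him : (Complex.exp ((a : ℂ) + θ * Complex.I) - 1).im = (r j m₀ - 1) * Real.sin θ := by
      rw [Complex.sub_im, Complex.exp_im, Complex.one_im, hzre, hzim, hea]; ring
    have hs' : Real.sin θ * Real.sin θ = 1 := by rw [← sq, hs]
    have hsq : ‖Complex.exp ((a : ℂ) + θ * Complex.I) - 1‖ ^ 2 = 1 + (r j m₀ - 1) ^ 2 := by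
      rw [← Complex.normSq_eq_norm_sq, Complex.normSq_apply, hre, him]
      linear_combination (r j m₀ - 1) ^ 2 * hs'
    refine not_le.mp fun hlt => ?_
    have h2 := mul_self_le_mul_self (le_of_lt (hr m₀)) hlt
    rw [← sq, ← sq, hsq] at h2
    nlinarith
  · rw [Pi.single_eq_of_ne hk, Complex.exp_zero, sub_self, norm_zero]
    exact hr m

/-- **NOT CONVEX FOR RADII `> 1` EITHER** [folklore]: `log(r − 1) + (π/2)i` and `log(r − 1) + (3π/2)i` belong
(`single_log_mem_plaqdisc`), their midpoint `log(r − 1) + πi` has image `−(r − 1)` at distance exactly `r` from `1`. -/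
theorem plaqdisc_not_convex_of_one_lt (N : ℕ) {r : ℕ → ℕ → ℝ} {j : ℕ} (hr : ∀ m, 0 < r j m) (m₀ : Fin (N + 1))
    (hm₀ : (m₀ : ℕ) ≤ j) (h1 : 1 < r j m₀) : ¬ Convex ℝ (plaqdisc N r j) := by
  intro h
  set a : ℝ := Real.log (r j m₀ - 1) with ha
  have hea : Real.exp a = r j m₀ - 1 := Real.exp_log (by linarith)
  have hp₁ := single_log_mem_plaqdisc N hr m₀ h1 (θ := Real.pi / 2) Real.cos_pi_div_two
    (by rw [Real.sin_pi_div_two]; norm_num)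
  have hp₂ := single_log_mem_plaqdisc N hr m₀ h1 (θ := Real.pi / 2 + Real.pi)
    (by rw [Real.cos_add_pi, Real.cos_pi_div_two, neg_zero]) (by rw [Real.sin_add_pi, Real.sin_pi_div_two]; norm_num)
  have h3 := h hp₁ hp₂ (by norm_num : (0 : ℝ) ≤ 1 / 2) (by norm_num : (0 : ℝ) ≤ 1 / 2) (by norm_num)
  have h4 := h3 m₀ hm₀
  have h5 : ((1 / 2 : ℝ) • (Pi.single m₀ ((a : ℂ) + (Real.pi / 2 : ℝ) * Complex.I) : Fin (N + 1) → ℂ) +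
      (1 / 2 : ℝ) • (Pi.single m₀ ((a : ℂ) + (Real.pi / 2 + Real.pi : ℝ) * Complex.I) : Fin (N + 1) → ℂ)) m₀ =
      (a : ℂ) + Real.pi * Complex.I := by
    rw [Pi.add_apply, Pi.smul_apply, Pi.smul_apply, Pi.single_eq_same, Pi.single_eq_same, Complex.real_smul,
      Complex.real_smul]
    push_cast
    ring
  rw [h5] at h4
  have hzre : ((a : ℂ) + Real.pi * Complex.I).re = a := by simp
  have hzim : ((a : ℂ) + Real.pi * Complex.I).im = Real.pi := by simp
  have hre : (Complex.exp ((a : ℂ) + Real.pi * Complex.I) - 1).re = -r j m₀ := by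
    rw [Complex.sub_re, Complex.exp_re, Complex.one_re, hzre, hzim, Real.cos_pi, hea]; ring
  have h6 : |(Complex.exp ((a : ℂ) + Real.pi * Complex.I) - 1).re| ≤ ‖Complex.exp ((a : ℂ) + Real.pi * Complex.I) - 1‖ :=
    Complex.abs_re_le_norm _
  rw [hre, abs_neg, abs_of_pos (hr m₀)] at h6
  linarith

/-- **THE PLAQUETTE-LIKE DOMAINS ARE NEVER CONVEX — ALL RADII** [folklore]: `plaqdisc_not_convex` (`r j m₀ ≤ 2`: `0`, `2πi·e_{m₀}`
in, `πi·e_{m₀}` out) and `plaqdisc_not_convex_of_one_lt` (`1 < r j m₀`) cover every positive radius of a constrained layer. -/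
theorem plaqdisc_not_convex' (N : ℕ) {r : ℕ → ℕ → ℝ} {j : ℕ} (hr : ∀ m, 0 < r j m) (m₀ : Fin (N + 1))
    (hm₀ : (m₀ : ℕ) ≤ j) : ¬ Convex ℝ (plaqdisc N r j) := by
  rcases le_or_gt (r j m₀) 2 with h2 | h2
  · exact plaqdisc_not_convex N hr m₀ hm₀ h2
  · exact plaqdisc_not_convex_of_one_lt N hr m₀ hm₀ (by linarith)

/-- … so NO encoded domain of the plaquette frame is convex, whatever the (positive) radii. [folklore] -/
theorem plaq_dom_not_convex' (N : ℕ) (δ : ℝ) {r : ℕ → ℕ → ℝ} (hr : ∀ j m, 0 < r j m) (Y : Fin (N + 1)) :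
    ¬ Convex ℝ ((plaqFrame N δ r).dom Y) := by
  rw [plaqFrame_dom]
  exact plaqdisc_not_convex' N (hr Y) 0 (Nat.zero_le _)

end Literature.MathematicalPhysics.QuantumFieldTheory.Balaban1983to89.T4BoundaryRateFrame
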